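import Literature.Analysis.FunctionSpaces.BMOCarlesonFeffermanStein
import Mathlib.MeasureTheory.Integral.PeakFunction
import Mathlib.MeasureTheory.Integral.DominatedConvergence
import Mathlib.Analysis.Calculus.BumpFunction.Convolution
import Mathlib.Data.Real.Sign
import HarnessLib

/-!
# Fefferman–Stein `Carleson ⇒ BMO` for the heat extension, by duality

Topic `Analysis/FunctionSpaces`; fourth file of the Koch–Tataru cluster
(`BMOCarleson.lean`: decomposition of `Literature.Analysis.FunctionSpaces.memBMOInv_iff_carleson_heat` (Koch–Tataru 2001,
Theorem 1) into the named facts (A)–(E); `BMOCarlesonProofs.lean`: (A), (C) discharged;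
`BMOCarlesonFeffermanStein.lean`: (B) from the John–Nirenberg inequality). This file **proves
fact (E)**, `Literature.BMOInv.memBMO_of_eCarlesonGradNorm_lt_top` — the direction `Carleson ⇒ BMO` of
the Fefferman–Stein characterisation of `BMO` (Fefferman–Stein 1972, Theorem 3; Stein, *Harmonic
Analysis*, IV §4.3–4.4; Grafakos, *Modern Fourier Analysis*, remark after Theorem 3.3.8) in the
caloric form of Koch–Tataru's Definition 1.1: a locally integrable `f` of Stein growth with
`γ = sup_{x,R} R^{-d} ∫₀^{R²}∫_{B(x,R)} |∇e^{tΔ}f|² dy dt < ∞` has bounded mean oscillation — and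
records the resulting assembly of Koch–Tataru's Theorem 1 from the John–Nirenberg inequality and
(D) alone: `Literature.Analysis.FunctionSpaces.memBMOInv_iff_carleson_heat_of_JN_D`.

## The proof (tent-space duality done by hand, Stein IV §4.4)

Fix a continuous test function `g` with `|g| ≤ M`, `g = 0` off `B(x₀, ρ)` and `∫ g = 0`, and put
`Φ(s) = ∫ f · e^{sΔ}g`.

* *Kernel calculus* (`§ TimeDerivative`–`§ KernelIdentities`): `∂ₛK_s`, `D(∇K_s)` and its trace,
  the semigroup identity for `∇K` and the polarisation identity
  `∫ ⟪∇K_t(x - y), ∇K_t(y)⟫ dy = (∂ₛK)(2t, x)`.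
* *Main identity* (`§ TestSide`, `§ Weights`, `§ MainIdentity`): `Φ` is differentiable with
  `Φ'(2t) = -2∫⟪∇e^{tΔ}f, ∇e^{tΔ}g⟫`, whence
  `Φ(a) - Φ(b) = 2 ∫_{a/2}^{b/2} ∫ ⟪∇e^{tΔ}f, ∇e^{tΔ}g⟫ dy dt` (`integral_mul_heatExtension_sub_eq`;
  the Stein-growth hypothesis on `f` supplies all dominations and the Fubini step).
* *Estimates* (`§ OffTentKernel`, `§ Annuli`, `§ Total`): on the tent `(0, R²) × B(x₀, R)`,
  `R = 4ρ`, Cauchy–Schwarz with the Carleson quantity `γ R^d` and the energy inequality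
  `∫₀^∞∫|∇e^{tΔ}g|² ≤ ½‖g‖₂²` of `BMOCarlesonFeffermanStein.lean`; on the dyadic annuli
  `box_{k+1} \ box_k` the mean-zero property of `g` gives
  `|∇e^{tΔ}g(t, y)| ≤ C ‖g‖₁ ρ R_k^{-(d+2)}`, and a weighted AM–GM sums to
  `∫₀^∞∫ 2|∇e^{tΔ}f| |∇e^{tΔ}g| ≤ (A₁γ + A₂M²) ρ^d` (`exists_lintegral_two_mul_enorm_mul_enorm_le`).
* *Limits* (`§ Limits`–`§ DualityBound`): `Φ(a) → ∫ f g` as `a → 0⁺` (approximate identity for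
  continuous compactly supported `g`, dominated convergence with the Stein weight) and `Φ(b) → 0`
  as `b → ∞` (mean zero), so `|∫ f g| ≤ (A₁γ + A₂M²) ρ^d` (`exists_abs_integral_mul_le`).
* *BMO* (`§ Mollify`, `§ BMO`): mollification by normalised bump functions (Lebesgue
  differentiation, Mathlib's `ContDiffBump.ae_convolution_tendsto_right_of_locallyIntegrable`)
  extends the bound to measurable `g`; testing with `g = 1_B (sign(f - f_B) - c_B)` gives
  `∫_B |f - f_B| ≤ (A₁γ + 4A₂) 2^d ρ^d`, i.e. `f ∈ BMO` (`memBMO_of_eCarlesonGradNorm_lt_top_holds`).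

Only theorems are declared (no new definitions). Remaining named facts behind
`Literature.Analysis.FunctionSpaces.memBMOInv_iff_carleson_heat`: `Literature.Analysis.FunctionSpaces.john_nirenberg` (`BMO.lean`) and (D)
`Literature.BMOInv.exists_hasWeakDivergenceRepresentation_of_eCarlesonNorm_lt_top` (Koch–Tataru's
converse with Lemma 4.1, Riesz transforms on `BMO⁻¹`).

## References

* C. Fefferman, E. M. Stein, *Hᵖ spaces of several variables*, Acta Math. 129 (1972), Thm 3.
* E. M. Stein, *Harmonic Analysis* (1993), Chapter IV, §4.3–4.4.
* L. Grafakos, *Modern Fourier Analysis*, 3rd ed. (2014), §3.3.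
* H. Koch, D. Tataru, *Well-posedness for the Navier–Stokes equations*, Adv. Math. 157 (2001),
  Definition 1.1 and Theorem 1.
-/

noncomputable section

open MeasureTheory Metric Filter Topology
open scoped ENNReal NNReal RealInnerProductSpace Convolution

namespace Literature.Analysis.FunctionSpaces

namespace BMOInv

section TimeDerivative

variable {E : Type*} [NormedAddCommGroup E] [InnerProductSpace ℝ E]

/-- **The heat kernel solves the heat equation, time side**: for `s > 0` and fixed `x`,
`∂_s K_s(x) = K_s(x) (‖x‖²/(4s²) - d/(2s))` (Evans, *PDE*, §2.3.1). [folklore] -/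
theorem hasDerivAt_heatKernel_time (x : E) {s : ℝ} (hs : 0 < s) :
    HasDerivAt (fun s : ℝ => heatKernel s x)
      (heatKernel s x * (‖x‖ ^ 2 / (4 * s ^ 2) - (Module.finrank ℝ E : ℝ) / (2 * s))) s := by
  set d : ℝ := (Module.finrank ℝ E : ℝ) with hd
  -- the power factor
  have h1 : HasDerivAt (fun s : ℝ => (4 * Real.pi * s) ^ (-d / 2))
      (-d / 2 * (4 * Real.pi * s) ^ (-d / 2 - 1) * (4 * Real.pi)) s := by
    have hlin : HasDerivAt (fun s : ℝ => 4 * Real.pi * s) (4 * Real.pi) s := by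
      simpa using (hasDerivAt_id s).const_mul (4 * Real.pi)
    have := hlin.rpow_const (p := -d / 2) (Or.inl (by positivity))
    simpa [mul_comm, mul_assoc, mul_left_comm] using this
  -- the exponential factor
  have h2 : HasDerivAt (fun s : ℝ => Real.exp (-‖x‖ ^ 2 / (4 * s)))
      (Real.exp (-‖x‖ ^ 2 / (4 * s)) * (‖x‖ ^ 2 / (4 * s ^ 2))) s := by
    have hinv : HasDerivAt (fun s : ℝ => -‖x‖ ^ 2 / (4 * s)) (‖x‖ ^ 2 / (4 * s ^ 2)) s := by
      have h0 : HasDerivAt (fun s : ℝ => s⁻¹) (-(s ^ 2)⁻¹) s := hasDerivAt_inv hs.ne'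
      have := h0.const_mul (-‖x‖ ^ 2 / 4)
      refine (this.congr_of_eventuallyEq ?_).congr_deriv ?_
      · filter_upwards with u
        ring
      · field_simp
    exact hinv.exp
  have h3 := h1.mul h2
  refine (h3.congr_of_eventuallyEq (Eventually.of_forall fun u => rfl)).congr_deriv ?_
  simp only [heatKernel]
  have h4 : (4 * Real.pi * s) ^ (-d / 2 - 1) = (4 * Real.pi * s) ^ (-d / 2) * (4 * Real.pi * s)⁻¹ := by
    rw [Real.rpow_sub (by positivity), Real.rpow_one, div_eq_mul_inv]
  rw [h4]
  field_simp
  ring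

end TimeDerivative

section SpaceDerivative

variable {E : Type*} [NormedAddCommGroup E] [InnerProductSpace ℝ E]

/-- The Fréchet derivative of `∇K_s`: `D(∇K_s)(x)[w] = -(2s)⁻¹ (⟪∇K_s(x), w⟫ x + K_s(x) w)`
(product rule on `∇K_s(x) = -(2s)⁻¹ K_s(x) x`). [folklore] -/
theorem hasFDerivAt_heatKernelGrad [CompleteSpace E] (s : ℝ) (x : E) :
    HasFDerivAt (heatKernelGrad s)
      ((-(2 * s)⁻¹ * heatKernel s x) • ContinuousLinearMap.id ℝ E +
        ((-(2 * s)⁻¹) • (InnerProductSpace.toDual ℝ E (heatKernelGrad s x))).smulRight x) x := by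
  have hc : HasFDerivAt (fun y : E => -(2 * s)⁻¹ * heatKernel s y)
      ((-(2 * s)⁻¹) • (InnerProductSpace.toDual ℝ E (heatKernelGrad s x))) x :=
    ((hasGradientAt_heatKernel s x).hasFDerivAt).const_mul _
  have hid : HasFDerivAt (fun y : E => y) (ContinuousLinearMap.id ℝ E) x := hasFDerivAt_id x
  have h := hc.smul hid
  exact h

/-- The trace of `D(∇K_s)(x)` in an orthonormal basis is the time derivative of the kernel:
`Σᵢ ⟪D(∇K_s)(x) bᵢ, bᵢ⟫ = ΔK_s(x) = K_s(x)(‖x‖²/(4s²) - d/(2s))` (the heat equation for the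
Gauss–Weierstrass kernel, Evans, *PDE*, §2.3.1). [folklore] -/
theorem sum_inner_fderiv_heatKernelGrad [CompleteSpace E] [FiniteDimensional ℝ E] {ι : Type*} [Fintype ι]
    (b : OrthonormalBasis ι ℝ E) {s : ℝ} (hs : 0 < s) (x : E) :
    ∑ i, ⟪((-(2 * s)⁻¹ * heatKernel s x) • ContinuousLinearMap.id ℝ E +
        ((-(2 * s)⁻¹) • (InnerProductSpace.toDual ℝ E (heatKernelGrad s x))).smulRight x) (b i), b i⟫ =
      heatKernel s x * (‖x‖ ^ 2 / (4 * s ^ 2) - (Module.finrank ℝ E : ℝ) / (2 * s)) := by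
  have hterm : ∀ i, ⟪((-(2 * s)⁻¹ * heatKernel s x) • ContinuousLinearMap.id ℝ E +
        ((-(2 * s)⁻¹) • (InnerProductSpace.toDual ℝ E (heatKernelGrad s x))).smulRight x) (b i), b i⟫ =
      -(2 * s)⁻¹ * heatKernel s x + -(2 * s)⁻¹ * (⟪heatKernelGrad s x, b i⟫ * ⟪x, b i⟫) := by
    intro i
    simp only [add_apply, FunLike.coe_smul, Pi.smul_apply,
      ContinuousLinearMap.id_apply, ContinuousLinearMap.smulRight_apply,
      InnerProductSpace.toDual_apply_apply, inner_add_left, real_inner_smul_left, smul_eq_mul]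
    rw [real_inner_self_eq_norm_sq, b.orthonormal.1 i]
    ring
  simp_rw [hterm]
  rw [Finset.sum_add_distrib, Finset.sum_const, Finset.card_univ, ← Finset.mul_sum,
    nsmul_eq_mul]
  have hsum : ∑ i, ⟪heatKernelGrad s x, b i⟫ * ⟪x, b i⟫ = ⟪heatKernelGrad s x, x⟫ := by
    rw [← b.sum_inner_mul_inner (heatKernelGrad s x) x]
    refine Finset.sum_congr rfl fun i _ => ?_
    rw [real_inner_comm (b i) x]
  rw [hsum, ← Module.finrank_eq_card_basis b.toBasis]
  simp only [heatKernelGrad, real_inner_smul_left, real_inner_self_eq_norm_sq]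
  field_simp
  ring

end SpaceDerivative

section KernelIdentities

variable {E : Type*} [NormedAddCommGroup E] [InnerProductSpace ℝ E] [FiniteDimensional ℝ E]
  [MeasurableSpace E] [BorelSpace E]

omit [FiniteDimensional ℝ E] [MeasurableSpace E] [BorelSpace E] in
/-- `∇K_t` is continuous. [folklore] -/
theorem continuous_heatKernelGrad (t : ℝ) : Continuous (heatKernelGrad (E := E) t) := by
  unfold heatKernelGrad heatKernel
  fun_prop

/-- For `b > 0`, `y ↦ K_b(y) ∇K_a(x - y)` is integrable (bounded times integrable). [folklore] -/
theorem integrable_heatKernel_smul_heatKernelGrad_sub {a b : ℝ} (ha : 0 < a) (hb : 0 < b) (x : E) :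
    Integrable fun y => heatKernel b y • heatKernelGrad a (x - y) := by
  have hcont : Continuous fun y : E => heatKernelGrad a (x - y) :=
    (continuous_heatKernelGrad a).comp (continuous_const.sub continuous_id)
  have hf : MemLp (fun y : E => heatKernelGrad a (x - y)) ∞ volume :=
    memLp_top_of_bound hcont.aestronglyMeasurable _
      (Eventually.of_forall fun y => norm_heatKernelGrad_le_const ha (x - y))
  exact (Literature.Analysis.UnboundedOperators.integrable_heatKernel_holds hb).smul_of_top_left hf

/-- The operator-valued integrand `y ↦ ∇K_a(x - y) ⊗ F(y)` is integrable for `F ∈ L¹`. [folklore] -/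
theorem integrable_fderiv_heatKernel_smulRight {G : Type*} [NormedAddCommGroup G] [NormedSpace ℝ G]
    {a : ℝ} (ha : 0 < a) (x : E) {F : E → G} (hF : Integrable F) :
    Integrable fun y => (fderiv ℝ (heatKernel a) (x - y)).smulRight (F y) := by
  have h1 : AEStronglyMeasurable (fun y => fderiv ℝ (heatKernel a) (x - y)) volume :=
    ((Literature.Analysis.UnboundedOperators.continuous_fderiv_heatKernel a).comp (continuous_const.sub continuous_id)).aestronglyMeasurable
  refine ⟨(ContinuousLinearMap.smulRightL ℝ E G).aestronglyMeasurable_comp₂ h1 hF.1, ?_⟩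
  have hb := (hF.norm.const_mul ((4 * Real.pi * a) ^ (-(Module.finrank ℝ E : ℝ) / 2) * (Real.sqrt a)⁻¹)).hasFiniteIntegral
  refine hb.mono (Eventually.of_forall fun y => ?_)
  rw [ContinuousLinearMap.norm_smulRight_apply, norm_fderiv_heatKernel_eq, Real.norm_of_nonneg (by positivity)]
  exact mul_le_mul_of_nonneg_right (norm_heatKernelGrad_le_const ha (x - y)) (norm_nonneg _)

/-- **The gradient kernel is reproduced by the semigroup**: `∇K_{a+b}(x) = ∫ K_b(y) ∇K_a(x - y) dy`
for `a, b > 0`, i.e. `∇K_{a+b} = ∇K_a ∗ K_b` (differentiate `K_a ∗ K_b = K_{a+b}` under the integral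
sign; Evans, *PDE*, §2.3.1). [folklore] -/
theorem heatKernelGrad_add_eq_integral {a b : ℝ} (ha : 0 < a) (hb : 0 < b) (x : E) :
    heatKernelGrad (a + b) x = ∫ y, heatKernel b y • heatKernelGrad a (x - y) := by
  haveI : CompleteSpace E := FiniteDimensional.complete ℝ E
  have hmem : MemLp (heatKernel (E := E) b) 1 volume := Literature.Analysis.UnboundedOperators.memLp_heatKernel hb le_rfl
  have H0 := Literature.Analysis.UnboundedOperators.hasFDerivAt_heatExtension (F := ℝ) hmem le_rfl ha x
  have hconv : Literature.Analysis.UnboundedOperators.heatExtension (heatKernel (E := E) b) a = heatKernel (a + b) :=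
    Literature.Analysis.UnboundedOperators.heatKernel_convolution_heatKernel_holds ha hb
  rw [hconv] at H0
  have H : HasFDerivAt (heatKernel (a + b))
      (∫ y, (fderiv ℝ (heatKernel a) (x - y)).smulRight (heatKernel b y)) x := H0
  have H2 : HasFDerivAt (heatKernel (a + b)) (InnerProductSpace.toDual ℝ E (heatKernelGrad (a + b) x)) x :=
    (hasGradientAt_heatKernel (a + b) x).hasFDerivAt
  have heq := H2.unique H
  have hint := integrable_fderiv_heatKernel_smulRight ha x (Literature.Analysis.UnboundedOperators.integrable_heatKernel_holds (E := E) hb)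
  have hint2 := integrable_heatKernel_smul_heatKernelGrad_sub ha hb x
  refine ext_inner_right ℝ fun w => ?_
  calc ⟪heatKernelGrad (a + b) x, w⟫
      = InnerProductSpace.toDual ℝ E (heatKernelGrad (a + b) x) w := by
        rw [InnerProductSpace.toDual_apply_apply]
    _ = (∫ y, (fderiv ℝ (heatKernel a) (x - y)).smulRight (heatKernel b y)) w := by rw [heq]
    _ = ∫ y, (fderiv ℝ (heatKernel a) (x - y)).smulRight (heatKernel b y) w :=
        ContinuousLinearMap.integral_apply hint w
    _ = ∫ y, ⟪w, heatKernel b y • heatKernelGrad a (x - y)⟫ := by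
        refine integral_congr_ae (Eventually.of_forall fun y => ?_)
        simp only [ContinuousLinearMap.smulRight_apply, fderiv_heatKernel_apply, real_inner_smul_right,
          smul_eq_mul]
        rw [real_inner_comm]
        ring
    _ = ⟪w, ∫ y, heatKernel b y • heatKernelGrad a (x - y)⟫ := integral_inner hint2 w
    _ = ⟪∫ y, heatKernel b y • heatKernelGrad a (x - y), w⟫ := real_inner_comm _ _

/-- The caloric extension (Mathlib-convolution form of `Literature.Analysis.UnboundedOperators.heatExtension`) of `∇K_t` at time `t`
is `∇K_{2t}`. [folklore] -/
theorem heatExtension_heatKernelGrad {t : ℝ} (ht : 0 < t) :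
    Literature.Analysis.UnboundedOperators.heatExtension (heatKernelGrad (E := E) t) t = heatKernelGrad (t + t) := by
  funext x
  rw [Literature.Analysis.UnboundedOperators.heatExtension_apply, heatKernelGrad_add_eq_integral ht ht x]
  exact rfl

/-- **The kernel of `∇e^{tΔ} · ∇e^{tΔ}`**: for `t > 0`,
`∫ ⟪∇K_t(x - y), ∇K_t(y)⟫ dy = (∂_s K_s)(x)|_{s = 2t} = (ΔK_{2t})(x)`
(differentiate `∇K_{2t} = K_t ∗ ∇K_t` under the integral sign and take the trace; Evans, *PDE*,
§2.3.1). [folklore] -/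
theorem integral_inner_heatKernelGrad_sub_heatKernelGrad {t : ℝ} (ht : 0 < t) (x : E) :
    ∫ y, ⟪heatKernelGrad t (x - y), heatKernelGrad t y⟫ =
      heatKernel (t + t) x *
        (‖x‖ ^ 2 / (4 * (t + t) ^ 2) - (Module.finrank ℝ E : ℝ) / (2 * (t + t))) := by
  haveI : CompleteSpace E := FiniteDimensional.complete ℝ E
  set b := stdOrthonormalBasis ℝ E with hb
  have hmem : MemLp (heatKernelGrad (E := E) t) 1 volume :=
    memLp_one_iff_integrable.2 (integrable_heatKernelGrad ht)
  have H0 := Literature.Analysis.UnboundedOperators.hasFDerivAt_heatExtension (F := E) hmem le_rfl ht x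
  rw [heatExtension_heatKernelGrad ht] at H0
  have H : HasFDerivAt (heatKernelGrad (t + t))
      (∫ y, (fderiv ℝ (heatKernel t) (x - y)).smulRight (heatKernelGrad t y)) x := H0
  have heq := (hasFDerivAt_heatKernelGrad (t + t) x).unique H
  have hint := integrable_fderiv_heatKernel_smulRight ht x (integrable_heatKernelGrad (E := E) ht)
  -- integrability of the scalar integrands
  have hsc : ∀ i, Integrable fun y => ⟪heatKernelGrad t (x - y), b i⟫ * ⟪b i, heatKernelGrad t y⟫ := by
    intro i
    have hg : Integrable fun y => ⟪b i, heatKernelGrad t y⟫ := (integrable_heatKernelGrad ht).const_inner (b i)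
    refine hg.bdd_mul (c := (4 * Real.pi * t) ^ (-(Module.finrank ℝ E : ℝ) / 2) * (Real.sqrt t)⁻¹) ?_ ?_
    · exact (((continuous_heatKernelGrad t).comp (continuous_const.sub continuous_id)).inner
        continuous_const).aestronglyMeasurable
    · refine Eventually.of_forall fun y => ?_
      calc ‖⟪heatKernelGrad t (x - y), b i⟫‖ ≤ ‖heatKernelGrad t (x - y)‖ * ‖b i‖ := norm_inner_le_norm _ _
        _ = ‖heatKernelGrad t (x - y)‖ := by rw [b.orthonormal.1 i, mul_one]
        _ ≤ _ := norm_heatKernelGrad_le_const ht (x - y)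
  calc ∫ y, ⟪heatKernelGrad t (x - y), heatKernelGrad t y⟫
      = ∫ y, ∑ i, ⟪heatKernelGrad t (x - y), b i⟫ * ⟪b i, heatKernelGrad t y⟫ := by
        simp_rw [b.sum_inner_mul_inner]
    _ = ∑ i, ∫ y, ⟪heatKernelGrad t (x - y), b i⟫ * ⟪b i, heatKernelGrad t y⟫ :=
        integral_finsetSum _ fun i _ => hsc i
    _ = ∑ i, ⟪(∫ y, (fderiv ℝ (heatKernel t) (x - y)).smulRight (heatKernelGrad t y)) (b i), b i⟫ := by
        refine Finset.sum_congr rfl fun i _ => ?_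
        rw [ContinuousLinearMap.integral_apply hint (b i), real_inner_comm,
          ← integral_inner ?_ (b i)]
        · refine integral_congr_ae (Eventually.of_forall fun y => ?_)
          simp only [ContinuousLinearMap.smulRight_apply, fderiv_heatKernel_apply, real_inner_smul_right]
        · have := (ContinuousLinearMap.apply ℝ E (b i)).integrable_comp hint
          simpa using this
    _ = ∑ i, ⟪((-(2 * (t + t))⁻¹ * heatKernel (t + t) x) • ContinuousLinearMap.id ℝ E +
          ((-(2 * (t + t))⁻¹) • (InnerProductSpace.toDual ℝ E (heatKernelGrad (t + t) x))).smulRight x)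
            (b i), b i⟫ := by rw [heq]
    _ = _ := sum_inner_fderiv_heatKernelGrad b (by positivity) x

/-- Translated form of `integral_inner_heatKernelGrad_sub_heatKernelGrad`:
`∫ ⟪∇K_t(y - v), ∇K_t(y - z)⟫ dy = -(∂_sK_s)|_{s=2t}(v - z)`. [folklore] -/
theorem integral_inner_heatKernelGrad_sub_sub {t : ℝ} (ht : 0 < t) (v z : E) :
    ∫ y, ⟪heatKernelGrad t (y - v), heatKernelGrad t (y - z)⟫ =
      -(heatKernel (t + t) (v - z) *
        (‖v - z‖ ^ 2 / (4 * (t + t) ^ 2) - (Module.finrank ℝ E : ℝ) / (2 * (t + t)))) := by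
  rw [← integral_inner_heatKernelGrad_sub_heatKernelGrad ht (v - z), ← integral_neg,
    ← integral_add_right_eq_self _ z]
  refine integral_congr_ae (Eventually.of_forall fun y => ?_)
  simp only [add_sub_cancel_right]
  have h1 : y + z - v = -(v - z - y) := by abel
  rw [h1, heatKernelGrad_neg, inner_neg_left]

end KernelIdentities

section TestSide

variable {E : Type*} [NormedAddCommGroup E] [InnerProductSpace ℝ E]

/-- **Bound on the time derivative of the heat kernel**:
`|K_s(x)(‖x‖²/(4s²) - d/(2s))| ≤ (4πs)^{-d/2} s⁻¹ (1 + d/2)` for `s > 0` (from `u e^{-u} ≤ 1`). [folklore] -/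
theorem abs_heatKernel_mul_le {s : ℝ} (hs : 0 < s) (x : E) :
    |heatKernel s x * (‖x‖ ^ 2 / (4 * s ^ 2) - (Module.finrank ℝ E : ℝ) / (2 * s))| ≤
      (4 * Real.pi * s) ^ (-(Module.finrank ℝ E : ℝ) / 2) * s⁻¹ * (1 + (Module.finrank ℝ E : ℝ) / 2) := by
  obtain ⟨d, hd⟩ : ∃ d : ℝ, d = (Module.finrank ℝ E : ℝ) := ⟨_, rfl⟩
  rw [← hd]
  obtain ⟨A, hA⟩ : ∃ A : ℝ, A = (4 * Real.pi * s) ^ (-d / 2) := ⟨_, rfl⟩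
  obtain ⟨u, hu⟩ : ∃ u : ℝ, u = ‖x‖ ^ 2 / (4 * s) := ⟨_, rfl⟩
  have hd0 : 0 ≤ d := by rw [hd]; positivity
  have hA0 : 0 ≤ A := by rw [hA]; positivity
  have hu0 : 0 ≤ u := by rw [hu]; positivity
  have hK : heatKernel s x = A * Real.exp (-u) := by
    rw [hA, hu, hd]
    simp only [heatKernel, neg_div]
  rw [← hA]
  have hueu : u * Real.exp (-u) ≤ 1 := by
    rw [Real.exp_neg, ← div_eq_mul_inv, div_le_one (Real.exp_pos u)]
    linarith [Real.add_one_le_exp u]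
  have he1 : Real.exp (-u) ≤ 1 := by
    rw [Real.exp_le_one_iff]; linarith
  have h1 : ‖x‖ ^ 2 / (4 * s ^ 2) = u * s⁻¹ := by
    rw [hu]; field_simp
  rw [hK, h1, abs_le]
  constructor
  · -- lower bound: `-(bound) ≤ A e^{-u} (u/s - d/(2s))`, using `A e^{-u} d/(2s) ≤ A d/(2s)`
    have h2 : A * Real.exp (-u) * (d / (2 * s)) ≤ A * s⁻¹ * (1 + d / 2) := by
      have : A * Real.exp (-u) * (d / (2 * s)) ≤ A * 1 * (d / (2 * s)) := by gcongr
      refine this.trans ?_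
      rw [mul_one]
      have h3 : d / (2 * s) ≤ s⁻¹ * (1 + d / 2) := by
        rw [div_eq_mul_inv, mul_comm]
        have : (2 * s)⁻¹ * d = s⁻¹ * (d / 2) := by field_simp
        rw [this]
        gcongr
        linarith
      calc A * (d / (2 * s)) ≤ A * (s⁻¹ * (1 + d / 2)) := by gcongr
        _ = A * s⁻¹ * (1 + d / 2) := by ring
    have h4 : 0 ≤ A * Real.exp (-u) * (u * s⁻¹) := by positivity
    nlinarith
  · -- upper bound
    have h2 : A * Real.exp (-u) * (u * s⁻¹) ≤ A * s⁻¹ * 1 := by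
      have : A * Real.exp (-u) * (u * s⁻¹) = A * s⁻¹ * (u * Real.exp (-u)) := by ring
      rw [this]
      gcongr
    have h3 : 0 ≤ A * Real.exp (-u) * (d / (2 * s)) := by positivity
    have h5 : A * s⁻¹ * 1 ≤ A * s⁻¹ * (1 + d / 2) := by gcongr; linarith
    nlinarith

/-- The bound of `abs_heatKernel_mul_le` is uniform on `[s₁, ∞)`. [folklore] -/
theorem abs_heatKernel_mul_le_of_le {s₁ s : ℝ} (hs₁ : 0 < s₁) (hs : s₁ ≤ s) (x : E) :
    |heatKernel s x * (‖x‖ ^ 2 / (4 * s ^ 2) - (Module.finrank ℝ E : ℝ) / (2 * s))| ≤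
      (4 * Real.pi * s₁) ^ (-(Module.finrank ℝ E : ℝ) / 2) * s₁⁻¹ * (1 + (Module.finrank ℝ E : ℝ) / 2) := by
  have hs0 : 0 < s := hs₁.trans_le hs
  refine (abs_heatKernel_mul_le hs0 x).trans ?_
  have h1 : (4 * Real.pi * s) ^ (-(Module.finrank ℝ E : ℝ) / 2) ≤
      (4 * Real.pi * s₁) ^ (-(Module.finrank ℝ E : ℝ) / 2) := by
    refine Real.rpow_le_rpow_of_nonpos (by positivity) (by nlinarith [Real.pi_pos]) ?_
    have : (0 : ℝ) ≤ Module.finrank ℝ E := by positivity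
    rw [neg_div]; exact neg_nonpos.mpr (by positivity)
  have h2 : s⁻¹ ≤ s₁⁻¹ := inv_anti₀ hs₁ hs
  gcongr

/-- The time derivative of the heat kernel is continuous in `s > 0` (fixed `x`). [folklore] -/
theorem continuousOn_heatKernel_mul (x : E) :
    ContinuousOn (fun s : ℝ => heatKernel s x *
      (‖x‖ ^ 2 / (4 * s ^ 2) - (Module.finrank ℝ E : ℝ) / (2 * s))) (Set.Ioi 0) := by
  have h1 : ContinuousOn (fun s : ℝ => heatKernel s x) (Set.Ioi 0) := by
    intro s hs
    exact (hasDerivAt_heatKernel_time x hs).continuousAt.continuousWithinAt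
  refine h1.mul (ContinuousOn.sub ?_ ?_)
  · refine continuousOn_const.div (by fun_prop) fun s hs => ?_
    have : (0 : ℝ) < s := hs
    positivity
  · refine continuousOn_const.div (by fun_prop) fun s hs => ?_
    have : (0 : ℝ) < s := hs
    positivity

variable [FiniteDimensional ℝ E] [MeasurableSpace E] [BorelSpace E]

/-- For `g ∈ L¹`, `z ↦ K_s(v - z) g(z)` is integrable (`K_s` is bounded). [folklore] -/
theorem integrable_heatKernel_sub_mul {g : E → ℝ} (hg : Integrable g) {s : ℝ} (hs : 0 < s) (v : E) :
    Integrable fun z => heatKernel s (v - z) * g z := by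
  refine hg.bdd_mul (c := (4 * Real.pi * s) ^ (-(Module.finrank ℝ E : ℝ) / 2)) ?_ ?_
  · exact ((Literature.Analysis.UnboundedOperators.continuous_heatKernel s).comp (continuous_const.sub continuous_id)).aestronglyMeasurable
  · refine Eventually.of_forall fun z => ?_
    change ‖Literature.Analysis.UnboundedOperators.heatKernel s (v - z)‖ ≤ _
    rw [Real.norm_of_nonneg (Literature.Analysis.UnboundedOperators.heatKernel_pos hs _).le]
    exact Literature.Analysis.UnboundedOperators.heatKernel_le hs _

/-- For `g ∈ L¹`, `z ↦ (∂_sK_s)(v - z) g(z)` is integrable. [folklore] -/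
theorem integrable_heatKernel_mul_sub_mul {g : E → ℝ} (hg : Integrable g) {s : ℝ} (hs : 0 < s) (v : E) :
    Integrable fun z => heatKernel s (v - z) *
      (‖v - z‖ ^ 2 / (4 * s ^ 2) - (Module.finrank ℝ E : ℝ) / (2 * s)) * g z := by
  refine hg.bdd_mul (c := (4 * Real.pi * s) ^ (-(Module.finrank ℝ E : ℝ) / 2) * s⁻¹ *
      (1 + (Module.finrank ℝ E : ℝ) / 2)) ?_ ?_
  · refine Continuous.aestronglyMeasurable ?_
    refine ((Literature.Analysis.UnboundedOperators.continuous_heatKernel s).comp (continuous_const.sub continuous_id)).mul ?_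
    fun_prop
  · exact Eventually.of_forall fun z => by
      rw [Real.norm_eq_abs]; exact abs_heatKernel_mul_le hs (v - z)

/-- **Time derivative of the caloric extension of an `L¹` function** (differentiation under the
integral sign): for `g ∈ L¹`, `v ∈ E` and `s > 0`,
`∂_s e^{sΔ}g (v) = ∫ (∂_sK_s)(v - z) g(z) dz`. [folklore] -/
theorem hasDerivAt_heatExtension_time {g : E → ℝ} (hg : Integrable g) (v : E) {s : ℝ} (hs : 0 < s) :
    HasDerivAt (fun s : ℝ => heatExtension g s v)
      (∫ z, heatKernel s (v - z) *
        (‖v - z‖ ^ 2 / (4 * s ^ 2) - (Module.finrank ℝ E : ℝ) / (2 * s)) * g z) s := by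
  set d : ℝ := (Module.finrank ℝ E : ℝ) with hd
  set C : ℝ := (4 * Real.pi * (s / 2)) ^ (-d / 2) * (s / 2)⁻¹ * (1 + d / 2) with hC
  have hs2 : 0 < s / 2 := by positivity
  have hmem : Set.Ioi (s / 2) ∈ 𝓝 s := Ioi_mem_nhds (by linarith)
  have key := hasDerivAt_integral_of_dominated_loc_of_deriv_le (μ := volume) (x₀ := s)
    (F := fun σ z => heatKernel σ (v - z) * g z)
    (F' := fun σ z => heatKernel σ (v - z) * (‖v - z‖ ^ 2 / (4 * σ ^ 2) - d / (2 * σ)) * g z)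
    (bound := fun z => C * ‖g z‖) hmem ?_ ?_ ?_ ?_ ?_ ?_
  · exact key.2
  · filter_upwards [hmem] with σ hσ
    exact (integrable_heatKernel_sub_mul hg (hs2.trans hσ) v).aestronglyMeasurable
  · exact integrable_heatKernel_sub_mul hg hs v
  · exact (integrable_heatKernel_mul_sub_mul hg hs v).aestronglyMeasurable
  · refine Eventually.of_forall fun z σ hσ => ?_
    rw [norm_mul]
    refine mul_le_mul_of_nonneg_right ?_ (norm_nonneg _)
    rw [Real.norm_eq_abs]
    exact abs_heatKernel_mul_le_of_le hs2 (le_of_lt hσ) (v - z)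
  · exact hg.norm.const_mul C
  · refine Eventually.of_forall fun z σ hσ => ?_
    exact (hasDerivAt_heatKernel_time (v - z) (hs2.trans hσ)).mul_const (g z)

/-- The time derivative `s ↦ ∫ (∂_sK_s)(v - z) g(z) dz` is continuous on `(0, ∞)` for `g ∈ L¹`. [folklore] -/
theorem continuousOn_integral_heatKernel_mul_sub_mul {g : E → ℝ} (hg : Integrable g) (v : E) {a : ℝ}
    (ha : 0 < a) :
    ContinuousOn (fun s : ℝ => ∫ z, heatKernel s (v - z) *
      (‖v - z‖ ^ 2 / (4 * s ^ 2) - (Module.finrank ℝ E : ℝ) / (2 * s)) * g z) (Set.Ici a) := by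
  set d : ℝ := (Module.finrank ℝ E : ℝ) with hd
  refine continuousOn_of_dominated (bound := fun z => (4 * Real.pi * a) ^ (-d / 2) * a⁻¹ * (1 + d / 2) * ‖g z‖)
    ?_ ?_ ?_ ?_
  · intro s hs
    exact (integrable_heatKernel_mul_sub_mul hg (ha.trans_le hs) v).aestronglyMeasurable
  · intro s hs
    refine Eventually.of_forall fun z => ?_
    rw [norm_mul]
    refine mul_le_mul_of_nonneg_right ?_ (norm_nonneg _)
    rw [Real.norm_eq_abs]
    exact abs_heatKernel_mul_le_of_le ha hs (v - z)
  · exact hg.norm.const_mul _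
  · refine Eventually.of_forall fun z => ?_
    have h := (continuousOn_heatKernel_mul (E := E) (v - z)).mono
      (fun s (hs : s ∈ Set.Ici a) => ha.trans_le hs)
    exact h.mul continuousOn_const

/-- **Fundamental theorem of calculus for the caloric extension in time**: for `g ∈ L¹`,
`0 < a ≤ b`, `e^{bΔ}g(v) - e^{aΔ}g(v) = ∫_a^b ∫ (∂_sK_s)(v - z) g(z) dz ds`. [folklore] -/
theorem heatExtension_sub_eq_integral {g : E → ℝ} (hg : Integrable g) (v : E) {a b : ℝ}
    (ha : 0 < a) (hab : a ≤ b) :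
    heatExtension g b v - heatExtension g a v =
      ∫ s in a..b, ∫ z, heatKernel s (v - z) *
        (‖v - z‖ ^ 2 / (4 * s ^ 2) - (Module.finrank ℝ E : ℝ) / (2 * s)) * g z := by
  rw [intervalIntegral.integral_eq_sub_of_hasDerivAt]
  · intro s hs
    rw [Set.uIcc_of_le hab] at hs
    exact hasDerivAt_heatExtension_time hg v (ha.trans_le hs.1)
  · refine ContinuousOn.intervalIntegrable ?_
    rw [Set.uIcc_of_le hab]
    exact (continuousOn_integral_heatKernel_mul_sub_mul hg v ha).mono Set.Icc_subset_Ici_self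

/-- **The polarisation identity for the kernels, integrated against `g`**: for `g ∈ L¹`, `t > 0`,
`∫ ⟪∇K_t(y - v), ∇e^{tΔ}g(y)⟫ dy = -∫ (∂_sK_s)|_{s=2t}(v - z) g(z) dz`
(Fubini and `integral_inner_heatKernelGrad_sub_sub`). [folklore] -/
theorem integral_inner_heatKernelGrad_heatExtensionGrad {g : E → ℝ} (hg : Integrable g) {t : ℝ}
    (ht : 0 < t) (v : E) :
    ∫ y, ⟪heatKernelGrad t (y - v), heatExtensionGrad g t y⟫ =
      -∫ z, heatKernel (t + t) (v - z) *
        (‖v - z‖ ^ 2 / (4 * (t + t) ^ 2) - (Module.finrank ℝ E : ℝ) / (2 * (t + t))) * g z := by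
  haveI : CompleteSpace E := FiniteDimensional.complete ℝ E
  set C : ℝ := (4 * Real.pi * t) ^ (-(Module.finrank ℝ E : ℝ) / 2) * (Real.sqrt t)⁻¹ with hC
  -- the integrand as an iterated integral
  have h1 : ∀ y, ⟪heatKernelGrad t (y - v), heatExtensionGrad g t y⟫ =
      ∫ z, g z * ⟪heatKernelGrad t (y - v), heatKernelGrad t (y - z)⟫ := by
    intro y
    rw [heatExtensionGrad, ← integral_inner (integrable_smul_heatKernelGrad_sub hg ht y)]
    refine integral_congr_ae (Eventually.of_forall fun z => ?_)
    simp only [real_inner_smul_right]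
  simp_rw [h1]
  -- Fubini
  have hint : Integrable (Function.uncurry fun y z =>
      g z * ⟪heatKernelGrad t (y - v), heatKernelGrad t (y - z)⟫) (volume.prod volume) := by
    have hb : Integrable (fun p : E × E => ‖heatKernelGrad t (p.1 - v)‖ * (C * ‖g p.2‖))
        (volume.prod volume) :=
      ((integrable_heatKernelGrad ht).comp_sub_right v).norm.mul_prod (hg.norm.const_mul C)
    refine hb.mono' ?_ (Eventually.of_forall fun p => ?_)
    · refine (hg.1.comp_snd.mul ?_)
      have : Continuous fun p : E × E => ⟪heatKernelGrad t (p.1 - v), heatKernelGrad t (p.1 - p.2)⟫ :=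
        ((continuous_heatKernelGrad t).comp (continuous_fst.sub continuous_const)).inner
          ((continuous_heatKernelGrad t).comp (continuous_fst.sub continuous_snd))
      exact this.aestronglyMeasurable
    · obtain ⟨y, z⟩ := p
      simp only [Function.uncurry_apply_pair, norm_mul]
      calc ‖g z‖ * ‖⟪heatKernelGrad t (y - v), heatKernelGrad t (y - z)⟫‖
          ≤ ‖g z‖ * (‖heatKernelGrad t (y - v)‖ * ‖heatKernelGrad t (y - z)‖) := by
            gcongr; exact norm_inner_le_norm _ _
        _ ≤ ‖g z‖ * (‖heatKernelGrad t (y - v)‖ * C) := by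
            gcongr; exact norm_heatKernelGrad_le_const ht _
        _ = ‖heatKernelGrad t (y - v)‖ * (C * ‖g z‖) := by ring
  rw [integral_integral_swap hint, ← integral_neg]
  refine integral_congr_ae (Eventually.of_forall fun z => ?_)
  simp only
  rw [integral_const_mul, integral_inner_heatKernelGrad_sub_sub ht v z]
  ring

/-- **Time-FTC for the caloric extension in polarised form**: for `g ∈ L¹`, `0 < a ≤ b` and `v`,
`e^{aΔ}g(v) - e^{bΔ}g(v) = 2 ∫_{a/2}^{b/2} ∫ ⟪∇K_t(y - v), ∇e^{tΔ}g(y)⟫ dy dt`. [folklore] -/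
theorem heatExtension_sub_eq_two_mul_integral {g : E → ℝ} (hg : Integrable g) (v : E) {a b : ℝ}
    (ha : 0 < a) (hab : a ≤ b) :
    heatExtension g a v - heatExtension g b v =
      2 * ∫ t in (a / 2)..(b / 2), ∫ y, ⟪heatKernelGrad t (y - v), heatExtensionGrad g t y⟫ := by
  have h1 : ∫ t in (a / 2)..(b / 2), ∫ y, ⟪heatKernelGrad t (y - v), heatExtensionGrad g t y⟫ =
      ∫ t in (a / 2)..(b / 2), -∫ z, heatKernel (2 * t) (v - z) *
        (‖v - z‖ ^ 2 / (4 * (2 * t) ^ 2) - (Module.finrank ℝ E : ℝ) / (2 * (2 * t))) * g z := by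
    refine intervalIntegral.integral_congr fun t ht => ?_
    rw [Set.uIcc_of_le (by linarith)] at ht
    have ht0 : 0 < t := by linarith [ht.1]
    rw [integral_inner_heatKernelGrad_heatExtensionGrad hg ht0 v, ← two_mul]
  rw [h1, intervalIntegral.integral_neg, intervalIntegral.integral_comp_mul_left
    (fun s => ∫ z, heatKernel s (v - z) *
      (‖v - z‖ ^ 2 / (4 * s ^ 2) - (Module.finrank ℝ E : ℝ) / (2 * s)) * g z) two_ne_zero,
    mul_div_cancel₀ _ (two_ne_zero : (2 : ℝ) ≠ 0), mul_div_cancel₀ _ (two_ne_zero : (2 : ℝ) ≠ 0),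
    ← heatExtension_sub_eq_integral hg v ha hab, smul_eq_mul]
  ring

end TestSide

section Weights

variable {E : Type*} [NormedAddCommGroup E] [InnerProductSpace ℝ E]

/-- **Gaussian against polynomial weights, uniformly on a compact time interval**: for
`0 < t₁ ≤ t₂` and `N`, `(1 + ‖u‖)^N K_t(u) ≤ C` for all `t ∈ [t₁, t₂]` and `u`. [folklore] -/
theorem exists_unif_bound_heatKernel [FiniteDimensional ℝ E] (N : ℕ) {t₁ t₂ : ℝ} (ht₁ : 0 < t₁)
    (h12 : t₁ ≤ t₂) :
    ∃ C : ℝ, 0 ≤ C ∧ ∀ t ∈ Set.Icc t₁ t₂, ∀ u : E, (1 + ‖u‖) ^ N * heatKernel t u ≤ C := by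
  have ht₂ : 0 < t₂ := ht₁.trans_le h12
  set a : ℝ := 1 / (4 * t₂) with ha
  have ha0 : 0 < a := by positivity
  refine ⟨(4 * Real.pi * t₁) ^ (-(Module.finrank ℝ E : ℝ) / 2) * (2 ^ N * (2 ^ N * (1 + N.factorial / a ^ N))),
    by positivity, fun t ht u => ?_⟩
  have ht0 : 0 < t := ht₁.trans_le ht.1
  -- compare the Gaussian factors
  have hpow : (4 * Real.pi * t) ^ (-(Module.finrank ℝ E : ℝ) / 2) ≤
      (4 * Real.pi * t₁) ^ (-(Module.finrank ℝ E : ℝ) / 2) := by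
    refine Real.rpow_le_rpow_of_nonpos (by positivity) (by nlinarith [Real.pi_pos, ht.1]) ?_
    rw [neg_div]
    exact neg_nonpos.mpr (by positivity)
  have hexp : Real.exp (-‖u‖ ^ 2 / (4 * t)) ≤ Real.exp (-(a * ‖u‖ ^ 2)) := by
    rw [Real.exp_le_exp, neg_div, neg_le_neg_iff, ha, one_div, inv_mul_eq_div]
    exact div_le_div_of_nonneg_left (by positivity) (by positivity) (by nlinarith [ht.2])
  have h1 : heatKernel t u ≤ (4 * Real.pi * t₁) ^ (-(Module.finrank ℝ E : ℝ) / 2) *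
      Real.exp (-(a * ‖u‖ ^ 2)) :=
    mul_le_mul hpow hexp (Real.exp_pos _).le (by positivity)
  have key := one_add_pow_mul_exp_neg_le ha0 N (sq_nonneg ‖u‖)
  have h2 : (1 + ‖u‖) ^ N * Real.exp (-(a * ‖u‖ ^ 2)) ≤ 2 ^ N * (2 ^ N * (1 + N.factorial / a ^ N)) := by
    calc (1 + ‖u‖) ^ N * Real.exp (-(a * ‖u‖ ^ 2))
        ≤ (2 ^ N * (1 + ‖u‖ ^ 2) ^ N) * Real.exp (-(a * ‖u‖ ^ 2)) :=
          mul_le_mul_of_nonneg_right (one_add_norm_pow_le u N) (Real.exp_pos _).le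
      _ = 2 ^ N * ((1 + ‖u‖ ^ 2) ^ N * Real.exp (-(a * ‖u‖ ^ 2))) := by ring
      _ ≤ 2 ^ N * (2 ^ N * (1 + N.factorial / a ^ N)) :=
          mul_le_mul_of_nonneg_left key (by positivity)
  calc (1 + ‖u‖) ^ N * heatKernel t u
      ≤ (1 + ‖u‖) ^ N * ((4 * Real.pi * t₁) ^ (-(Module.finrank ℝ E : ℝ) / 2) *
          Real.exp (-(a * ‖u‖ ^ 2))) := by gcongr
    _ = (4 * Real.pi * t₁) ^ (-(Module.finrank ℝ E : ℝ) / 2) *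
          ((1 + ‖u‖) ^ N * Real.exp (-(a * ‖u‖ ^ 2))) := by ring
    _ ≤ _ := by gcongr

/-- Uniform decay of the gradient kernel: for `0 < t₁ ≤ t₂` and `N`,
`(1 + ‖u‖)^N ‖∇K_t(u)‖ ≤ C` for all `t ∈ [t₁, t₂]` and `u`. [folklore] -/
theorem exists_unif_bound_heatKernelGrad [FiniteDimensional ℝ E] (N : ℕ) {t₁ t₂ : ℝ} (ht₁ : 0 < t₁)
    (h12 : t₁ ≤ t₂) :
    ∃ C : ℝ, 0 ≤ C ∧ ∀ t ∈ Set.Icc t₁ t₂, ∀ u : E, (1 + ‖u‖) ^ N * ‖heatKernelGrad t u‖ ≤ C := by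
  obtain ⟨C, hC0, hC⟩ := exists_unif_bound_heatKernel (E := E) (N + 2) ht₁ h12
  refine ⟨(2 * t₁)⁻¹ * C, by positivity, fun t ht u => ?_⟩
  have ht0 : 0 < t := ht₁.trans_le ht.1
  have hK : 0 ≤ heatKernel t u := (Literature.Analysis.UnboundedOperators.heatKernel_pos ht0 u).le
  have h1 : ‖heatKernelGrad t u‖ ≤ (2 * t₁)⁻¹ * ((1 + ‖u‖) ^ 2 * heatKernel t u) := by
    refine (norm_heatKernelGrad_le ht0 u).trans ?_
    gcongr
    · exact ht.1
    · nlinarith [norm_nonneg u]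
  calc (1 + ‖u‖) ^ N * ‖heatKernelGrad t u‖
      ≤ (1 + ‖u‖) ^ N * ((2 * t₁)⁻¹ * ((1 + ‖u‖) ^ 2 * heatKernel t u)) := by gcongr
    _ = (2 * t₁)⁻¹ * ((1 + ‖u‖) ^ (N + 2) * heatKernel t u) := by ring
    _ ≤ (2 * t₁)⁻¹ * C := by gcongr; exact hC t ht u

omit [InnerProductSpace ℝ E] in
/-- Peetre's inequality: `1 + ‖a - c‖ ≤ (1 + ‖a - b‖)(1 + ‖b - c‖)`. [folklore] -/
theorem one_add_norm_sub_le_mul [NormedSpace ℝ E] (a b c : E) :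
    1 + ‖a - c‖ ≤ (1 + ‖a - b‖) * (1 + ‖b - c‖) := by
  have h := norm_sub_le_norm_sub_add_norm_sub a b c
  nlinarith [norm_nonneg (a - b), norm_nonneg (b - c)]

omit [InnerProductSpace ℝ E] in
/-- Moving a polynomial weight from `y - z` to `y - x₀` for `z ∈ B(x₀, ρ)`:
`((1 + ‖y - z‖)^N)⁻¹ ≤ (1 + ρ)^N ((1 + ‖y - x₀‖)^N)⁻¹`. [folklore] -/
theorem inv_one_add_norm_pow_le_of_mem_ball [NormedSpace ℝ E] {x₀ z : E} {ρ : ℝ} (hz : z ∈ ball x₀ ρ)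
    (y : E) (N : ℕ) :
    ((1 + ‖y - z‖) ^ N)⁻¹ ≤ (1 + ρ) ^ N * ((1 + ‖y - x₀‖) ^ N)⁻¹ := by
  have hρ : ‖z - x₀‖ < ρ := mem_ball_iff_norm.mp hz
  have h1 : 1 + ‖y - x₀‖ ≤ (1 + ‖y - z‖) * (1 + ρ) := by
    have := one_add_norm_sub_le_mul y z x₀
    nlinarith [norm_nonneg (y - z)]
  have h2 : (1 + ‖y - x₀‖) ^ N ≤ (1 + ‖y - z‖) ^ N * (1 + ρ) ^ N := by
    rw [← mul_pow]; exact pow_le_pow_left₀ (by positivity) h1 N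
  have hρ0 : 0 < 1 + ρ := by linarith [norm_nonneg (z - x₀)]
  rw [← div_eq_mul_inv, le_div_iff₀ (by positivity)]
  calc ((1 + ‖y - z‖) ^ N)⁻¹ * (1 + ‖y - x₀‖) ^ N
      ≤ ((1 + ‖y - z‖) ^ N)⁻¹ * ((1 + ‖y - z‖) ^ N * (1 + ρ) ^ N) := by gcongr
    _ = (1 + ρ) ^ N := by
        rw [← mul_assoc, inv_mul_cancel₀ (by positivity), one_mul]

omit [InnerProductSpace ℝ E] in
/-- The Peetre step of the `y`-integration: with `K' = K + K`,
`((1+‖y-w‖)^{K'})⁻¹ ((1+‖y-x₀‖)^{K'})⁻¹ ≤ ((1+‖w-x₀‖)^K)⁻¹ ((1+‖y-x₀‖)^K)⁻¹`. [folklore] -/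
theorem inv_weights_mul_le [NormedSpace ℝ E] (y w x₀ : E) (K : ℕ) :
    ((1 + ‖y - w‖) ^ (K + K))⁻¹ * ((1 + ‖y - x₀‖) ^ (K + K))⁻¹ ≤
      ((1 + ‖w - x₀‖) ^ K)⁻¹ * ((1 + ‖y - x₀‖) ^ K)⁻¹ := by
  have hP : 1 + ‖w - x₀‖ ≤ (1 + ‖y - w‖) * (1 + ‖y - x₀‖) := by
    have := one_add_norm_sub_le_mul w y x₀
    rwa [norm_sub_rev w y] at this
  have hA : 0 < 1 + ‖y - w‖ := by positivity
  have hB : 0 < 1 + ‖y - x₀‖ := by positivity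
  have hW : 0 < 1 + ‖w - x₀‖ := by positivity
  rw [pow_add, pow_add, mul_inv, mul_inv]
  -- `A^{-K} B^{-K} ≤ W^{-K}` and `A^{-K} B^{-K} ≤ B^{-K}`
  have h1 : ((1 + ‖y - w‖) ^ K)⁻¹ * ((1 + ‖y - x₀‖) ^ K)⁻¹ ≤ ((1 + ‖w - x₀‖) ^ K)⁻¹ := by
    rw [← mul_inv, ← mul_pow]
    exact inv_anti₀ (by positivity) (pow_le_pow_left₀ (by positivity) hP K)
  have h2 : ((1 + ‖y - w‖) ^ K)⁻¹ ≤ 1 := inv_le_one_of_one_le₀ (one_le_pow₀ (by linarith [norm_nonneg (y - w)]))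
  calc ((1 + ‖y - w‖) ^ K)⁻¹ * ((1 + ‖y - w‖) ^ K)⁻¹ * (((1 + ‖y - x₀‖) ^ K)⁻¹ * ((1 + ‖y - x₀‖) ^ K)⁻¹)
      = (((1 + ‖y - w‖) ^ K)⁻¹ * ((1 + ‖y - x₀‖) ^ K)⁻¹) *
          (((1 + ‖y - w‖) ^ K)⁻¹ * ((1 + ‖y - x₀‖) ^ K)⁻¹) := by ring
    _ ≤ ((1 + ‖w - x₀‖) ^ K)⁻¹ * (1 * ((1 + ‖y - x₀‖) ^ K)⁻¹) := by gcongr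
    _ = _ := by rw [one_mul]

omit [InnerProductSpace ℝ E] in
/-- Recentring Stein's weight: `((1 + ‖w - x₀‖)^K)⁻¹ ≤ (1 + ‖x₀‖)^K ((1 + ‖w‖)^K)⁻¹`. [folklore] -/
theorem inv_one_add_norm_sub_pow_le [NormedSpace ℝ E] (w x₀ : E) (K : ℕ) :
    ((1 + ‖w - x₀‖) ^ K)⁻¹ ≤ (1 + ‖x₀‖) ^ K * ((1 + ‖w‖) ^ K)⁻¹ := by
  have h1 : 1 + ‖w‖ ≤ (1 + ‖w - x₀‖) * (1 + ‖x₀‖) := by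
    have := one_add_norm_sub_le_mul w x₀ 0
    simp only [sub_zero] at this
    exact this
  have h2 : (1 + ‖w‖) ^ K ≤ (1 + ‖w - x₀‖) ^ K * (1 + ‖x₀‖) ^ K := by
    rw [← mul_pow]; exact pow_le_pow_left₀ (by positivity) h1 K
  rw [← div_eq_mul_inv, le_div_iff₀ (by positivity)]
  calc ((1 + ‖w - x₀‖) ^ K)⁻¹ * (1 + ‖w‖) ^ K
      ≤ ((1 + ‖w - x₀‖) ^ K)⁻¹ * ((1 + ‖w - x₀‖) ^ K * (1 + ‖x₀‖) ^ K) := by gcongr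
    _ = (1 + ‖x₀‖) ^ K := by rw [← mul_assoc, inv_mul_cancel₀ (by positivity), one_mul]

variable [FiniteDimensional ℝ E] [MeasurableSpace E] [BorelSpace E]

/-- **Off-support decay of kernel averages of a bounded, boundedly supported function**: if
`(1+‖u‖)^N φ(u) ≤ C` with `φ ≥ 0` continuous, `|g| ≤ M` and `g = 0` off `B(x₀, ρ)`, then
`∫ |g(z)| φ(y - z) dz ≤ M C (1+ρ)^N |B(x₀,ρ)| (1+‖y-x₀‖)^{-N}`. [folklore] -/
theorem integral_abs_mul_le_of_support {g : E → ℝ} {x₀ : E} {ρ M : ℝ}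
    (hgM : ∀ z, |g z| ≤ M) (hgs : ∀ z, z ∉ ball x₀ ρ → g z = 0)
    {φ : E → ℝ} (hφ0 : ∀ u, 0 ≤ φ u) {N : ℕ} {C : ℝ}
    (hφ : ∀ u, (1 + ‖u‖) ^ N * φ u ≤ C) (y : E) :
    ∫ z, |g z| * φ (y - z) ≤ M * C * (1 + ρ) ^ N * volume.real (ball x₀ ρ) *
      ((1 + ‖y - x₀‖) ^ N)⁻¹ := by
  have hM : 0 ≤ M := (abs_nonneg _).trans (hgM x₀)
  have hC : 0 ≤ C := (mul_nonneg (by positivity) (hφ0 0)).trans (hφ 0)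
  rw [← setIntegral_eq_integral_of_forall_compl_eq_zero (s := ball x₀ ρ)
    (fun z hz => by rw [hgs z hz, abs_zero, zero_mul])]
  have hpt : ∀ z ∈ ball x₀ ρ, ‖|g z| * φ (y - z)‖ ≤
      M * C * (1 + ρ) ^ N * ((1 + ‖y - x₀‖) ^ N)⁻¹ := by
    intro z hz
    rw [Real.norm_of_nonneg (mul_nonneg (abs_nonneg _) (hφ0 _))]
    have h1 : φ (y - z) ≤ C * ((1 + ‖y - z‖) ^ N)⁻¹ := by
      rw [← div_eq_mul_inv, le_div_iff₀ (by positivity), mul_comm]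
      exact hφ (y - z)
    have h2 := inv_one_add_norm_pow_le_of_mem_ball hz y N
    calc |g z| * φ (y - z) ≤ M * (C * ((1 + ‖y - z‖) ^ N)⁻¹) :=
          mul_le_mul (hgM z) h1 (hφ0 _) hM
      _ ≤ M * (C * ((1 + ρ) ^ N * ((1 + ‖y - x₀‖) ^ N)⁻¹)) := by gcongr
      _ = M * C * (1 + ρ) ^ N * ((1 + ‖y - x₀‖) ^ N)⁻¹ := by ring
  have h := norm_setIntegral_le_of_norm_le_const (measure_ball_lt_top (μ := volume)) hpt
  refine (Real.le_norm_self _).trans (h.trans (le_of_eq ?_))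
  ring

/-- **Pointwise decay of `∇e^{tΔ}g` for an atom-like `g`**, uniformly for `t` in a compact
interval: if `|g| ≤ M`, `g = 0` off `B(x₀, ρ)`, then for `t ∈ [t₁, t₂]`,
`‖∇e^{tΔ}g(y)‖ ≤ C (1 + ‖y - x₀‖)^{-N}`. [folklore] -/
theorem exists_norm_heatExtensionGrad_le_of_support {g : E → ℝ} {x₀ : E} {ρ M : ℝ} (hρ : 0 < ρ)
    (hgM : ∀ z, |g z| ≤ M) (hgs : ∀ z, z ∉ ball x₀ ρ → g z = 0) (N : ℕ) {t₁ t₂ : ℝ}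
    (ht₁ : 0 < t₁) (h12 : t₁ ≤ t₂) :
    ∃ C : ℝ, 0 ≤ C ∧ ∀ t ∈ Set.Icc t₁ t₂, ∀ y : E,
      ‖heatExtensionGrad g t y‖ ≤ C * ((1 + ‖y - x₀‖) ^ N)⁻¹ := by
  have hM : 0 ≤ M := (abs_nonneg _).trans (hgM x₀)
  obtain ⟨C, hC0, hC⟩ := exists_unif_bound_heatKernelGrad (E := E) N ht₁ h12
  refine ⟨M * C * (1 + ρ) ^ N * volume.real (ball x₀ ρ), by positivity, fun t ht y => ?_⟩
  calc ‖heatExtensionGrad g t y‖ ≤ ∫ z, ‖g z • heatKernelGrad t (y - z)‖ :=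
        norm_integral_le_integral_norm _
    _ = ∫ z, |g z| * ‖heatKernelGrad t (y - z)‖ := by
        refine integral_congr_ae (Eventually.of_forall fun z => ?_)
        simp only [norm_smul, Real.norm_eq_abs]
    _ ≤ _ := integral_abs_mul_le_of_support hgM hgs (fun u => norm_nonneg _) (hC t ht) y

/-- Pointwise decay of `e^{sΔ}g` for an atom-like `g`, uniformly for `s` in a compact interval. [folklore] -/
theorem exists_abs_heatExtension_le_of_support {g : E → ℝ} {x₀ : E} {ρ M : ℝ} (hρ : 0 < ρ)
    (hgM : ∀ z, |g z| ≤ M) (hgs : ∀ z, z ∉ ball x₀ ρ → g z = 0) (N : ℕ) {t₁ t₂ : ℝ}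
    (ht₁ : 0 < t₁) (h12 : t₁ ≤ t₂) :
    ∃ C : ℝ, 0 ≤ C ∧ ∀ s ∈ Set.Icc t₁ t₂, ∀ y : E,
      |heatExtension g s y| ≤ C * ((1 + ‖y - x₀‖) ^ N)⁻¹ := by
  have hM : 0 ≤ M := (abs_nonneg _).trans (hgM x₀)
  obtain ⟨C, hC0, hC⟩ := exists_unif_bound_heatKernel (E := E) N ht₁ h12
  refine ⟨M * C * (1 + ρ) ^ N * volume.real (ball x₀ ρ), by positivity, fun s hs y => ?_⟩
  have hs0 : 0 < s := ht₁.trans_le hs.1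
  calc |heatExtension g s y| = ‖∫ z, heatKernel s (y - z) * g z‖ := rfl
    _ ≤ ∫ z, ‖heatKernel s (y - z) * g z‖ := norm_integral_le_integral_norm _
    _ = ∫ z, |g z| * heatKernel s (y - z) := by
        refine integral_congr_ae (Eventually.of_forall fun z => ?_)
        show ‖heatKernel s (y - z) * g z‖ = |g z| * heatKernel s (y - z)
        rw [norm_mul, Real.norm_eq_abs, Real.norm_eq_abs,
          abs_of_pos (show 0 < heatKernel s (y - z) from Literature.Analysis.UnboundedOperators.heatKernel_pos hs0 _), mul_comm]
    _ ≤ _ := integral_abs_mul_le_of_support hgM hgs (fun u => (Literature.Analysis.UnboundedOperators.heatKernel_pos hs0 u).le) (hC s hs) y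

/-- A function of Stein growth is a.e.-strongly measurable. [folklore] -/
theorem aestronglyMeasurable_of_growth {f : E → ℝ} {K : ℕ}
    (hfw : Integrable fun w => ((1 + ‖w‖) ^ K)⁻¹ * f w) : AEStronglyMeasurable f volume := by
  have h1 : AEStronglyMeasurable (fun w => (1 + ‖w‖) ^ K * (((1 + ‖w‖) ^ K)⁻¹ * f w)) volume :=
    (Continuous.aestronglyMeasurable (by fun_prop)).mul hfw.1
  refine h1.congr (Eventually.of_forall fun w => ?_)
  have : (1 + ‖w‖) ^ K ≠ 0 := by positivity
  simp only
  rw [← mul_assoc, mul_inv_cancel₀ this, one_mul]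

/-- **Integrability on the `f` side**: for `f` of Stein growth and `t > 0`,
`w ↦ f(w) ∇K_t(y - w)` is integrable. [folklore] -/
theorem integrable_mul_smul_heatKernelGrad_of_growth {f : E → ℝ}
    (hfw : Integrable fun w => ((1 + ‖w‖) ^ (Module.finrank ℝ E + 1))⁻¹ * f w)
    {t : ℝ} (ht : 0 < t) (y : E) :
    Integrable fun w => f w • heatKernelGrad t (y - w) := by
  obtain ⟨C, hC⟩ := exists_bound_one_add_norm_pow_mul_norm_heatKernelGrad ht y (Module.finrank ℝ E + 1)
  have hint : Integrable fun w => f w * ‖heatKernelGrad t (y - w)‖ :=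
    integrable_mul_of_weight_bound (w := fun w => (1 + ‖w‖) ^ (Module.finrank ℝ E + 1))
      (fun w => by positivity) (by fun_prop) hfw
      ((continuous_heatKernelGrad t).comp (continuous_const.sub continuous_id)).norm
      (fun w => norm_nonneg _) hC
  have hKm : AEStronglyMeasurable (fun w : E => heatKernelGrad t (y - w)) volume :=
    ((continuous_heatKernelGrad t).comp (continuous_const.sub continuous_id)).aestronglyMeasurable
  refine hint.norm.mono' ((aestronglyMeasurable_of_growth hfw).smul hKm)
    (Eventually.of_forall fun w => ?_)
  rw [norm_smul, Real.norm_eq_abs, Real.norm_eq_abs, abs_mul, abs_of_nonneg (norm_nonneg _)]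

end Weights

section MainIdentity

variable {E : Type*} [NormedAddCommGroup E] [InnerProductSpace ℝ E] [FiniteDimensional ℝ E]
  [MeasurableSpace E] [BorelSpace E]

/-- Points of `(a, b) × E` (for the restricted product measure) have time coordinate in `(a, b)`. [folklore] -/
theorem ae_fst_mem_Ioo (a b : ℝ) :
    ∀ᵐ p : ℝ × E ∂((volume.restrict (Set.Ioo a b)).prod volume), p.1 ∈ Set.Ioo a b := by
  rw [Measure.restrict_prod_eq_prod_univ]
  exact (ae_restrict_mem (measurableSet_Ioo.prod MeasurableSet.univ)).mono fun p hp => hp.1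

/-- Joint measurability of `(t, y) ↦ ⟪∇K_t(y - w), ∇e^{tΔ}g(y)⟫`. [folklore] -/
theorem measurable_inner_heatKernelGrad_heatExtensionGrad {g : E → ℝ} (hg : AEStronglyMeasurable g volume)
    (w : E) :
    Measurable fun p : ℝ × E => ⟪heatKernelGrad p.1 (p.2 - w), heatExtensionGrad g p.1 p.2⟫ := by
  have h1 : Measurable fun p : ℝ × E => heatKernelGrad p.1 (p.2 - w) :=
    measurable_heatKernelGrad.comp (measurable_fst.prodMk (measurable_snd.sub measurable_const))
  exact h1.inner (measurable_heatExtensionGrad hg)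

/-- Joint measurability of `((t, y), w) ↦ ⟪∇K_t(y - w), ∇e^{tΔ}g(y)⟫`. [folklore] -/
theorem measurable_inner_heatKernelGrad_heatExtensionGrad' {g : E → ℝ} (hg : AEStronglyMeasurable g volume) :
    Measurable fun q : (ℝ × E) × E =>
      ⟪heatKernelGrad q.1.1 (q.1.2 - q.2), heatExtensionGrad g q.1.1 q.1.2⟫ := by
  have h1 : Measurable fun q : (ℝ × E) × E => heatKernelGrad q.1.1 (q.1.2 - q.2) :=
    measurable_heatKernelGrad.comp
      ((measurable_fst.comp measurable_fst).prodMk ((measurable_snd.comp measurable_fst).sub measurable_snd))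
  exact h1.inner ((measurable_heatExtensionGrad hg).comp measurable_fst)

/-- **The section bound**: for `g` atom-like, `0 < a ≤ b`, there is `C ≥ 0` with
`|⟪∇K_t(y - w), ∇e^{tΔ}g(y)⟫| ≤ C (1+‖w-x₀‖)^{-(d+1)} (1+‖y-x₀‖)^{-(d+1)}` for `t ∈ [a, b]`. [folklore] -/
theorem exists_bound_inner_heatKernelGrad_heatExtensionGrad {g : E → ℝ} {x₀ : E} {ρ M : ℝ}
    (hρ : 0 < ρ) (hgM : ∀ z, |g z| ≤ M) (hgs : ∀ z, z ∉ ball x₀ ρ → g z = 0) {a b : ℝ}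
    (ha : 0 < a) (hab : a ≤ b) :
    ∃ C : ℝ, 0 ≤ C ∧ ∀ t ∈ Set.Icc a b, ∀ y w : E,
      |⟪heatKernelGrad t (y - w), heatExtensionGrad g t y⟫| ≤
        C * (((1 + ‖w - x₀‖) ^ (Module.finrank ℝ E + 1))⁻¹ *
          ((1 + ‖y - x₀‖) ^ (Module.finrank ℝ E + 1))⁻¹) := by
  set K := Module.finrank ℝ E + 1 with hK
  obtain ⟨C₁, hC₁0, hC₁⟩ := exists_unif_bound_heatKernelGrad (E := E) (K + K) ha hab
  obtain ⟨C₂, hC₂0, hC₂⟩ := exists_norm_heatExtensionGrad_le_of_support hρ hgM hgs (K + K) ha hab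
  refine ⟨C₁ * C₂, by positivity, fun t ht y w => ?_⟩
  have h1 : ‖heatKernelGrad t (y - w)‖ ≤ C₁ * ((1 + ‖y - w‖) ^ (K + K))⁻¹ := by
    rw [← div_eq_mul_inv, le_div_iff₀ (by positivity), mul_comm]
    exact hC₁ t ht (y - w)
  calc |⟪heatKernelGrad t (y - w), heatExtensionGrad g t y⟫|
      ≤ ‖heatKernelGrad t (y - w)‖ * ‖heatExtensionGrad g t y‖ := abs_real_inner_le_norm _ _
    _ ≤ (C₁ * ((1 + ‖y - w‖) ^ (K + K))⁻¹) * (C₂ * ((1 + ‖y - x₀‖) ^ (K + K))⁻¹) :=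
        mul_le_mul h1 (hC₂ t ht y) (norm_nonneg _) (by positivity)
    _ = C₁ * C₂ * (((1 + ‖y - w‖) ^ (K + K))⁻¹ * ((1 + ‖y - x₀‖) ^ (K + K))⁻¹) := by ring
    _ ≤ C₁ * C₂ * (((1 + ‖w - x₀‖) ^ K)⁻¹ * ((1 + ‖y - x₀‖) ^ K)⁻¹) :=
        mul_le_mul_of_nonneg_left (inv_weights_mul_le y w x₀ K) (by positivity)

/-- **Integrability of the sections** `(t, y) ↦ ⟪∇K_t(y - w), ∇e^{tΔ}g(y)⟫` on `(a, b) × E`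
for `g` atom-like and `0 < a`. [folklore] -/
theorem integrable_inner_heatKernelGrad_heatExtensionGrad {g : E → ℝ} {x₀ : E} {ρ M : ℝ}
    (hgi : Integrable g) (hρ : 0 < ρ) (hgM : ∀ z, |g z| ≤ M) (hgs : ∀ z, z ∉ ball x₀ ρ → g z = 0)
    {a b : ℝ} (ha : 0 < a) (hab : a ≤ b) (w : E) :
    Integrable (fun p : ℝ × E => ⟪heatKernelGrad p.1 (p.2 - w), heatExtensionGrad g p.1 p.2⟫)
      ((volume.restrict (Set.Ioo a b)).prod volume) := by
  set K := Module.finrank ℝ E + 1 with hK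
  obtain ⟨C, hC0, hC⟩ := exists_bound_inner_heatKernelGrad_heatExtensionGrad hρ hgM hgs ha hab
  have hJ : Integrable (fun p : ℝ × E => C * ((1 + ‖p.2 - x₀‖) ^ K)⁻¹)
      ((volume.restrict (Set.Ioo a b)).prod volume) := by
    have h := ((integrable_inv_one_add_norm_pow (E := E)).comp_sub_right x₀).const_mul C
    exact h.comp_snd (volume.restrict (Set.Ioo a b))
  refine hJ.mono' (measurable_inner_heatKernelGrad_heatExtensionGrad hgi.1 w).aestronglyMeasurable ?_
  filter_upwards [ae_fst_mem_Ioo (E := E) a b] with p hp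
  rw [Real.norm_eq_abs]
  refine (hC p.1 (Set.Ioo_subset_Icc_self hp) p.2 w).trans ?_
  have h1 : ((1 + ‖w - x₀‖) ^ K)⁻¹ ≤ 1 :=
    inv_le_one_of_one_le₀ (one_le_pow₀ (by linarith [norm_nonneg (w - x₀)]))
  calc C * (((1 + ‖w - x₀‖) ^ K)⁻¹ * ((1 + ‖p.2 - x₀‖) ^ K)⁻¹)
      ≤ C * (1 * ((1 + ‖p.2 - x₀‖) ^ K)⁻¹) := by gcongr
    _ = C * ((1 + ‖p.2 - x₀‖) ^ K)⁻¹ := by rw [one_mul]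

/-- **Integrability for the big Fubini**: the function
`((t, y), w) ↦ f(w) ⟪∇K_t(y - w), ∇e^{tΔ}g(y)⟫` is integrable on `((a,b) × E) × E` for `f` of
Stein growth, `g` atom-like and `0 < a`. [folklore] -/
theorem integrable_mul_inner_heatKernelGrad_heatExtensionGrad {f g : E → ℝ} {x₀ : E} {ρ M : ℝ}
    (hfw : Integrable fun w => ((1 + ‖w‖) ^ (Module.finrank ℝ E + 1))⁻¹ * f w)
    (hgi : Integrable g) (hρ : 0 < ρ) (hgM : ∀ z, |g z| ≤ M) (hgs : ∀ z, z ∉ ball x₀ ρ → g z = 0)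
    {a b : ℝ} (ha : 0 < a) (hab : a ≤ b) :
    Integrable (Function.uncurry fun (p : ℝ × E) (w : E) =>
        f w * ⟪heatKernelGrad p.1 (p.2 - w), heatExtensionGrad g p.1 p.2⟫)
      (((volume.restrict (Set.Ioo a b)).prod volume).prod volume) := by
  set K := Module.finrank ℝ E + 1 with hK
  set μ : Measure (ℝ × E) := (volume.restrict (Set.Ioo a b)).prod volume with hμ
  obtain ⟨C, hC0, hC⟩ := exists_bound_inner_heatKernelGrad_heatExtensionGrad hρ hgM hgs ha hab
  have hfm : AEStronglyMeasurable f volume := aestronglyMeasurable_of_growth hfw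
  -- measurability
  have h1f : AEStronglyMeasurable (Function.uncurry fun (p : ℝ × E) (w : E) =>
      f w * ⟪heatKernelGrad p.1 (p.2 - w), heatExtensionGrad g p.1 p.2⟫) (μ.prod volume) := by
    refine (hfm.comp_snd (μ := μ)).mul ?_
    exact (measurable_inner_heatKernelGrad_heatExtensionGrad' hgi.1).aestronglyMeasurable
  rw [integrable_prod_iff' h1f]
  constructor
  · refine Eventually.of_forall fun w => ?_
    exact (integrable_inner_heatKernelGrad_heatExtensionGrad hgi hρ hgM hgs ha hab w).const_mul (f w)
  · -- the bound on `w ↦ ∫ ‖H(p, w)‖ dp`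
    set J : ℝ := ∫ p : ℝ × E, ((1 + ‖p.2 - x₀‖) ^ K)⁻¹ ∂μ with hJ
    have hJi : Integrable (fun p : ℝ × E => ((1 + ‖p.2 - x₀‖) ^ K)⁻¹) μ :=
      ((integrable_inv_one_add_norm_pow (E := E)).comp_sub_right x₀).comp_snd _
    have hJ0 : 0 ≤ J := integral_nonneg fun p => by positivity
    have hbound : ∀ w, ∫ p, ‖f w * ⟪heatKernelGrad p.1 (p.2 - w), heatExtensionGrad g p.1 p.2⟫‖ ∂μ ≤
        C * J * (1 + ‖x₀‖) ^ K * ‖((1 + ‖w‖) ^ K)⁻¹ * f w‖ := by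
      intro w
      have h1 : ∫ p, ‖f w * ⟪heatKernelGrad p.1 (p.2 - w), heatExtensionGrad g p.1 p.2⟫‖ ∂μ ≤
          ∫ p, |f w| * (C * (((1 + ‖w - x₀‖) ^ K)⁻¹ * ((1 + ‖p.2 - x₀‖) ^ K)⁻¹)) ∂μ := by
        refine integral_mono_of_nonneg (Eventually.of_forall fun p => norm_nonneg _)
          (((hJi.const_mul (C * ((1 + ‖w - x₀‖) ^ K)⁻¹)).const_mul (|f w|)).congr
            (Eventually.of_forall fun p => by simp only; ring)) ?_
        filter_upwards [ae_fst_mem_Ioo (E := E) a b] with p hp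
        rw [norm_mul, Real.norm_eq_abs, Real.norm_eq_abs]
        exact mul_le_mul_of_nonneg_left (hC p.1 (Set.Ioo_subset_Icc_self hp) p.2 w) (abs_nonneg _)
      refine h1.trans ?_
      rw [integral_const_mul, integral_const_mul, integral_const_mul]
      have h2 := inv_one_add_norm_sub_pow_le w x₀ K
      rw [norm_mul, Real.norm_of_nonneg (by positivity : (0 : ℝ) ≤ ((1 + ‖w‖) ^ K)⁻¹), Real.norm_eq_abs]
      calc |f w| * (C * (((1 + ‖w - x₀‖) ^ K)⁻¹ * J))
          ≤ |f w| * (C * ((1 + ‖x₀‖) ^ K * ((1 + ‖w‖) ^ K)⁻¹ * J)) := by gcongr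
        _ = C * J * (1 + ‖x₀‖) ^ K * (((1 + ‖w‖) ^ K)⁻¹ * |f w|) := by ring
    refine Integrable.mono' ((hfw.norm.const_mul (C * J * (1 + ‖x₀‖) ^ K)))
      h1f.norm.prod_swap.integral_prod_right' (Eventually.of_forall fun w => ?_)
    rw [Real.norm_of_nonneg (integral_nonneg fun p => norm_nonneg _)]
    exact hbound w

/-- `e^{sΔ}g` is continuous for `g ∈ L¹`, `s > 0`. [folklore] -/
theorem continuous_heatExtension {g : E → ℝ} (hgi : Integrable g) {s : ℝ} (hs : 0 < s) :
    Continuous fun v => heatExtension g s v := by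
  refine continuous_of_dominated (F := fun v z => heatKernel s (v - z) * g z)
    (bound := fun z => (4 * Real.pi * s) ^ (-(Module.finrank ℝ E : ℝ) / 2) * ‖g z‖)
    (fun v => (integrable_heatKernel_sub_mul hgi hs v).aestronglyMeasurable) ?_ (hgi.norm.const_mul _) ?_
  · refine fun v => Eventually.of_forall fun z => ?_
    rw [norm_mul]
    refine mul_le_mul_of_nonneg_right ?_ (norm_nonneg _)
    rw [Real.norm_of_nonneg (show 0 ≤ heatKernel s (v - z) from (Literature.Analysis.UnboundedOperators.heatKernel_pos hs _).le)]
    exact Literature.Analysis.UnboundedOperators.heatKernel_le hs _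
  · refine Eventually.of_forall fun z => ?_
    exact ((Literature.Analysis.UnboundedOperators.continuous_heatKernel s).comp (continuous_id.sub continuous_const)).mul continuous_const

/-- For `f` of Stein growth and `g` atom-like, `v ↦ f(v) e^{sΔ}g(v)` is integrable (`s > 0`). [folklore] -/
theorem integrable_mul_heatExtension {f g : E → ℝ} {x₀ : E} {ρ M : ℝ}
    (hfw : Integrable fun w => ((1 + ‖w‖) ^ (Module.finrank ℝ E + 1))⁻¹ * f w)
    (hgi : Integrable g) (hρ : 0 < ρ) (hgM : ∀ z, |g z| ≤ M) (hgs : ∀ z, z ∉ ball x₀ ρ → g z = 0)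
    {s : ℝ} (hs : 0 < s) :
    Integrable fun v => f v * heatExtension g s v := by
  set K := Module.finrank ℝ E + 1 with hK
  obtain ⟨C, hC0, hC⟩ := exists_abs_heatExtension_le_of_support hρ hgM hgs K hs le_rfl
  refine Integrable.mono' (hfw.norm.const_mul (C * (1 + ‖x₀‖) ^ K))
    ((aestronglyMeasurable_of_growth hfw).mul (continuous_heatExtension hgi hs).aestronglyMeasurable)
    (Eventually.of_forall fun v => ?_)
  rw [norm_mul, norm_mul, Real.norm_of_nonneg (by positivity : (0 : ℝ) ≤ ((1 + ‖v‖) ^ K)⁻¹),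
    Real.norm_eq_abs, Real.norm_eq_abs]
  have h1 := hC s ⟨le_rfl, le_rfl⟩ v
  have h2 := inv_one_add_norm_sub_pow_le v x₀ K
  calc |f v| * |heatExtension g s v| ≤ |f v| * (C * ((1 + ‖v - x₀‖) ^ K)⁻¹) := by gcongr
    _ ≤ |f v| * (C * ((1 + ‖x₀‖) ^ K * ((1 + ‖v‖) ^ K)⁻¹)) := by gcongr
    _ = C * (1 + ‖x₀‖) ^ K * (((1 + ‖v‖) ^ K)⁻¹ * |f v|) := by ring

/-- **The main identity** (Fefferman–Stein duality computation for the heat extension; Stein,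
*Harmonic Analysis*, IV §4.4; here with the caloric in place of the harmonic extension): for `f`
of Stein growth, `g` atom-like and `0 < a ≤ b`,
`∫ f e^{aΔ}g - ∫ f e^{bΔ}g = 2 ∫_{(a/2,b/2) × E} ⟪∇e^{tΔ}f(y), ∇e^{tΔ}g(y)⟫ d(t,y)`. [folklore] -/
theorem integral_mul_heatExtension_sub_eq {f g : E → ℝ} {x₀ : E} {ρ M : ℝ}
    (hfw : Integrable fun w => ((1 + ‖w‖) ^ (Module.finrank ℝ E + 1))⁻¹ * f w)
    (hgi : Integrable g) (hρ : 0 < ρ) (hgM : ∀ z, |g z| ≤ M) (hgs : ∀ z, z ∉ ball x₀ ρ → g z = 0)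
    {a b : ℝ} (ha : 0 < a) (hab : a ≤ b) :
    (∫ v, f v * heatExtension g a v) - ∫ v, f v * heatExtension g b v =
      2 * ∫ p, ⟪heatExtensionGrad f p.1 p.2, heatExtensionGrad g p.1 p.2⟫
        ∂((volume.restrict (Set.Ioo (a / 2) (b / 2))).prod volume) := by
  haveI : CompleteSpace E := FiniteDimensional.complete ℝ E
  have ha2 : 0 < a / 2 := by positivity
  have hab2 : a / 2 ≤ b / 2 := by linarith
  set μ : Measure (ℝ × E) := (volume.restrict (Set.Ioo (a / 2) (b / 2))).prod volume with hμ
  -- left-hand side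
  have hL : (∫ v, f v * heatExtension g a v) - ∫ v, f v * heatExtension g b v =
      2 * ∫ v, f v * ∫ t in (a / 2)..(b / 2), ∫ y, ⟪heatKernelGrad t (y - v), heatExtensionGrad g t y⟫ := by
    calc (∫ v, f v * heatExtension g a v) - ∫ v, f v * heatExtension g b v
        = ∫ v, (f v * heatExtension g a v - f v * heatExtension g b v) :=
          (integral_sub (integrable_mul_heatExtension hfw hgi hρ hgM hgs ha)
            (integrable_mul_heatExtension hfw hgi hρ hgM hgs (ha.trans_le hab))).symm
      _ = ∫ v, 2 * (f v * ∫ t in (a / 2)..(b / 2), ∫ y,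
            ⟪heatKernelGrad t (y - v), heatExtensionGrad g t y⟫) := by
          refine integral_congr_ae (Eventually.of_forall fun v => ?_)
          beta_reduce
          rw [← mul_sub, heatExtension_sub_eq_two_mul_integral hgi v ha hab]
          ring
      _ = _ := integral_const_mul _ _
  -- right-hand side
  have hH := integrable_mul_inner_heatKernelGrad_heatExtensionGrad hfw hgi hρ hgM hgs ha2 hab2
  have hR1 : ∫ p, ⟪heatExtensionGrad f p.1 p.2, heatExtensionGrad g p.1 p.2⟫ ∂μ =
      ∫ p, (∫ w, f w * ⟪heatKernelGrad p.1 (p.2 - w), heatExtensionGrad g p.1 p.2⟫) ∂μ := by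
    refine integral_congr_ae ?_
    filter_upwards [ae_fst_mem_Ioo (E := E) (a / 2) (b / 2)] with p hp
    have ht : 0 < p.1 := ha2.trans hp.1
    rw [heatExtensionGrad, real_inner_comm,
      ← integral_inner (integrable_mul_smul_heatKernelGrad_of_growth hfw ht p.2)]
    refine integral_congr_ae (Eventually.of_forall fun w => ?_)
    beta_reduce
    rw [real_inner_smul_right, real_inner_comm]
  have hR2 : ∫ p, (∫ w, f w * ⟪heatKernelGrad p.1 (p.2 - w), heatExtensionGrad g p.1 p.2⟫) ∂μ =
      ∫ w, (∫ p, f w * ⟪heatKernelGrad p.1 (p.2 - w), heatExtensionGrad g p.1 p.2⟫ ∂μ) :=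
    integral_integral_swap hH
  have hR3 : ∀ w, (∫ p, f w * ⟪heatKernelGrad p.1 (p.2 - w), heatExtensionGrad g p.1 p.2⟫ ∂μ) =
      f w * ∫ t in (a / 2)..(b / 2), ∫ y, ⟪heatKernelGrad t (y - w), heatExtensionGrad g t y⟫ := by
    intro w
    rw [integral_const_mul, integral_prod _
      (integrable_inner_heatKernelGrad_heatExtensionGrad hgi hρ hgM hgs ha2 hab2 w),
      intervalIntegral.integral_of_le hab2, integral_Ioc_eq_integral_Ioo]
  rw [hL, hR1, hR2]
  congr 1
  exact integral_congr_ae (Eventually.of_forall fun w => (hR3 w).symm)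

end MainIdentity

section OffTentKernel

variable {E : Type*} [NormedAddCommGroup E] [InnerProductSpace ℝ E]

/-- The heat kernel in terms of `√t`: `K_t(x) = (4π)^{-d/2} (√t)^{-d} e^{-‖x‖²/(4t)}` (`t > 0`). [folklore] -/
theorem heatKernel_eq_sqrt [FiniteDimensional ℝ E] {t : ℝ} (ht : 0 < t) (x : E) :
    heatKernel t x = (4 * Real.pi) ^ (-(Module.finrank ℝ E : ℝ) / 2) * (Real.sqrt t ^ Module.finrank ℝ E)⁻¹ *
      Real.exp (-‖x‖ ^ 2 / (4 * t)) := by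
  unfold heatKernel
  congr 1
  have hs : Real.sqrt t ^ Module.finrank ℝ E = t ^ ((Module.finrank ℝ E : ℝ) / 2) := by
    rw [Real.sqrt_eq_rpow, ← Real.rpow_natCast, ← Real.rpow_mul ht.le]
    congr 1
    ring
  rw [hs, Real.mul_rpow (by positivity) ht.le, ← Real.rpow_neg ht.le]
  congr 1
  rw [neg_div]

/-- `(4πt)^{-d/2} ≤ (4π)^{-d/2} R^{-d}` for `R² ≤ t`. [folklore] -/
theorem rpow_time_le [FiniteDimensional ℝ E] {t R : ℝ} (hR : 0 < R) (ht : R ^ 2 ≤ t) :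
    (4 * Real.pi * t) ^ (-(Module.finrank ℝ E : ℝ) / 2) ≤
      (4 * Real.pi) ^ (-(Module.finrank ℝ E : ℝ) / 2) * (R ^ Module.finrank ℝ E)⁻¹ := by
  have h1 : (4 * Real.pi * t) ^ (-(Module.finrank ℝ E : ℝ) / 2) ≤
      (4 * Real.pi * R ^ 2) ^ (-(Module.finrank ℝ E : ℝ) / 2) := by
    refine Real.rpow_le_rpow_of_nonpos (by positivity) (by nlinarith [Real.pi_pos]) ?_
    rw [neg_div]; exact neg_nonpos.mpr (by positivity)
  refine h1.trans (le_of_eq ?_)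
  rw [Real.mul_rpow (by positivity) (by positivity)]
  congr 1
  rw [show ((R : ℝ) ^ 2) = R ^ (2 : ℝ) by norm_cast, ← Real.rpow_mul hR.le,
    show (2 : ℝ) * (-(Module.finrank ℝ E : ℝ) / 2) = -(Module.finrank ℝ E : ℝ) by ring,
    Real.rpow_neg hR.le, Real.rpow_natCast]

/-- Algebra of `∇K_t(p) - ∇K_t(q)`:
`∇K_t(p) - ∇K_t(q) = -(2t)⁻¹ (K_t(p) (p - q) + (K_t(p) - K_t(q)) q)`. [folklore] -/
theorem heatKernelGrad_sub (t : ℝ) (p q : E) :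
    heatKernelGrad t p - heatKernelGrad t q =
      (-(2 * t)⁻¹) • (heatKernel t p • (p - q) + (heatKernel t p - heatKernel t q) • q) := by
  simp only [heatKernelGrad, smul_sub, sub_smul, smul_add, smul_smul]
  abel

/-- Norm form: `‖∇K_t(p) - ∇K_t(q)‖ ≤ (2t)⁻¹ (K_t(p) ‖p - q‖ + |K_t(p) - K_t(q)| ‖q‖)` (`t > 0`). [folklore] -/
theorem norm_heatKernelGrad_sub_le {t : ℝ} (ht : 0 < t) (p q : E) :
    ‖heatKernelGrad t p - heatKernelGrad t q‖ ≤
      (2 * t)⁻¹ * (heatKernel t p * ‖p - q‖ + |heatKernel t p - heatKernel t q| * ‖q‖) := by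
  rw [heatKernelGrad_sub, norm_smul, norm_neg, norm_inv, Real.norm_of_nonneg (by positivity)]
  gcongr
  refine (norm_add_le _ _).trans ?_
  rw [norm_smul, norm_smul, Real.norm_of_nonneg (show 0 ≤ heatKernel t p from (Literature.Analysis.UnboundedOperators.heatKernel_pos ht p).le),
    Real.norm_eq_abs]

/-- Mean value inequality for the heat kernel along a segment:
`|K_t(p) - K_t(q)| ≤ C ‖p - q‖` whenever `‖∇K_t‖ ≤ C` on `[q, p]`. [folklore] -/
theorem abs_heatKernel_sub_le_of_bound [CompleteSpace E] {t : ℝ} (p q : E) {C : ℝ}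
    (hC : ∀ c ∈ segment ℝ q p, ‖heatKernelGrad t c‖ ≤ C) :
    |heatKernel t p - heatKernel t q| ≤ C * ‖p - q‖ := by
  have h := Convex.norm_image_sub_le_of_norm_hasFDerivWithin_le (f := heatKernel t)
    (f' := fun c => InnerProductSpace.toDual ℝ E (heatKernelGrad t c))
    (fun c _ => (hasGradientAt_heatKernel t c).hasFDerivAt.hasFDerivWithinAt)
    (fun c hc => by simpa using hC c hc) (convex_segment q p) (left_mem_segment ℝ q p)
    (right_mem_segment ℝ q p)
  rwa [Real.norm_eq_abs] at h

/-- **Kernel difference bound, large times**: there is `C = C(E)` such that for `0 < R'`,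
`R'² ≤ t`, `‖p - q‖ ≤ ρ`, `‖q‖ ≤ 2√t`: `‖∇K_t(p) - ∇K_t(q)‖ ≤ C ρ R'^{-(d+2)}`. [folklore] -/
theorem exists_bound_heatKernelGrad_sub_of_le_time [FiniteDimensional ℝ E] :
    ∃ C : ℝ, 0 ≤ C ∧ ∀ {t R' ρ : ℝ} {p q : E}, 0 < R' → R' ^ 2 ≤ t → 0 ≤ ρ → ‖p - q‖ ≤ ρ →
      ‖q‖ ≤ 2 * Real.sqrt t →
      ‖heatKernelGrad t p - heatKernelGrad t q‖ ≤ C * ρ * (R' ^ (Module.finrank ℝ E + 2))⁻¹ := by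
  haveI : CompleteSpace E := FiniteDimensional.complete ℝ E
  set d := Module.finrank ℝ E with hd
  refine ⟨3 / 2 * (4 * Real.pi) ^ (-(d : ℝ) / 2), by positivity, ?_⟩
  intro t R' ρ p q hR' ht hρ hpq hq
  have ht0 : 0 < t := lt_of_lt_of_le (by positivity) ht
  have hst : 0 < Real.sqrt t := Real.sqrt_pos.2 ht0
  set A : ℝ := (4 * Real.pi * t) ^ (-(d : ℝ) / 2) with hA
  have hA0 : 0 ≤ A := by positivity
  have hKle : ∀ x : E, heatKernel t x ≤ A := fun x => Literature.Analysis.UnboundedOperators.heatKernel_le ht0 x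
  have hGle : ∀ c : E, ‖heatKernelGrad t c‖ ≤ A * (Real.sqrt t)⁻¹ := fun c =>
    norm_heatKernelGrad_le_const ht0 c
  have hMVT := abs_heatKernel_sub_le_of_bound (t := t) p q (fun c _ => hGle c)
  have h1 : ‖heatKernelGrad t p - heatKernelGrad t q‖ ≤ (2 * t)⁻¹ * (A * ρ + A * (Real.sqrt t)⁻¹ * ρ * (2 * Real.sqrt t)) := by
    refine (norm_heatKernelGrad_sub_le ht0 p q).trans ?_
    gcongr (2 * t)⁻¹ * (?_ + ?_)
    · exact mul_le_mul (hKle p) hpq (norm_nonneg _) hA0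
    · exact mul_le_mul (hMVT.trans (by gcongr)) hq (norm_nonneg _) (by positivity)
  have h2 : (2 * t)⁻¹ * (A * ρ + A * (Real.sqrt t)⁻¹ * ρ * (2 * Real.sqrt t)) = 3 / 2 * A * ρ * t⁻¹ := by
    field_simp
    ring
  rw [h2] at h1
  refine h1.trans ?_
  have hA' : A ≤ (4 * Real.pi) ^ (-(d : ℝ) / 2) * (R' ^ d)⁻¹ := rpow_time_le hR' ht
  have ht' : t⁻¹ ≤ (R' ^ 2)⁻¹ := inv_anti₀ (by positivity) ht
  calc 3 / 2 * A * ρ * t⁻¹ ≤ 3 / 2 * ((4 * Real.pi) ^ (-(d : ℝ) / 2) * (R' ^ d)⁻¹) * ρ * (R' ^ 2)⁻¹ := by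
        gcongr
    _ = 3 / 2 * (4 * Real.pi) ^ (-(d : ℝ) / 2) * ρ * (R' ^ (d + 2))⁻¹ := by
        rw [pow_add, mul_inv]
        ring

/-- **Polynomial decay of the heat kernel**: for `t > 0` and `c`,
`‖c‖^{2(d+2)} K_t(c) ≤ (4π)^{-d/2} (d+2)! 4^{d+2} (√t)^{d+4}` (from `e^{-u} ≤ (d+2)!/u^{d+2}`). [folklore] -/
theorem norm_pow_mul_heatKernel_le [FiniteDimensional ℝ E] {t : ℝ} (ht : 0 < t) (c : E) :
    ‖c‖ ^ (2 * (Module.finrank ℝ E + 2)) * heatKernel t c ≤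
      (4 * Real.pi) ^ (-(Module.finrank ℝ E : ℝ) / 2) * (Module.finrank ℝ E + 2).factorial *
        4 ^ (Module.finrank ℝ E + 2) * Real.sqrt t ^ (Module.finrank ℝ E + 4) := by
  set d := Module.finrank ℝ E with hd
  set m := d + 2 with hm
  set s := Real.sqrt t with hs
  have hs0 : 0 < s := Real.sqrt_pos.2 ht
  have hts : t = s ^ 2 := (Real.sq_sqrt ht.le).symm
  rw [heatKernel_eq_sqrt ht]
  -- `e^{-‖c‖²/(4t)} ‖c‖^{2m} ≤ m! (4t)^m`
  have key : ‖c‖ ^ (2 * m) * Real.exp (-‖c‖ ^ 2 / (4 * t)) ≤ m.factorial * (4 * t) ^ m := by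
    have h := pow_mul_exp_neg_le (a := (4 * t)⁻¹) (by positivity) m (sq_nonneg ‖c‖)
    rw [pow_mul]
    have e1 : -‖c‖ ^ 2 / (4 * t) = -((4 * t)⁻¹ * ‖c‖ ^ 2) := by ring
    rw [e1]
    calc (‖c‖ ^ 2) ^ m * Real.exp (-((4 * t)⁻¹ * ‖c‖ ^ 2)) ≤ m.factorial / ((4 * t)⁻¹) ^ m := h
      _ = m.factorial * (4 * t) ^ m := by rw [inv_pow, div_inv_eq_mul]
  calc ‖c‖ ^ (2 * m) * ((4 * Real.pi) ^ (-(d : ℝ) / 2) * (s ^ d)⁻¹ * Real.exp (-‖c‖ ^ 2 / (4 * t)))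
      = (4 * Real.pi) ^ (-(d : ℝ) / 2) * (s ^ d)⁻¹ * (‖c‖ ^ (2 * m) * Real.exp (-‖c‖ ^ 2 / (4 * t))) := by
        ring
    _ ≤ (4 * Real.pi) ^ (-(d : ℝ) / 2) * (s ^ d)⁻¹ * (m.factorial * (4 * t) ^ m) := by gcongr
    _ = (4 * Real.pi) ^ (-(d : ℝ) / 2) * m.factorial * 4 ^ m * s ^ (d + 4) := by
        rw [hts, mul_pow, ← pow_mul]
        have : s ^ (2 * m) = s ^ d * s ^ (d + 4) := by rw [← pow_add, hm]; ring_nf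
        rw [this]
        field_simp

/-- First polynomial bound behind the far-field estimate: for `0 < t ≤ R'²` and `R'/2 ≤ ‖c‖`,
`(2t)⁻¹ K_t(c) ≤ B₁ R'^{-(d+2)}` with `B₁ = ½ P 4^{d+2}`, `P = (4π)^{-d/2}(d+2)! 4^{d+2}`. [folklore] -/
theorem inv_time_mul_heatKernel_le [FiniteDimensional ℝ E] {t R' : ℝ} {c : E} (ht0 : 0 < t)
    (ht : t ≤ R' ^ 2) (hR' : 0 < R') (hc : R' / 2 ≤ ‖c‖) :
    (2 * t)⁻¹ * heatKernel t c ≤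
      (2⁻¹ * ((4 * Real.pi) ^ (-(Module.finrank ℝ E : ℝ) / 2) * (Module.finrank ℝ E + 2).factorial *
        4 ^ (Module.finrank ℝ E + 2)) * 2 ^ (2 * (Module.finrank ℝ E + 2))) *
      (R' ^ (Module.finrank ℝ E + 2))⁻¹ := by
  set d := Module.finrank ℝ E with hd
  set P : ℝ := (4 * Real.pi) ^ (-(d : ℝ) / 2) * (d + 2).factorial * 4 ^ (d + 2) with hP
  set s := Real.sqrt t with hs
  have hs0 : 0 < s := Real.sqrt_pos.2 ht0
  have hts : t = s ^ 2 := (Real.sq_sqrt ht0.le).symm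
  have hsR : s ≤ R' := by
    rw [hs, ← Real.sqrt_sq hR'.le]
    exact Real.sqrt_le_sqrt ht
  have hc0 : 0 < ‖c‖ := lt_of_lt_of_le (by positivity) hc
  have hK : heatKernel t c ≤ P * s ^ (d + 4) * (‖c‖ ^ (2 * (d + 2)))⁻¹ := by
    rw [← div_eq_mul_inv, le_div_iff₀ (pow_pos hc0 _), mul_comm]
    exact norm_pow_mul_heatKernel_le ht0 c
  have hcm : (‖c‖ ^ (2 * (d + 2)))⁻¹ ≤ 2 ^ (2 * (d + 2)) * (R' ^ (2 * (d + 2)))⁻¹ := by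
    have h1 : (R' / 2) ^ (2 * (d + 2)) ≤ ‖c‖ ^ (2 * (d + 2)) := pow_le_pow_left₀ (by positivity) hc _
    calc (‖c‖ ^ (2 * (d + 2)))⁻¹ ≤ ((R' / 2) ^ (2 * (d + 2)))⁻¹ := inv_anti₀ (by positivity) h1
      _ = 2 ^ (2 * (d + 2)) * (R' ^ (2 * (d + 2)))⁻¹ := by rw [div_pow]; field_simp
  have hsd : s ^ (d + 2) ≤ R' ^ (d + 2) := pow_le_pow_left₀ hs0.le hsR _
  calc (2 * t)⁻¹ * heatKernel t c ≤ (2 * t)⁻¹ * (P * s ^ (d + 4) * (2 ^ (2 * (d + 2)) * (R' ^ (2 * (d + 2)))⁻¹)) := by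
        gcongr
        exact hK.trans (by gcongr)
    _ = 2⁻¹ * P * 2 ^ (2 * (d + 2)) * s ^ (d + 2) * (R' ^ (2 * (d + 2)))⁻¹ := by
        rw [hts]; field_simp; ring
    _ ≤ 2⁻¹ * P * 2 ^ (2 * (d + 2)) * R' ^ (d + 2) * (R' ^ (2 * (d + 2)))⁻¹ := by gcongr
    _ = 2⁻¹ * P * 2 ^ (2 * (d + 2)) * (R' ^ (d + 2))⁻¹ := by
        have : R' ^ (2 * (d + 2)) = R' ^ (d + 2) * R' ^ (d + 2) := by rw [← pow_add]; ring_nf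
        rw [this]; field_simp

/-- Second polynomial bound: for `0 < t ≤ R'²` and `R'/2 ≤ ‖c‖`,
`(2t)⁻² K_t(c) ‖c‖² ≤ B₃ R'^{-(d+2)}` with `B₃ = ¼ P 4^{d+1}`. [folklore] -/
theorem inv_time_sq_mul_heatKernel_mul_norm_sq_le [FiniteDimensional ℝ E] {t R' : ℝ} {c : E} (ht0 : 0 < t)
    (ht : t ≤ R' ^ 2) (hR' : 0 < R') (hc : R' / 2 ≤ ‖c‖) :
    (2 * t)⁻¹ ^ 2 * heatKernel t c * ‖c‖ ^ 2 ≤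
      (4⁻¹ * ((4 * Real.pi) ^ (-(Module.finrank ℝ E : ℝ) / 2) * (Module.finrank ℝ E + 2).factorial *
        4 ^ (Module.finrank ℝ E + 2)) * 2 ^ (2 * (Module.finrank ℝ E + 1))) *
      (R' ^ (Module.finrank ℝ E + 2))⁻¹ := by
  set d := Module.finrank ℝ E with hd
  set P : ℝ := (4 * Real.pi) ^ (-(d : ℝ) / 2) * (d + 2).factorial * 4 ^ (d + 2) with hP
  set s := Real.sqrt t with hs
  have hs0 : 0 < s := Real.sqrt_pos.2 ht0
  have hts : t = s ^ 2 := (Real.sq_sqrt ht0.le).symm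
  have hsR : s ≤ R' := by
    rw [hs, ← Real.sqrt_sq hR'.le]
    exact Real.sqrt_le_sqrt ht
  have hc0 : 0 < ‖c‖ := lt_of_lt_of_le (by positivity) hc
  -- `K ‖c‖² ≤ P s^{d+4} ‖c‖^{-(2d+2)}`
  have hK : heatKernel t c * ‖c‖ ^ 2 ≤ P * s ^ (d + 4) * (‖c‖ ^ (2 * (d + 1)))⁻¹ := by
    rw [← div_eq_mul_inv, le_div_iff₀ (pow_pos hc0 _)]
    have h := norm_pow_mul_heatKernel_le ht0 c
    rw [← hd] at h
    calc heatKernel t c * ‖c‖ ^ 2 * ‖c‖ ^ (2 * (d + 1)) = ‖c‖ ^ (2 * (d + 2)) * heatKernel t c := by ring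
      _ ≤ P * s ^ (d + 4) := h
  have hcm : (‖c‖ ^ (2 * (d + 1)))⁻¹ ≤ 2 ^ (2 * (d + 1)) * (R' ^ (2 * (d + 1)))⁻¹ := by
    have h1 : (R' / 2) ^ (2 * (d + 1)) ≤ ‖c‖ ^ (2 * (d + 1)) := pow_le_pow_left₀ (by positivity) hc _
    calc (‖c‖ ^ (2 * (d + 1)))⁻¹ ≤ ((R' / 2) ^ (2 * (d + 1)))⁻¹ := inv_anti₀ (by positivity) h1
      _ = 2 ^ (2 * (d + 1)) * (R' ^ (2 * (d + 1)))⁻¹ := by rw [div_pow]; field_simp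
  have hsd : s ^ d ≤ R' ^ d := pow_le_pow_left₀ hs0.le hsR _
  calc (2 * t)⁻¹ ^ 2 * heatKernel t c * ‖c‖ ^ 2 = (2 * t)⁻¹ ^ 2 * (heatKernel t c * ‖c‖ ^ 2) := by ring
    _ ≤ (2 * t)⁻¹ ^ 2 * (P * s ^ (d + 4) * (2 ^ (2 * (d + 1)) * (R' ^ (2 * (d + 1)))⁻¹)) :=
        mul_le_mul_of_nonneg_left (hK.trans (mul_le_mul_of_nonneg_left hcm (by positivity)))
          (by positivity)
    _ = 4⁻¹ * P * 2 ^ (2 * (d + 1)) * s ^ d * (R' ^ (2 * (d + 1)))⁻¹ := by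
        rw [hts]; field_simp; ring
    _ ≤ 4⁻¹ * P * 2 ^ (2 * (d + 1)) * R' ^ d * (R' ^ (2 * (d + 1)))⁻¹ := by gcongr
    _ = 4⁻¹ * P * 2 ^ (2 * (d + 1)) * (R' ^ (d + 2))⁻¹ := by
        have : R' ^ (2 * (d + 1)) = R' ^ d * R' ^ (d + 2) := by rw [← pow_add]; ring_nf
        rw [this]; field_simp

/-- **Kernel difference bound, points far from the support**: there is `C = C(E)` such that for
`0 < t ≤ R'²`, `2ρ ≤ R'`, `R' ≤ ‖q‖`, `‖p - q‖ ≤ ρ`: `‖∇K_t(p) - ∇K_t(q)‖ ≤ C ρ R'^{-(d+2)}`. [folklore] -/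
theorem exists_bound_heatKernelGrad_sub_of_time_le [FiniteDimensional ℝ E] :
    ∃ C : ℝ, 0 ≤ C ∧ ∀ {t R' ρ : ℝ} {p q : E}, 0 < t → t ≤ R' ^ 2 → 0 ≤ ρ → 2 * ρ ≤ R' →
      R' ≤ ‖q‖ → ‖p - q‖ ≤ ρ →
      ‖heatKernelGrad t p - heatKernelGrad t q‖ ≤ C * ρ * (R' ^ (Module.finrank ℝ E + 2))⁻¹ := by
  haveI : CompleteSpace E := FiniteDimensional.complete ℝ E
  set d := Module.finrank ℝ E with hd
  set P : ℝ := (4 * Real.pi) ^ (-(d : ℝ) / 2) * (d + 2).factorial * 4 ^ (d + 2) with hP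
  set B₁ : ℝ := 2⁻¹ * P * 2 ^ (2 * (d + 2)) with hB₁
  set B₃ : ℝ := 4⁻¹ * P * 2 ^ (2 * (d + 1)) with hB₃
  refine ⟨B₁ + 2 * B₃, by positivity, ?_⟩
  intro t R' ρ p q ht0 ht hρ hρR hq hpq
  have hR' : 0 < R' := by
    rcases (show (0 : ℝ) ≤ R' by linarith).eq_or_lt with h | h
    · rw [← h] at ht; simp at ht; linarith
    · exact h
  -- points within `ρ` of `q` are far from the origin
  have hfar : ∀ c : E, ‖c - q‖ ≤ ρ → R' / 2 ≤ ‖c‖ := by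
    intro c hc
    have := norm_sub_norm_le q c
    rw [norm_sub_rev] at this
    linarith
  -- term 1
  have h1 : (2 * t)⁻¹ * (heatKernel t p * ‖p - q‖) ≤ B₁ * (R' ^ (d + 2))⁻¹ * ρ := by
    rw [← mul_assoc]
    exact mul_le_mul (inv_time_mul_heatKernel_le ht0 ht hR' (hfar p hpq)) hpq (norm_nonneg _)
      (by positivity)
  -- term 2 via the mean value inequality on the segment `[q, p]`
  have hq0 : 0 < ‖q‖ := hR'.trans_le hq
  have hseg : ∀ c ∈ segment ℝ q p, ‖heatKernelGrad t c‖ ≤ 2 * B₃ * (R' ^ (d + 2))⁻¹ * (2 * t) * ‖q‖⁻¹ := by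
    intro c hc
    have hcq : ‖c - q‖ ≤ ρ := by
      have h := segment_subset_closedBall_left q p hc
      rw [mem_closedBall, dist_eq_norm, dist_eq_norm, norm_sub_rev q p] at h
      exact h.trans hpq
    have hcfar := hfar c hcq
    have hqc : ‖q‖ ≤ 2 * ‖c‖ := by
      have := norm_sub_norm_le q c
      rw [norm_sub_rev] at this
      linarith
    have key : (2 * t)⁻¹ ^ 2 * heatKernel t c * ‖c‖ ^ 2 ≤ B₃ * (R' ^ (d + 2))⁻¹ := by
      have := inv_time_sq_mul_heatKernel_mul_norm_sq_le ht0 ht hR' hcfar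
      rw [← hd] at this
      rw [hB₃, hP]
      exact this
    rw [norm_heatKernelGrad ht0 c]
    -- `(2t)⁻¹ K ‖c‖ ≤ 2 B₃ R'^{-(d+2)} (2t) / ‖q‖` iff `(2t)⁻² K ‖c‖ ‖q‖ ≤ 2 B₃ R'^{-(d+2)}`
    rw [le_mul_inv_iff₀ hq0]
    have hX : 0 ≤ (2 * t)⁻¹ * heatKernel t c * ‖c‖ :=
      mul_nonneg (mul_nonneg (by positivity) (Literature.Analysis.UnboundedOperators.heatKernel_pos ht0 c).le) (norm_nonneg _)
    have e1 : (2 * t)⁻¹ * heatKernel t c * ‖c‖ * ‖q‖ ≤ (2 * t)⁻¹ * heatKernel t c * ‖c‖ * (2 * ‖c‖) :=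
      mul_le_mul_of_nonneg_left hqc hX
    refine e1.trans ?_
    have e2 : (2 * t)⁻¹ * heatKernel t c * ‖c‖ * (2 * ‖c‖) =
        (2 * ((2 * t)⁻¹ ^ 2 * heatKernel t c * ‖c‖ ^ 2)) * (2 * t) := by
      field_simp
    rw [e2]
    calc 2 * ((2 * t)⁻¹ ^ 2 * heatKernel t c * ‖c‖ ^ 2) * (2 * t)
        ≤ 2 * (B₃ * (R' ^ (d + 2))⁻¹) * (2 * t) := by gcongr
      _ = 2 * B₃ * (R' ^ (d + 2))⁻¹ * (2 * t) := by ring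
  have hMVT := abs_heatKernel_sub_le_of_bound (t := t) p q hseg
  have h2 : (2 * t)⁻¹ * (|heatKernel t p - heatKernel t q| * ‖q‖) ≤ 2 * B₃ * (R' ^ (d + 2))⁻¹ * ρ := by
    calc (2 * t)⁻¹ * (|heatKernel t p - heatKernel t q| * ‖q‖)
        ≤ (2 * t)⁻¹ * ((2 * B₃ * (R' ^ (d + 2))⁻¹ * (2 * t) * ‖q‖⁻¹ * ‖p - q‖) * ‖q‖) := by gcongr
      _ = 2 * B₃ * (R' ^ (d + 2))⁻¹ * ‖p - q‖ := by field_simp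
      _ ≤ 2 * B₃ * (R' ^ (d + 2))⁻¹ * ρ := by gcongr
  calc ‖heatKernelGrad t p - heatKernelGrad t q‖
      ≤ (2 * t)⁻¹ * (heatKernel t p * ‖p - q‖ + |heatKernel t p - heatKernel t q| * ‖q‖) :=
        norm_heatKernelGrad_sub_le ht0 p q
    _ = (2 * t)⁻¹ * (heatKernel t p * ‖p - q‖) + (2 * t)⁻¹ * (|heatKernel t p - heatKernel t q| * ‖q‖) := by
        ring
    _ ≤ B₁ * (R' ^ (d + 2))⁻¹ * ρ + 2 * B₃ * (R' ^ (d + 2))⁻¹ * ρ := add_le_add h1 h2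
    _ = (B₁ + 2 * B₃) * ρ * (R' ^ (d + 2))⁻¹ := by ring

end OffTentKernel

section Annuli

variable {E : Type*} [NormedAddCommGroup E] [InnerProductSpace ℝ E] [FiniteDimensional ℝ E]
  [MeasurableSpace E] [BorelSpace E]

/-- **Decay of `∇e^{tΔ}g` off the tent over the support of a mean-zero atom-like `g`**
(Stein, *Harmonic Analysis*, IV §4.4, the estimate for atoms away from their support, in caloric
form): there is `C = C(E)` such that if `|g| ≤ M`, `g = 0` off `B(x₀, ρ)`, `∫ g = 0`, then for
`2ρ ≤ R'`, `0 < t < (2R')²`, `y ∈ B(x₀, 2R')` with `t ≥ R'²` or `‖y - x₀‖ ≥ R'`,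
`‖∇e^{tΔ}g(y)‖ ≤ C M |B(x₀,ρ)| ρ R'^{-(d+2)}`. [folklore] -/
theorem exists_norm_heatExtensionGrad_le_annulus :
    ∃ C : ℝ, 0 ≤ C ∧ ∀ {g : E → ℝ} {x₀ : E} {ρ M : ℝ}, 0 < ρ → (∀ z, |g z| ≤ M) →
      (∀ z, z ∉ ball x₀ ρ → g z = 0) → (∫ z, g z = 0) → Integrable g →
      ∀ {R' t : ℝ} {y : E}, 2 * ρ ≤ R' → 0 < t → y ∈ ball x₀ (2 * R') →
        (R' ^ 2 ≤ t ∨ R' ≤ ‖y - x₀‖) →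
        ‖heatExtensionGrad g t y‖ ≤
          C * M * volume.real (ball x₀ ρ) * ρ * (R' ^ (Module.finrank ℝ E + 2))⁻¹ := by
  haveI : CompleteSpace E := FiniteDimensional.complete ℝ E
  obtain ⟨CA, hCA0, hCA⟩ := exists_bound_heatKernelGrad_sub_of_le_time (E := E)
  obtain ⟨CB, hCB0, hCB⟩ := exists_bound_heatKernelGrad_sub_of_time_le (E := E)
  refine ⟨CA + CB, by positivity, ?_⟩
  intro g x₀ ρ M hρ hgM hgs hg0 hgi R' t y hρR ht hy hcase
  set d := Module.finrank ℝ E with hd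
  have hM : 0 ≤ M := (abs_nonneg _).trans (hgM x₀)
  have hR' : 0 < R' := by linarith
  -- subtract the value of the kernel at the centre (mean zero)
  have hrepr : heatExtensionGrad g t y =
      ∫ z, g z • (heatKernelGrad t (y - z) - heatKernelGrad t (y - x₀)) := by
    rw [heatExtensionGrad]
    have h1 : ∫ z, g z • heatKernelGrad t (y - x₀) = 0 := by
      rw [integral_smul_const, hg0, zero_smul]
    rw [← sub_zero (∫ z, g z • heatKernelGrad t (y - z)), ← h1, ← integral_sub
      (integrable_smul_heatKernelGrad_sub hgi ht y) (hgi.smul_const _)]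
    refine integral_congr_ae (Eventually.of_forall fun z => ?_)
    simp only [smul_sub]
  -- the pointwise kernel bound on the support
  have hker : ∀ z ∈ ball x₀ ρ, ‖heatKernelGrad t (y - z) - heatKernelGrad t (y - x₀)‖ ≤
      (CA + CB) * ρ * (R' ^ (d + 2))⁻¹ := by
    intro z hz
    have hpq : ‖(y - z) - (y - x₀)‖ ≤ ρ := by
      rw [sub_sub_sub_cancel_left, norm_sub_rev]
      exact (mem_ball_iff_norm.mp hz).le
    have hsum : ∀ {a : ℝ}, a ≤ CA * ρ * (R' ^ (d + 2))⁻¹ ∨ a ≤ CB * ρ * (R' ^ (d + 2))⁻¹ →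
        a ≤ (CA + CB) * ρ * (R' ^ (d + 2))⁻¹ := by
      intro a h
      have h1 : 0 ≤ CA * ρ * (R' ^ (d + 2))⁻¹ := by positivity
      have h2 : 0 ≤ CB * ρ * (R' ^ (d + 2))⁻¹ := by positivity
      rcases h with h | h <;> nlinarith
    rcases le_or_gt (R' ^ 2) t with hlarge | hsmall
    · refine hsum (Or.inl (hCA hR' hlarge hρ.le hpq ?_))
      have h1 : ‖y - x₀‖ < 2 * R' := mem_ball_iff_norm.mp hy
      have h2 : R' ≤ Real.sqrt t := by
        rw [← Real.sqrt_sq hR'.le]; exact Real.sqrt_le_sqrt hlarge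
      linarith
    · have hfar : R' ≤ ‖y - x₀‖ := by
        rcases hcase with h | h
        · exact absurd h (not_le.mpr hsmall)
        · exact h
      exact hsum (Or.inr (hCB ht hsmall.le hρ.le hρR hfar hpq))
  rw [hrepr]
  calc ‖∫ z, g z • (heatKernelGrad t (y - z) - heatKernelGrad t (y - x₀))‖
      ≤ ∫ z, ‖g z • (heatKernelGrad t (y - z) - heatKernelGrad t (y - x₀))‖ :=
        norm_integral_le_integral_norm _
    _ = ∫ z in ball x₀ ρ, ‖g z • (heatKernelGrad t (y - z) - heatKernelGrad t (y - x₀))‖ := by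
        rw [setIntegral_eq_integral_of_forall_compl_eq_zero]
        intro z hz
        rw [hgs z hz, zero_smul, norm_zero]
    _ ≤ (M * ((CA + CB) * ρ * (R' ^ (d + 2))⁻¹)) * volume.real (ball x₀ ρ) := by
        refine (Real.le_norm_self _).trans (norm_setIntegral_le_of_norm_le_const measure_ball_lt_top ?_)
        intro z hz
        rw [norm_norm, norm_smul, Real.norm_eq_abs]
        exact mul_le_mul (hgM z) (hker z hz) (norm_nonneg _) hM
    _ = (CA + CB) * M * volume.real (ball x₀ ρ) * ρ * (R' ^ (d + 2))⁻¹ := by ring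

/-! ### The Carleson boxes and the annuli -/

omit [InnerProductSpace ℝ E] [FiniteDimensional ℝ E] [MeasurableSpace E] [BorelSpace E] in
/-- Every point of `(0, ∞) × E` lies in some dyadic Carleson box over `x₀`. [folklore] -/
theorem Ioi_prod_univ_subset_iUnion_box [NormedSpace ℝ E] (x₀ : E) {R : ℝ} (hR : 0 < R) :
    Set.Ioi (0 : ℝ) ×ˢ (Set.univ : Set E) ⊆
      ⋃ k : ℕ, Set.Ioo (0 : ℝ) ((2 ^ k * R) ^ 2) ×ˢ ball x₀ (2 ^ k * R) := by
  rintro ⟨t, y⟩ ⟨ht, -⟩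
  simp only [Set.mem_Ioi] at ht
  obtain ⟨k, hk⟩ := exists_nat_gt (max (Real.sqrt t) ‖y - x₀‖ / R)
  have h2k : (k : ℝ) ≤ 2 ^ k := by exact_mod_cast Nat.lt_two_pow_self.le
  have hlt : max (Real.sqrt t) ‖y - x₀‖ < 2 ^ k * R := by
    rw [div_lt_iff₀ hR] at hk
    nlinarith
  refine Set.mem_iUnion.mpr ⟨k, ⟨ht, ?_⟩, ?_⟩
  · have h1 : Real.sqrt t < 2 ^ k * R := lt_of_le_of_lt (le_max_left _ _) hlt
    calc t = Real.sqrt t ^ 2 := (Real.sq_sqrt ht.le).symm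
      _ < (2 ^ k * R) ^ 2 := by gcongr
  · exact mem_ball_iff_norm.mpr (lt_of_le_of_lt (le_max_right _ _) hlt)

omit [NormedAddCommGroup E] [InnerProductSpace ℝ E] [FiniteDimensional ℝ E] [MeasurableSpace E] [BorelSpace E] in
/-- A nested sequence of sets is covered by the first set and the successive differences. [folklore] -/
theorem iUnion_subset_first_union_iUnion_diff (S : ℕ → Set (ℝ × E)) :
    (⋃ k, S k) ⊆ S 0 ∪ ⋃ k, (S (k + 1) \ S k) := by
  intro p hp
  obtain ⟨k, hk⟩ := Set.mem_iUnion.mp hp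
  induction k with
  | zero => exact Or.inl hk
  | succ k ih =>
    by_cases h : p ∈ S k
    · exact ih h
    · exact Or.inr (Set.mem_iUnion.mpr ⟨k, hk, h⟩)

/-- Set `lintegral`s over a product set as iterated integrals (Tonelli, inequality form, no
measurability needed). [folklore] -/
theorem setLIntegral_prod_le (F : ℝ × E → ℝ≥0∞) (s : Set ℝ) (B : Set E) :
    ∫⁻ p in s ×ˢ B, F p ≤ ∫⁻ t in s, ∫⁻ y in B, F (t, y) := by
  rw [Measure.volume_eq_prod, ← Measure.prod_restrict]
  exact lintegral_prod_le _

/-- The Carleson box integral of `‖∇e^{tΔ}f‖²` is at most `γ R^d`, `γ = eCarlesonGradNorm f`. [folklore] -/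
theorem setLIntegral_box_enorm_sq_le (f : E → ℝ) (x₀ : E) {R : ℝ} (hR : 0 < R) :
    ∫⁻ p in Set.Ioo (0 : ℝ) (R ^ 2) ×ˢ ball x₀ R, ‖heatExtensionGrad f p.1 p.2‖ₑ ^ 2 ≤
      eCarlesonGradNorm f * ENNReal.ofReal (R ^ Module.finrank ℝ E) := by
  refine (setLIntegral_prod_le _ _ _).trans ?_
  have h := mul_lintegral_le_eCarlesonGradNorm f x₀ hR
  have hRd : ENNReal.ofReal (R ^ Module.finrank ℝ E) ≠ 0 := by
    rw [ne_eq, ENNReal.ofReal_eq_zero, not_le]; positivity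
  calc ∫⁻ t in Set.Ioo 0 (R ^ 2), ∫⁻ y in ball x₀ R, ‖heatExtensionGrad f t y‖ₑ ^ 2
      = ENNReal.ofReal (R ^ Module.finrank ℝ E) * ((ENNReal.ofReal (R ^ Module.finrank ℝ E))⁻¹ *
          ∫⁻ t in Set.Ioo 0 (R ^ 2), ∫⁻ y in ball x₀ R, ‖heatExtensionGrad f t y‖ₑ ^ 2) := by
        rw [← mul_assoc, ENNReal.mul_inv_cancel hRd ENNReal.ofReal_ne_top, one_mul]
    _ ≤ ENNReal.ofReal (R ^ Module.finrank ℝ E) * eCarlesonGradNorm f := by gcongr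
    _ = _ := mul_comm _ _

omit [InnerProductSpace ℝ E] [FiniteDimensional ℝ E] [MeasurableSpace E] [BorelSpace E] in
/-- `2ab ≤ ε a² + ε⁻¹ b²` in `ℝ≥0∞`, for `ε ∈ (0, ∞)`. [folklore] -/
theorem _root_.ENNReal.two_mul_mul_le_eps (a b : ℝ≥0∞) {ε : ℝ≥0∞} (h0 : ε ≠ 0) (htop : ε ≠ ⊤) :
    2 * (a * b) ≤ ε * a ^ 2 + ε⁻¹ * b ^ 2 := by
  rcases eq_or_ne a ⊤ with rfl | ha
  · rw [ENNReal.top_pow two_ne_zero, ENNReal.mul_top h0]; exact le_top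
  rcases eq_or_ne b ⊤ with rfl | hb
  · rw [ENNReal.top_pow two_ne_zero, ENNReal.mul_top (ENNReal.inv_ne_zero.mpr htop)]
    exact le_top.trans_eq (by simp)
  lift a to ℝ≥0 using ha
  lift b to ℝ≥0 using hb
  lift ε to ℝ≥0 using htop
  have hε : ε ≠ 0 := by simpa using h0
  rw [← ENNReal.coe_inv hε]
  norm_cast
  rw [← NNReal.coe_le_coe]
  push_cast
  have hε' : (0 : ℝ) < ε := by positivity
  have key : 2 * ((a : ℝ) * b) * ε ≤ (ε * (a : ℝ) ^ 2 + (ε : ℝ)⁻¹ * (b : ℝ) ^ 2) * ε := by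
    have : (ε * (a : ℝ) ^ 2 + (ε : ℝ)⁻¹ * (b : ℝ) ^ 2) * ε = (ε * a) ^ 2 + (b : ℝ) ^ 2 := by
      field_simp
    rw [this]
    nlinarith [sq_nonneg ((ε : ℝ) * a - b)]
  exact le_of_mul_le_mul_right key hε'

/-- `∫ |g|² ≤ M² |B(x₀, ρ)|` for `|g| ≤ M` vanishing off `B(x₀, ρ)`. [folklore] -/
theorem lintegral_enorm_sq_le_of_support {g : E → ℝ} {x₀ : E} {ρ M : ℝ}
    (hgM : ∀ z, |g z| ≤ M) (hgs : ∀ z, z ∉ ball x₀ ρ → g z = 0) :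
    ∫⁻ z, ‖g z‖ₑ ^ 2 ≤ ENNReal.ofReal (M ^ 2) * volume (ball x₀ ρ) := by
  have hM : 0 ≤ M := (abs_nonneg _).trans (hgM x₀)
  have h1 : ∫⁻ z, ‖g z‖ₑ ^ 2 = ∫⁻ z in ball x₀ ρ, ‖g z‖ₑ ^ 2 := by
    rw [← lintegral_indicator measurableSet_ball]
    refine lintegral_congr fun z => ?_
    by_cases hz : z ∈ ball x₀ ρ
    · rw [Set.indicator_of_mem hz]
    · rw [Set.indicator_of_notMem hz, hgs z hz]; simp
  rw [h1, ← setLIntegral_const]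
  refine setLIntegral_mono' measurableSet_ball fun z _ => ?_
  rw [← ofReal_norm, ← ENNReal.ofReal_pow (norm_nonneg _), Real.norm_eq_abs]
  exact ENNReal.ofReal_le_ofReal (pow_le_pow_left₀ (abs_nonneg _) (hgM z) 2)

/-- A bounded function vanishing off a ball is in `L²`. [folklore] -/
theorem memLp_two_of_support {g : E → ℝ} {x₀ : E} {ρ M : ℝ} (hgi : Integrable g)
    (hgM : ∀ z, |g z| ≤ M) (hgs : ∀ z, z ∉ ball x₀ ρ → g z = 0) : MemLp g 2 volume := by
  rw [memLp_two_iff_integrable_sq_norm hgi.1]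
  refine ⟨hgi.1.norm.pow 2, ?_⟩
  rw [hasFiniteIntegral_iff_enorm]
  have h1 : ∀ z, ‖‖g z‖ ^ 2‖ₑ = ‖g z‖ₑ ^ 2 := fun z => by
    rw [Real.enorm_eq_ofReal (sq_nonneg _), ENNReal.ofReal_pow (norm_nonneg _), ofReal_norm]
  simp_rw [h1]
  exact (lintegral_enorm_sq_le_of_support hgM hgs).trans_lt
    (ENNReal.mul_lt_top ENNReal.ofReal_lt_top measure_ball_lt_top)

/-- **The tent estimate**: over the Carleson box `(0, R²) × B(x₀, R)`,
`∫∫ 2 ‖∇e^{tΔ}f‖ ‖∇e^{tΔ}g‖ ≤ γ R^d + ½ M² |B(x₀, ρ)|`. [folklore] -/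
theorem setLIntegral_box_two_mul_le {f g : E → ℝ} {x₀ : E} {ρ M : ℝ} (hgi : Integrable g)
    (hgM : ∀ z, |g z| ≤ M) (hgs : ∀ z, z ∉ ball x₀ ρ → g z = 0) {R : ℝ} (hR : 0 < R) :
    ∫⁻ p in Set.Ioo (0 : ℝ) (R ^ 2) ×ˢ ball x₀ R,
        2 * (‖heatExtensionGrad f p.1 p.2‖ₑ * ‖heatExtensionGrad g p.1 p.2‖ₑ) ≤
      eCarlesonGradNorm f * ENNReal.ofReal (R ^ Module.finrank ℝ E) +
        ENNReal.ofReal (1 / 2) * (ENNReal.ofReal (M ^ 2) * volume (ball x₀ ρ)) := by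
  have hpt : ∀ p : ℝ × E, 2 * (‖heatExtensionGrad f p.1 p.2‖ₑ * ‖heatExtensionGrad g p.1 p.2‖ₑ) ≤
      ‖heatExtensionGrad f p.1 p.2‖ₑ ^ 2 + ‖heatExtensionGrad g p.1 p.2‖ₑ ^ 2 := by
    intro p
    have := ENNReal.two_mul_mul_le_eps ‖heatExtensionGrad f p.1 p.2‖ₑ ‖heatExtensionGrad g p.1 p.2‖ₑ
      one_ne_zero ENNReal.one_ne_top
    simpa using this
  have hmeas : Measurable fun p : ℝ × E => ‖heatExtensionGrad g p.1 p.2‖ₑ ^ 2 :=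
    (measurable_heatExtensionGrad hgi.1).enorm.pow_const 2
  calc ∫⁻ p in Set.Ioo (0 : ℝ) (R ^ 2) ×ˢ ball x₀ R,
        2 * (‖heatExtensionGrad f p.1 p.2‖ₑ * ‖heatExtensionGrad g p.1 p.2‖ₑ)
      ≤ ∫⁻ p in Set.Ioo (0 : ℝ) (R ^ 2) ×ˢ ball x₀ R,
          (‖heatExtensionGrad f p.1 p.2‖ₑ ^ 2 + ‖heatExtensionGrad g p.1 p.2‖ₑ ^ 2) :=
        lintegral_mono fun p => hpt p
    _ = (∫⁻ p in Set.Ioo (0 : ℝ) (R ^ 2) ×ˢ ball x₀ R, ‖heatExtensionGrad f p.1 p.2‖ₑ ^ 2) +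
          ∫⁻ p in Set.Ioo (0 : ℝ) (R ^ 2) ×ˢ ball x₀ R, ‖heatExtensionGrad g p.1 p.2‖ₑ ^ 2 :=
        lintegral_add_right _ hmeas
    _ ≤ eCarlesonGradNorm f * ENNReal.ofReal (R ^ Module.finrank ℝ E) +
          ∫⁻ t in Set.Ioi (0 : ℝ), ∫⁻ y, ‖heatExtensionGrad g t y‖ₑ ^ 2 := by
        gcongr
        · exact setLIntegral_box_enorm_sq_le f x₀ hR
        · refine (lintegral_mono_set (Set.prod_mono Set.Ioo_subset_Ioi_self (Set.subset_univ _))).trans ?_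
          refine (setLIntegral_prod_le _ _ _).trans (lintegral_mono fun t => ?_)
          exact (setLIntegral_le_lintegral _ _)
    _ ≤ _ := by
        gcongr
        exact (lintegral_Ioi_lintegral_enorm_heatExtensionGrad_sq_le hgi
          (memLp_two_of_support hgi hgM hgs)).trans (by gcongr; exact lintegral_enorm_sq_le_of_support hgM hgs)

end Annuli

section Total

variable {E : Type*} [NormedAddCommGroup E] [InnerProductSpace ℝ E] [FiniteDimensional ℝ E]
  [MeasurableSpace E] [BorelSpace E]

/-- **One annulus**: if `‖∇e^{tΔ}g‖ ≤ D R'^{-(d+2)}` on `box(2R') ∖ box(R')`, then for `ε > 0`,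
`∫∫_{annulus} 2‖∇e^{tΔ}f‖‖∇e^{tΔ}g‖ ≤ ε γ (2R')^d + ε⁻¹ (D R'^{-(d+2)})² (2R')² |B(x₀, 2R')|`. [folklore] -/
theorem setLIntegral_annulus_two_mul_le {f g : E → ℝ} (hgm : AEStronglyMeasurable g volume) {x₀ : E}
    {R' D ε : ℝ} (hR' : 0 < R') (hε : 0 < ε)
    (hGg : ∀ p ∈ (Set.Ioo (0 : ℝ) ((2 * R') ^ 2) ×ˢ ball x₀ (2 * R')) \
        (Set.Ioo (0 : ℝ) (R' ^ 2) ×ˢ ball x₀ R'),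
      ‖heatExtensionGrad g p.1 p.2‖ ≤ D * (R' ^ (Module.finrank ℝ E + 2))⁻¹) :
    ∫⁻ p in (Set.Ioo (0 : ℝ) ((2 * R') ^ 2) ×ˢ ball x₀ (2 * R')) \
        (Set.Ioo (0 : ℝ) (R' ^ 2) ×ˢ ball x₀ R'),
        2 * (‖heatExtensionGrad f p.1 p.2‖ₑ * ‖heatExtensionGrad g p.1 p.2‖ₑ) ≤
      ENNReal.ofReal ε * (eCarlesonGradNorm f * ENNReal.ofReal ((2 * R') ^ Module.finrank ℝ E)) +
        (ENNReal.ofReal ε)⁻¹ * (ENNReal.ofReal ((D * (R' ^ (Module.finrank ℝ E + 2))⁻¹) ^ 2) *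
          (ENNReal.ofReal ((2 * R') ^ 2) * volume (ball x₀ (2 * R')))) := by
  set A := (Set.Ioo (0 : ℝ) ((2 * R') ^ 2) ×ˢ ball x₀ (2 * R')) \
    (Set.Ioo (0 : ℝ) (R' ^ 2) ×ˢ ball x₀ R') with hA
  have hAm : MeasurableSet A :=
    (measurableSet_Ioo.prod measurableSet_ball).diff (measurableSet_Ioo.prod measurableSet_ball)
  have hε0 : ENNReal.ofReal ε ≠ 0 := by rw [ne_eq, ENNReal.ofReal_eq_zero, not_le]; exact hε
  have hpt : ∀ p : ℝ × E, 2 * (‖heatExtensionGrad f p.1 p.2‖ₑ * ‖heatExtensionGrad g p.1 p.2‖ₑ) ≤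
      ENNReal.ofReal ε * ‖heatExtensionGrad f p.1 p.2‖ₑ ^ 2 +
        (ENNReal.ofReal ε)⁻¹ * ‖heatExtensionGrad g p.1 p.2‖ₑ ^ 2 := fun p =>
    ENNReal.two_mul_mul_le_eps _ _ hε0 ENNReal.ofReal_ne_top
  calc ∫⁻ p in A, 2 * (‖heatExtensionGrad f p.1 p.2‖ₑ * ‖heatExtensionGrad g p.1 p.2‖ₑ)
      ≤ ∫⁻ p in A, (ENNReal.ofReal ε * ‖heatExtensionGrad f p.1 p.2‖ₑ ^ 2 +
          (ENNReal.ofReal ε)⁻¹ * ‖heatExtensionGrad g p.1 p.2‖ₑ ^ 2) := lintegral_mono fun p => hpt p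
    _ = (∫⁻ p in A, ENNReal.ofReal ε * ‖heatExtensionGrad f p.1 p.2‖ₑ ^ 2) +
          ∫⁻ p in A, (ENNReal.ofReal ε)⁻¹ * ‖heatExtensionGrad g p.1 p.2‖ₑ ^ 2 :=
        lintegral_add_right _ (((measurable_heatExtensionGrad hgm).enorm.pow_const 2).const_mul _)
    _ = ENNReal.ofReal ε * (∫⁻ p in A, ‖heatExtensionGrad f p.1 p.2‖ₑ ^ 2) +
          (ENNReal.ofReal ε)⁻¹ * ∫⁻ p in A, ‖heatExtensionGrad g p.1 p.2‖ₑ ^ 2 := by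
        rw [lintegral_const_mul' _ _ ENNReal.ofReal_ne_top,
          lintegral_const_mul' _ _ (ENNReal.inv_ne_top.mpr hε0)]
    _ ≤ ENNReal.ofReal ε * (eCarlesonGradNorm f * ENNReal.ofReal ((2 * R') ^ Module.finrank ℝ E)) +
          (ENNReal.ofReal ε)⁻¹ * (ENNReal.ofReal ((D * (R' ^ (Module.finrank ℝ E + 2))⁻¹) ^ 2) * volume A) := by
        gcongr
        · exact (lintegral_mono_set Set.sdiff_subset).trans
            (setLIntegral_box_enorm_sq_le f x₀ (by positivity))
        · rw [← setLIntegral_const]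
          refine setLIntegral_mono' hAm fun p hp => ?_
          rw [← ofReal_norm, ← ENNReal.ofReal_pow (norm_nonneg _)]
          exact ENNReal.ofReal_le_ofReal (pow_le_pow_left₀ (norm_nonneg _) (hGg p hp) 2)
    _ ≤ _ := by
        gcongr
        calc volume A ≤ volume (Set.Ioo (0 : ℝ) ((2 * R') ^ 2) ×ˢ ball x₀ (2 * R')) :=
              measure_mono Set.sdiff_subset
          _ = ENNReal.ofReal ((2 * R') ^ 2) * volume (ball x₀ (2 * R')) := by
              rw [Measure.volume_eq_prod, Measure.prod_prod, Real.volume_Ioo, sub_zero]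

/-- The volume of a ball as `ofReal (r^d |B(0,1)|)`. [folklore] -/
theorem volume_ball_eq_ofReal (x : E) {r : ℝ} (hr : 0 < r) :
    volume (ball x r) = ENNReal.ofReal (r ^ Module.finrank ℝ E * volume.real (ball (0 : E) 1)) := by
  rw [Measure.addHaar_ball_of_pos _ x hr, ENNReal.ofReal_mul (by positivity), measureReal_def,
    ENNReal.ofReal_toReal measure_ball_lt_top.ne]

omit [InnerProductSpace ℝ E] [FiniteDimensional ℝ E] [MeasurableSpace E] [BorelSpace E] in
/-- The algebra of one annulus: with `r = 2^k · 2ρ`, `ε = (ρ/r)^{d+1}`, `D = C M ρ^d V₁ ρ`,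
`ε γ (2r)^d + ε⁻¹ (D r^{-(d+2)})² (2r)² (2r)^d V₁ = (2^d γ/2 + 2^{d+1} V₁³ C² M²) ρ^d 2^{-k}`. [folklore] -/
theorem annulus_algebra (d k : ℕ) {ρ r : ℝ} (γr C M V₁ : ℝ) (hρ : 0 < ρ) (hr : r = 2 ^ k * (2 * ρ)) :
    (ρ / r) ^ (d + 1) * (γr * (2 * r) ^ d) +
        ((ρ / r) ^ (d + 1))⁻¹ * ((C * M * (ρ ^ d * V₁) * ρ * (r ^ (d + 2))⁻¹) ^ 2 *
          ((2 * r) ^ 2 * ((2 * r) ^ d * V₁))) =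
      (2 ^ d / 2 * γr + 2 ^ (d + 1) * V₁ ^ 3 * C ^ 2 * M ^ 2) * ρ ^ d * (2⁻¹) ^ k := by
  have hr0 : 0 < r := by rw [hr]; positivity
  have key1 : (ρ / r) ^ (d + 1) * (γr * (2 * r) ^ d) = 2 ^ d * γr * ρ ^ (d + 1) * r⁻¹ := by
    rw [div_pow, mul_pow]
    field_simp
    ring
  have key2 : ((ρ / r) ^ (d + 1))⁻¹ * ((C * M * (ρ ^ d * V₁) * ρ * (r ^ (d + 2))⁻¹) ^ 2 *
      ((2 * r) ^ 2 * ((2 * r) ^ d * V₁))) = 2 ^ (d + 2) * C ^ 2 * M ^ 2 * V₁ ^ 3 * ρ ^ (d + 1) * r⁻¹ := by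
    rw [div_pow, mul_pow, mul_pow, inv_div]
    field_simp
    ring
  have hrinv : r⁻¹ = (2 * ρ)⁻¹ * (2⁻¹) ^ k := by
    rw [hr, mul_inv, inv_pow]; ring
  rw [key1, key2, hrinv]
  field_simp
  ring

/-- **The total estimate** (Stein, *Harmonic Analysis*, IV §4.4, tent plus dyadic annuli, caloric
form): there are constants `A₁, A₂` depending only on `E` such that for every `f` with finite
Carleson `BMO` quantity `γ = eCarlesonGradNorm f` and every mean-zero `g` with `|g| ≤ M`
supported in `B(x₀, ρ)`,
`∫∫_{(0,∞) × E} 2 ‖∇e^{tΔ}f‖ ‖∇e^{tΔ}g‖ ≤ (A₁ γ + A₂ M²) ρ^d`. [folklore] -/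
theorem exists_lintegral_two_mul_enorm_mul_enorm_le :
    ∃ A₁ A₂ : ℝ, 0 ≤ A₁ ∧ 0 ≤ A₂ ∧ ∀ {f g : E → ℝ} {x₀ : E} {ρ M : ℝ},
      eCarlesonGradNorm f < ∞ → Integrable g → 0 < ρ → (∀ z, |g z| ≤ M) →
      (∀ z, z ∉ ball x₀ ρ → g z = 0) → (∫ z, g z = 0) →
      ∫⁻ p in Set.Ioi (0 : ℝ) ×ˢ (Set.univ : Set E),
          2 * (‖heatExtensionGrad f p.1 p.2‖ₑ * ‖heatExtensionGrad g p.1 p.2‖ₑ) ≤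
        ENNReal.ofReal ((A₁ * (eCarlesonGradNorm f).toReal + A₂ * M ^ 2) * ρ ^ Module.finrank ℝ E) := by
  obtain ⟨C, hC0, hC⟩ := exists_norm_heatExtensionGrad_le_annulus (E := E)
  set V₁ : ℝ := volume.real (ball (0 : E) 1) with hV₁
  have hV₁0 : 0 ≤ V₁ := measureReal_nonneg
  refine ⟨2 ^ (Module.finrank ℝ E + 1), 1 / 2 * V₁ + 2 ^ (Module.finrank ℝ E + 2) * V₁ ^ 3 * C ^ 2,
    by positivity, by positivity, ?_⟩
  intro f g x₀ ρ M hγ hgi hρ hgM hgs hg0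
  have hM : 0 ≤ M := (abs_nonneg _).trans (hgM x₀)
  set γr : ℝ := (eCarlesonGradNorm f).toReal with hγr
  have hγr0 : 0 ≤ γr := ENNReal.toReal_nonneg
  have hγe : eCarlesonGradNorm f = ENNReal.ofReal γr := (ENNReal.ofReal_toReal hγ.ne).symm
  -- the dyadic boxes
  set R : ℝ := 2 * ρ with hR
  have hR0 : 0 < R := by positivity
  set Rk : ℕ → ℝ := fun k => 2 ^ k * R with hRk
  have hRk0 : ∀ k, 0 < Rk k := fun k => by positivity
  have hRk_succ : ∀ k, Rk (k + 1) = 2 * Rk k := fun k => by simp only [hRk, pow_succ]; ring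
  set box : ℕ → Set (ℝ × E) := fun k => Set.Ioo (0 : ℝ) (Rk k ^ 2) ×ˢ ball x₀ (Rk k) with hbox
  -- covering
  have hcover : Set.Ioi (0 : ℝ) ×ˢ (Set.univ : Set E) ⊆ box 0 ∪ ⋃ k, (box (k + 1) \ box k) :=
    (Ioi_prod_univ_subset_iUnion_box x₀ hR0).trans (iUnion_subset_first_union_iUnion_diff box)
  -- tent
  have htent : ∫⁻ p in box 0, 2 * (‖heatExtensionGrad f p.1 p.2‖ₑ * ‖heatExtensionGrad g p.1 p.2‖ₑ) ≤
      ENNReal.ofReal ((2 ^ Module.finrank ℝ E * γr + 1 / 2 * V₁ * M ^ 2) * ρ ^ Module.finrank ℝ E) := by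
    have h := setLIntegral_box_two_mul_le (f := f) hgi hgM hgs (hRk0 0)
    refine h.trans (le_of_eq ?_)
    rw [hγe, volume_ball_eq_ofReal x₀ hρ, ← hV₁,
      ← ENNReal.ofReal_mul hγr0, ← ENNReal.ofReal_mul (sq_nonneg M), ← ENNReal.ofReal_mul (by norm_num),
      ← ENNReal.ofReal_add (by positivity) (by positivity)]
    congr 1
    simp only [hRk, hR, pow_zero, one_mul, mul_pow]
    ring
  -- annuli
  have hann : ∀ k, ∫⁻ p in box (k + 1) \ box k,
      2 * (‖heatExtensionGrad f p.1 p.2‖ₑ * ‖heatExtensionGrad g p.1 p.2‖ₑ) ≤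
      ENNReal.ofReal ((2 ^ Module.finrank ℝ E / 2 * γr + 2 ^ (Module.finrank ℝ E + 1) * V₁ ^ 3 * C ^ 2 * M ^ 2) *
        ρ ^ Module.finrank ℝ E) * (2⁻¹) ^ k := by
    intro k
    set D : ℝ := C * M * volume.real (ball x₀ ρ) * ρ with hD
    have hD0 : 0 ≤ D := by positivity
    set ε : ℝ := (ρ / Rk k) ^ (Module.finrank ℝ E + 1) with hε
    have hε0 : 0 < ε := by positivity
    have hGg : ∀ p ∈ (Set.Ioo (0 : ℝ) ((2 * Rk k) ^ 2) ×ˢ ball x₀ (2 * Rk k)) \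
        (Set.Ioo (0 : ℝ) (Rk k ^ 2) ×ˢ ball x₀ (Rk k)),
        ‖heatExtensionGrad g p.1 p.2‖ ≤ D * (Rk k ^ (Module.finrank ℝ E + 2))⁻¹ := by
      rintro ⟨t, y⟩ ⟨⟨ht, hy⟩, hnot⟩
      simp only [Set.mem_Ioo] at ht
      have hρR : 2 * ρ ≤ Rk k := by
        simp only [hRk, hR]
        have : (1 : ℝ) ≤ 2 ^ k := one_le_pow₀ (by norm_num)
        nlinarith
      have hcase : Rk k ^ 2 ≤ t ∨ Rk k ≤ ‖y - x₀‖ := by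
        by_contra h
        rw [not_or, not_le, not_le] at h
        exact hnot ⟨⟨ht.1, h.1⟩, mem_ball_iff_norm.mpr h.2⟩
      exact hC hρ hgM hgs hg0 hgi hρR ht.1 hy hcase
    have h := setLIntegral_annulus_two_mul_le (f := f) hgi.1 (hRk0 k) hε0 hGg
    rw [show box (k + 1) = Set.Ioo (0 : ℝ) ((2 * Rk k) ^ 2) ×ˢ ball x₀ (2 * Rk k) by
      simp only [hbox, hRk_succ]]
    refine h.trans (le_of_eq ?_)
    have hVρ : volume.real (ball x₀ ρ) = ρ ^ Module.finrank ℝ E * V₁ := by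
      rw [measureReal_def, volume_ball_eq_ofReal x₀ hρ, ENNReal.toReal_ofReal (by positivity)]
    rw [hγe, volume_ball_eq_ofReal x₀ (by positivity : (0 : ℝ) < 2 * Rk k), ← hV₁,
      ← ENNReal.ofReal_inv_of_pos hε0,
      ← ENNReal.ofReal_mul hγr0, ← ENNReal.ofReal_mul hε0.le,
      ← ENNReal.ofReal_mul (by positivity), ← ENNReal.ofReal_mul (by positivity),
      ← ENNReal.ofReal_mul (by positivity), ← ENNReal.ofReal_add (by positivity) (by positivity),
      show ((2 : ℝ≥0∞)⁻¹) ^ k = ENNReal.ofReal ((2⁻¹) ^ k) by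
        rw [ENNReal.ofReal_pow (by norm_num), ENNReal.ofReal_inv_of_pos two_pos, ENNReal.ofReal_ofNat],
      ← ENNReal.ofReal_mul (by positivity)]
    congr 1
    rw [hD, hVρ, hε]
    exact annulus_algebra (Module.finrank ℝ E) k γr C M V₁ hρ (by simp only [hRk, hR])
  -- sum
  calc ∫⁻ p in Set.Ioi (0 : ℝ) ×ˢ (Set.univ : Set E),
        2 * (‖heatExtensionGrad f p.1 p.2‖ₑ * ‖heatExtensionGrad g p.1 p.2‖ₑ)
      ≤ ∫⁻ p in box 0 ∪ ⋃ k, (box (k + 1) \ box k),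
          2 * (‖heatExtensionGrad f p.1 p.2‖ₑ * ‖heatExtensionGrad g p.1 p.2‖ₑ) :=
        lintegral_mono_set hcover
    _ ≤ (∫⁻ p in box 0, 2 * (‖heatExtensionGrad f p.1 p.2‖ₑ * ‖heatExtensionGrad g p.1 p.2‖ₑ)) +
          ∫⁻ p in ⋃ k, (box (k + 1) \ box k),
            2 * (‖heatExtensionGrad f p.1 p.2‖ₑ * ‖heatExtensionGrad g p.1 p.2‖ₑ) :=
        lintegral_union_le _ _ _
    _ ≤ ENNReal.ofReal ((2 ^ Module.finrank ℝ E * γr + 1 / 2 * V₁ * M ^ 2) * ρ ^ Module.finrank ℝ E) +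
          ∑' k, ∫⁻ p in box (k + 1) \ box k,
            2 * (‖heatExtensionGrad f p.1 p.2‖ₑ * ‖heatExtensionGrad g p.1 p.2‖ₑ) :=
        add_le_add htent (lintegral_iUnion_le _ _)
    _ ≤ ENNReal.ofReal ((2 ^ Module.finrank ℝ E * γr + 1 / 2 * V₁ * M ^ 2) * ρ ^ Module.finrank ℝ E) +
          ∑' k : ℕ, ENNReal.ofReal ((2 ^ Module.finrank ℝ E / 2 * γr +
            2 ^ (Module.finrank ℝ E + 1) * V₁ ^ 3 * C ^ 2 * M ^ 2) * ρ ^ Module.finrank ℝ E) * (2⁻¹ : ℝ≥0∞) ^ k := by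
        gcongr with k
        exact hann k
    _ = ENNReal.ofReal ((2 ^ Module.finrank ℝ E * γr + 1 / 2 * V₁ * M ^ 2) * ρ ^ Module.finrank ℝ E) +
          ENNReal.ofReal ((2 ^ Module.finrank ℝ E / 2 * γr +
            2 ^ (Module.finrank ℝ E + 1) * V₁ ^ 3 * C ^ 2 * M ^ 2) * ρ ^ Module.finrank ℝ E) * 2 := by
        rw [ENNReal.tsum_mul_left, ENNReal.tsum_geometric, ENNReal.one_sub_inv_two, inv_inv]
    _ = ENNReal.ofReal ((2 ^ (Module.finrank ℝ E + 1) * γr +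
          (1 / 2 * V₁ + 2 ^ (Module.finrank ℝ E + 2) * V₁ ^ 3 * C ^ 2) * M ^ 2) * ρ ^ Module.finrank ℝ E) := by
        rw [← ENNReal.ofReal_ofNat 2, ← ENNReal.ofReal_mul' (by norm_num),
          ← ENNReal.ofReal_add (by positivity) (by positivity)]
        congr 1
        ring

end Total

section Limits

variable {E : Type*} [NormedAddCommGroup E] [InnerProductSpace ℝ E] [FiniteDimensional ℝ E]
  [MeasurableSpace E] [BorelSpace E]

/-- `∫ K_a(v - z) dz = 1` for `a > 0`. [folklore] -/
theorem integral_heatKernel_sub (v : E) {a : ℝ} (ha : 0 < a) : ∫ z, heatKernel a (v - z) = 1 := by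
  rw [integral_sub_left_eq_self (heatKernel a) volume v]
  exact Literature.Analysis.UnboundedOperators.integral_heatKernel_eq_one_holds ha

/-- `|e^{aΔ}g(v)| ≤ M` when `|g| ≤ M` (`K_a` is a probability density). [folklore] -/
theorem abs_heatExtension_le {g : E → ℝ} {M : ℝ} (hgM : ∀ z, |g z| ≤ M) {a : ℝ}
    (ha : 0 < a) (v : E) : |heatExtension g a v| ≤ M := by
  have hM : 0 ≤ M := (abs_nonneg _).trans (hgM v)
  calc |heatExtension g a v| = ‖∫ z, heatKernel a (v - z) * g z‖ := rfl
    _ ≤ ∫ z, ‖heatKernel a (v - z) * g z‖ := norm_integral_le_integral_norm _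
    _ ≤ ∫ z, heatKernel a (v - z) * M := by
        refine integral_mono_of_nonneg (Eventually.of_forall fun z => norm_nonneg _)
          (((Literature.Analysis.UnboundedOperators.integrable_heatKernel_holds ha).comp_sub_left v).mul_const M)
          (Eventually.of_forall fun z => ?_)
        beta_reduce
        rw [norm_mul, Real.norm_of_nonneg (show 0 ≤ heatKernel a (v - z) from (Literature.Analysis.UnboundedOperators.heatKernel_pos ha _).le),
          Real.norm_eq_abs]
        exact mul_le_mul_of_nonneg_left (hgM z) (Literature.Analysis.UnboundedOperators.heatKernel_pos ha _).le
    _ = M := by rw [integral_mul_const, integral_heatKernel_sub v ha, one_mul]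

omit [MeasurableSpace E] [BorelSpace E] in
/-- Far-field polynomial bound for the heat kernel at small times: for `0 < a ≤ 1` and
`‖c‖ ≥ δ/2 > 0`, `K_a(c) ≤ P 4^{d+2} δ^{-2(d+2)}` with `P = (4π)^{-d/2} (d+2)! 4^{d+2}`. [folklore] -/
theorem heatKernel_le_of_norm_ge {a δ : ℝ} (ha : 0 < a) (ha1 : a ≤ 1) (hδ : 0 < δ) {c : E}
    (hc : δ / 2 ≤ ‖c‖) :
    heatKernel a c ≤ (4 * Real.pi) ^ (-(Module.finrank ℝ E : ℝ) / 2) * (Module.finrank ℝ E + 2).factorial *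
      4 ^ (Module.finrank ℝ E + 2) * 2 ^ (2 * (Module.finrank ℝ E + 2)) *
        (δ ^ (2 * (Module.finrank ℝ E + 2)))⁻¹ := by
  set P : ℝ := (4 * Real.pi) ^ (-(Module.finrank ℝ E : ℝ) / 2) * (Module.finrank ℝ E + 2).factorial *
    4 ^ (Module.finrank ℝ E + 2) with hP
  have hc0 : 0 < ‖c‖ := lt_of_lt_of_le (by positivity) hc
  have h1 := norm_pow_mul_heatKernel_le ha c
  have hs1 : Real.sqrt a ^ (Module.finrank ℝ E + 4) ≤ 1 :=
    pow_le_one₀ (Real.sqrt_nonneg _) (Real.sqrt_le_one.mpr ha1)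
  have h2 : ‖c‖ ^ (2 * (Module.finrank ℝ E + 2)) * heatKernel a c ≤ P := by
    refine h1.trans ?_
    calc P * Real.sqrt a ^ (Module.finrank ℝ E + 4) ≤ P * 1 := by gcongr
      _ = P := mul_one _
  have h3 : heatKernel a c ≤ P * (‖c‖ ^ (2 * (Module.finrank ℝ E + 2)))⁻¹ := by
    rw [← div_eq_mul_inv, le_div_iff₀ (by positivity), mul_comm]; exact h2
  have h4 : (‖c‖ ^ (2 * (Module.finrank ℝ E + 2)))⁻¹ ≤
      2 ^ (2 * (Module.finrank ℝ E + 2)) * (δ ^ (2 * (Module.finrank ℝ E + 2)))⁻¹ := by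
    have := pow_le_pow_left₀ (by positivity) hc (2 * (Module.finrank ℝ E + 2))
    calc (‖c‖ ^ (2 * (Module.finrank ℝ E + 2)))⁻¹ ≤ ((δ / 2) ^ (2 * (Module.finrank ℝ E + 2)))⁻¹ :=
          inv_anti₀ (by positivity) this
      _ = _ := by rw [div_pow]; field_simp
  calc heatKernel a c ≤ P * (‖c‖ ^ (2 * (Module.finrank ℝ E + 2)))⁻¹ := h3
    _ ≤ P * (2 ^ (2 * (Module.finrank ℝ E + 2)) * (δ ^ (2 * (Module.finrank ℝ E + 2)))⁻¹) := by gcongr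
    _ = _ := by ring

omit [InnerProductSpace ℝ E] [FiniteDimensional ℝ E] [MeasurableSpace E] [BorelSpace E] in
/-- Converting decay in `‖v - x₀‖` into Stein's weight: for `2ρ ≤ δ`,
`δ^{-(d+1)} ≤ ((1+2ρ)/(2ρ))^{d+1} (1+δ)^{-(d+1)}`. [folklore] -/
theorem inv_pow_le_inv_one_add_pow {ρ δ : ℝ} (hρ : 0 < ρ) (hδ : 2 * ρ ≤ δ) (K : ℕ) :
    (δ ^ K)⁻¹ ≤ ((1 + 2 * ρ) / (2 * ρ)) ^ K * ((1 + δ) ^ K)⁻¹ := by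
  have hδ0 : 0 < δ := by linarith
  have h1 : 1 + δ ≤ δ * ((1 + 2 * ρ) / (2 * ρ)) := by
    rw [mul_div_assoc', le_div_iff₀ (by positivity)]
    nlinarith
  have h2 : (1 + δ) ^ K ≤ δ ^ K * ((1 + 2 * ρ) / (2 * ρ)) ^ K := by
    rw [← mul_pow]; exact pow_le_pow_left₀ (by positivity) h1 K
  rw [← div_eq_mul_inv, le_div_iff₀ (by positivity)]
  calc (δ ^ K)⁻¹ * (1 + δ) ^ K ≤ (δ ^ K)⁻¹ * (δ ^ K * ((1 + 2 * ρ) / (2 * ρ)) ^ K) := by gcongr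
    _ = ((1 + 2 * ρ) / (2 * ρ)) ^ K := by rw [← mul_assoc, inv_mul_cancel₀ (by positivity), one_mul]

/-- **Domination for small times**: for `g` with `|g| ≤ M` vanishing off `B(x₀, ρ)`, there is `C`
with `|e^{aΔ}g(v)| ≤ C (1 + ‖v - x₀‖)^{-(d+1)}` for all `0 < a ≤ 1` and `v`. [folklore] -/
theorem exists_abs_heatExtension_le_of_le_one {g : E → ℝ} {x₀ : E} {ρ M : ℝ}
    (hρ : 0 < ρ) (hgM : ∀ z, |g z| ≤ M) (hgs : ∀ z, z ∉ ball x₀ ρ → g z = 0) :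
    ∃ C : ℝ, 0 ≤ C ∧ ∀ {a : ℝ}, 0 < a → a ≤ 1 → ∀ v : E,
      |heatExtension g a v| ≤ C * ((1 + ‖v - x₀‖) ^ (Module.finrank ℝ E + 1))⁻¹ := by
  set d := Module.finrank ℝ E with hd
  have hM : 0 ≤ M := (abs_nonneg _).trans (hgM x₀)
  set P' : ℝ := (4 * Real.pi) ^ (-(d : ℝ) / 2) * (d + 2).factorial * 4 ^ (d + 2) * 2 ^ (2 * (d + 2))
    with hP'
  set Cfar : ℝ := M * (P' * ((2 * ρ) ^ (d + 3))⁻¹ * ((1 + 2 * ρ) / (2 * ρ)) ^ (d + 1)) *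
    volume.real (ball x₀ ρ) with hCfar
  set Cnear : ℝ := M * (1 + 2 * ρ) ^ (d + 1) with hCnear
  refine ⟨Cfar + Cnear, by positivity, ?_⟩
  intro a ha ha1 v
  have hfar0 : 0 ≤ Cfar * ((1 + ‖v - x₀‖) ^ (d + 1))⁻¹ := by positivity
  have hnear0 : 0 ≤ Cnear * ((1 + ‖v - x₀‖) ^ (d + 1))⁻¹ := by positivity
  rcases lt_or_ge ‖v - x₀‖ (2 * ρ) with hnear | hfar
  · -- near: `|T_a g| ≤ M ≤ Cnear (1+‖v-x₀‖)^{-(d+1)}`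
    have h1 := abs_heatExtension_le hgM ha v
    have h2 : M ≤ Cnear * ((1 + ‖v - x₀‖) ^ (d + 1))⁻¹ := by
      rw [hCnear, mul_assoc]
      refine le_mul_of_one_le_right hM ?_
      rw [← div_eq_mul_inv, one_le_div (by positivity)]
      exact pow_le_pow_left₀ (by positivity) (by linarith) _
    calc |heatExtension g a v| ≤ M := h1
      _ ≤ Cnear * ((1 + ‖v - x₀‖) ^ (d + 1))⁻¹ := h2
      _ ≤ (Cfar + Cnear) * ((1 + ‖v - x₀‖) ^ (d + 1))⁻¹ := by rw [add_mul]; linarith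
  · -- far: polynomial decay of the kernel on the support
    set δ := ‖v - x₀‖ with hδ
    have hδ0 : 0 < δ := by linarith
    have hker : ∀ z ∈ ball x₀ ρ, heatKernel a (v - z) ≤
        P' * ((2 * ρ) ^ (d + 3))⁻¹ * ((1 + 2 * ρ) / (2 * ρ)) ^ (d + 1) * ((1 + δ) ^ (d + 1))⁻¹ := by
      intro z hz
      have hz' : ‖z - x₀‖ < ρ := mem_ball_iff_norm.mp hz
      have hc : δ / 2 ≤ ‖v - z‖ := by
        have := norm_sub_norm_le (v - x₀) (z - x₀)
        rw [sub_sub_sub_cancel_right] at this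
        linarith
      have h1 := heatKernel_le_of_norm_ge ha ha1 hδ0 hc
      rw [← hd] at h1
      -- `δ^{-2(d+2)} = δ^{-(d+3)} δ^{-(d+1)} ≤ (2ρ)^{-(d+3)} δ^{-(d+1)}`
      have h2 : (δ ^ (2 * (d + 2)))⁻¹ ≤ ((2 * ρ) ^ (d + 3))⁻¹ * (((1 + 2 * ρ) / (2 * ρ)) ^ (d + 1) *
          ((1 + δ) ^ (d + 1))⁻¹) := by
        have e1 : (δ ^ (2 * (d + 2)))⁻¹ = (δ ^ (d + 3))⁻¹ * (δ ^ (d + 1))⁻¹ := by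
          rw [← mul_inv, ← pow_add]; ring_nf
        rw [e1]
        exact mul_le_mul (inv_anti₀ (by positivity) (pow_le_pow_left₀ (by positivity) hfar _))
          (inv_pow_le_inv_one_add_pow hρ hfar (d + 1)) (by positivity) (by positivity)
      calc heatKernel a (v - z) ≤ P' * (δ ^ (2 * (d + 2)))⁻¹ := h1
        _ ≤ P' * (((2 * ρ) ^ (d + 3))⁻¹ * (((1 + 2 * ρ) / (2 * ρ)) ^ (d + 1) * ((1 + δ) ^ (d + 1))⁻¹)) := by
            gcongr
        _ = _ := by ring
    have h1 : |heatExtension g a v| ≤ Cfar * ((1 + δ) ^ (d + 1))⁻¹ := by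
      calc |heatExtension g a v| = ‖∫ z, heatKernel a (v - z) * g z‖ := rfl
        _ ≤ ∫ z, ‖heatKernel a (v - z) * g z‖ := norm_integral_le_integral_norm _
        _ = ∫ z in ball x₀ ρ, ‖heatKernel a (v - z) * g z‖ := by
            rw [setIntegral_eq_integral_of_forall_compl_eq_zero]
            intro z hz; rw [hgs z hz, mul_zero, norm_zero]
        _ ≤ (P' * ((2 * ρ) ^ (d + 3))⁻¹ * ((1 + 2 * ρ) / (2 * ρ)) ^ (d + 1) * ((1 + δ) ^ (d + 1))⁻¹ * M) *
              volume.real (ball x₀ ρ) := by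
            refine (Real.le_norm_self _).trans (norm_setIntegral_le_of_norm_le_const measure_ball_lt_top ?_)
            intro z hz
            rw [norm_norm, norm_mul, Real.norm_of_nonneg (show 0 ≤ heatKernel a (v - z) from
              (Literature.Analysis.UnboundedOperators.heatKernel_pos ha _).le), Real.norm_eq_abs]
            exact mul_le_mul (hker z hz) (hgM z) (abs_nonneg _) (by positivity)
        _ = Cfar * ((1 + δ) ^ (d + 1))⁻¹ := by rw [hCfar]; ring
    calc |heatExtension g a v| ≤ Cfar * ((1 + δ) ^ (d + 1))⁻¹ := h1
      _ ≤ (Cfar + Cnear) * ((1 + δ) ^ (d + 1))⁻¹ := by rw [add_mul]; linarith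

/-- Representation of `e^{bΔ}g` for mean-zero `g`: `e^{bΔ}g(v) = ∫ (K_b(v - z) - K_b(v - x₀)) g(z) dz`. [folklore] -/
theorem heatExtension_eq_integral_sub {g : E → ℝ} (hgi : Integrable g) (hg0 : ∫ z, g z = 0) (x₀ : E)
    {b : ℝ} (hb : 0 < b) (v : E) :
    heatExtension g b v = ∫ z, (heatKernel b (v - z) - heatKernel b (v - x₀)) * g z := by
  have h1 : ∫ z, heatKernel b (v - x₀) * g z = 0 := by rw [integral_const_mul, hg0, mul_zero]
  calc heatExtension g b v = (∫ z, heatKernel b (v - z) * g z) - ∫ z, heatKernel b (v - x₀) * g z := by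
        rw [h1, sub_zero]; rfl
    _ = ∫ z, (heatKernel b (v - z) * g z - heatKernel b (v - x₀) * g z) :=
        (integral_sub (integrable_heatKernel_sub_mul hgi hb v) (hgi.const_mul _)).symm
    _ = _ := integral_congr_ae (Eventually.of_forall fun z => by ring)

/-- **Decay in time for mean-zero `g`**: `|e^{bΔ}g(v)| ≤ M |B(x₀,ρ)| ρ (4πb)^{-d/2} (√b)⁻¹`. [folklore] -/
theorem abs_heatExtension_le_of_integral_eq_zero {g : E → ℝ} {x₀ : E} {ρ M : ℝ} (hgi : Integrable g)
    (hgM : ∀ z, |g z| ≤ M) (hgs : ∀ z, z ∉ ball x₀ ρ → g z = 0) (hg0 : ∫ z, g z = 0)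
    {b : ℝ} (hb : 0 < b) (v : E) :
    |heatExtension g b v| ≤ M * volume.real (ball x₀ ρ) * ρ *
      ((4 * Real.pi * b) ^ (-(Module.finrank ℝ E : ℝ) / 2) * (Real.sqrt b)⁻¹) := by
  haveI : CompleteSpace E := FiniteDimensional.complete ℝ E
  have hM : 0 ≤ M := (abs_nonneg _).trans (hgM x₀)
  set A : ℝ := (4 * Real.pi * b) ^ (-(Module.finrank ℝ E : ℝ) / 2) * (Real.sqrt b)⁻¹ with hA
  have hA0 : 0 ≤ A := by positivity
  rcases le_or_gt ρ 0 with hρ | hρ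
  · have hball : ball x₀ ρ = ∅ := Metric.ball_eq_empty.mpr hρ
    have hg : ∀ z, g z = 0 := fun z => hgs z (by rw [hball]; exact Set.notMem_empty z)
    have : heatExtension g b v = 0 := by simp [heatExtension, hg]
    rw [this, abs_zero, hball]
    simp
  rw [heatExtension_eq_integral_sub hgi hg0 x₀ hb v]
  have hker : ∀ z ∈ ball x₀ ρ, |heatKernel b (v - z) - heatKernel b (v - x₀)| ≤ A * ρ := by
    intro z hz
    have h := abs_heatKernel_sub_le_of_bound (t := b) (v - z) (v - x₀)
      (fun c _ => norm_heatKernelGrad_le_const hb c)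
    refine h.trans ?_
    rw [sub_sub_sub_cancel_left, norm_sub_rev]
    exact mul_le_mul_of_nonneg_left (mem_ball_iff_norm.mp hz).le hA0
  calc |∫ z, (heatKernel b (v - z) - heatKernel b (v - x₀)) * g z|
      = ‖∫ z, (heatKernel b (v - z) - heatKernel b (v - x₀)) * g z‖ := rfl
    _ ≤ ∫ z, ‖(heatKernel b (v - z) - heatKernel b (v - x₀)) * g z‖ := norm_integral_le_integral_norm _
    _ = ∫ z in ball x₀ ρ, ‖(heatKernel b (v - z) - heatKernel b (v - x₀)) * g z‖ := by
        rw [setIntegral_eq_integral_of_forall_compl_eq_zero]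
        intro z hz; rw [hgs z hz, mul_zero, norm_zero]
    _ ≤ (A * ρ * M) * volume.real (ball x₀ ρ) := by
        refine (Real.le_norm_self _).trans (norm_setIntegral_le_of_norm_le_const measure_ball_lt_top ?_)
        intro z hz
        rw [norm_norm, norm_mul, Real.norm_eq_abs, Real.norm_eq_abs]
        exact mul_le_mul (hker z hz) (hgM z) (abs_nonneg _) (by positivity)
    _ = _ := by ring

/-- **Domination for all times, mean-zero `g`**: there is `C` with
`|e^{bΔ}g(v)| ≤ C (1 + ‖v - x₀‖)^{-(d+1)}` for all `b > 0` (uniform off-diagonal decay of `∇K_b`). [folklore] -/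
theorem exists_abs_heatExtension_le_of_integral_eq_zero {g : E → ℝ} {x₀ : E} {ρ M : ℝ}
    (hgi : Integrable g) (hρ : 0 < ρ) (hgM : ∀ z, |g z| ≤ M) (hgs : ∀ z, z ∉ ball x₀ ρ → g z = 0)
    (hg0 : ∫ z, g z = 0) :
    ∃ C : ℝ, 0 ≤ C ∧ ∀ {b : ℝ}, 0 < b → ∀ v : E,
      |heatExtension g b v| ≤ C * ((1 + ‖v - x₀‖) ^ (Module.finrank ℝ E + 1))⁻¹ := by
  haveI : CompleteSpace E := FiniteDimensional.complete ℝ E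
  set d := Module.finrank ℝ E with hd
  have hM : 0 ≤ M := (abs_nonneg _).trans (hgM x₀)
  set Cfar : ℝ := M * (2 * (d + 2).factorial * 2 ^ (d + 1) * ((1 + 2 * ρ) / (2 * ρ)) ^ (d + 1) * ρ) *
    volume.real (ball x₀ ρ) with hCfar
  set Cnear : ℝ := M * (1 + 2 * ρ) ^ (d + 1) with hCnear
  refine ⟨Cfar + Cnear, by positivity, ?_⟩
  intro b hb v
  have hfar0 : 0 ≤ Cfar * ((1 + ‖v - x₀‖) ^ (d + 1))⁻¹ := by positivity
  have hnear0 : 0 ≤ Cnear * ((1 + ‖v - x₀‖) ^ (d + 1))⁻¹ := by positivity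
  rcases lt_or_ge ‖v - x₀‖ (2 * ρ) with hnear | hfar
  · have h1 := abs_heatExtension_le hgM hb v
    have h2 : M ≤ Cnear * ((1 + ‖v - x₀‖) ^ (d + 1))⁻¹ := by
      rw [hCnear, mul_assoc]
      refine le_mul_of_one_le_right hM ?_
      rw [← div_eq_mul_inv, one_le_div (by positivity)]
      exact pow_le_pow_left₀ (by positivity) (by linarith) _
    calc |heatExtension g b v| ≤ M := h1
      _ ≤ Cnear * ((1 + ‖v - x₀‖) ^ (d + 1))⁻¹ := h2
      _ ≤ (Cfar + Cnear) * ((1 + ‖v - x₀‖) ^ (d + 1))⁻¹ := by rw [add_mul]; linarith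
  · set δ := ‖v - x₀‖ with hδ
    have hδ0 : 0 < δ := by linarith
    -- the gradient bound on segments from `v - x₀` to `v - z`, `z ∈ B(x₀, ρ)`
    have hseg : ∀ z ∈ ball x₀ ρ, ∀ c ∈ segment ℝ (v - x₀) (v - z),
        ‖heatKernelGrad b c‖ ≤ 2 * (d + 2).factorial * 2 ^ (d + 1) * (δ ^ (d + 1))⁻¹ := by
      intro z hz c hc
      have hz' : ‖z - x₀‖ < ρ := mem_ball_iff_norm.mp hz
      have hcq : ‖c - (v - x₀)‖ ≤ ρ := by
        have h := segment_subset_closedBall_left (v - x₀) (v - z) hc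
        rw [mem_closedBall, dist_eq_norm, dist_eq_norm, sub_sub_sub_cancel_left] at h
        exact h.trans hz'.le
      have hcn : δ / 2 ≤ ‖c‖ := by
        have := norm_sub_norm_le (v - x₀) c
        rw [norm_sub_rev (v - x₀) c] at this
        linarith
      have hc0 : 0 < ‖c‖ := lt_of_lt_of_le (by positivity) hcn
      have h1 := norm_pow_mul_norm_heatKernelGrad_le hb c
      rw [← hd] at h1
      have h2 : ‖heatKernelGrad b c‖ ≤ 2 * (d + 2).factorial * (‖c‖ ^ (d + 1))⁻¹ := by
        rw [← div_eq_mul_inv, le_div_iff₀ (by positivity), mul_comm]; exact h1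
      have h3 : (‖c‖ ^ (d + 1))⁻¹ ≤ 2 ^ (d + 1) * (δ ^ (d + 1))⁻¹ := by
        calc (‖c‖ ^ (d + 1))⁻¹ ≤ ((δ / 2) ^ (d + 1))⁻¹ :=
              inv_anti₀ (by positivity) (pow_le_pow_left₀ (by positivity) hcn _)
          _ = _ := by rw [div_pow]; field_simp
      calc ‖heatKernelGrad b c‖ ≤ 2 * (d + 2).factorial * (‖c‖ ^ (d + 1))⁻¹ := h2
        _ ≤ 2 * (d + 2).factorial * (2 ^ (d + 1) * (δ ^ (d + 1))⁻¹) := by gcongr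
        _ = _ := by ring
    have hker : ∀ z ∈ ball x₀ ρ, |heatKernel b (v - z) - heatKernel b (v - x₀)| ≤
        2 * (d + 2).factorial * 2 ^ (d + 1) * (δ ^ (d + 1))⁻¹ * ρ := by
      intro z hz
      have h := abs_heatKernel_sub_le_of_bound (t := b) (v - z) (v - x₀) (hseg z hz)
      refine h.trans ?_
      rw [sub_sub_sub_cancel_left, norm_sub_rev]
      exact mul_le_mul_of_nonneg_left (mem_ball_iff_norm.mp hz).le (by positivity)
    have h1 : |heatExtension g b v| ≤
        M * (2 * (d + 2).factorial * 2 ^ (d + 1) * (δ ^ (d + 1))⁻¹ * ρ) * volume.real (ball x₀ ρ) := by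
      rw [heatExtension_eq_integral_sub hgi hg0 x₀ hb v]
      calc |∫ z, (heatKernel b (v - z) - heatKernel b (v - x₀)) * g z|
          = ‖∫ z, (heatKernel b (v - z) - heatKernel b (v - x₀)) * g z‖ := rfl
        _ ≤ ∫ z, ‖(heatKernel b (v - z) - heatKernel b (v - x₀)) * g z‖ := norm_integral_le_integral_norm _
        _ = ∫ z in ball x₀ ρ, ‖(heatKernel b (v - z) - heatKernel b (v - x₀)) * g z‖ := by
            rw [setIntegral_eq_integral_of_forall_compl_eq_zero]
            intro z hz; rw [hgs z hz, mul_zero, norm_zero]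
        _ ≤ (2 * (d + 2).factorial * 2 ^ (d + 1) * (δ ^ (d + 1))⁻¹ * ρ * M) * volume.real (ball x₀ ρ) := by
            refine (Real.le_norm_self _).trans (norm_setIntegral_le_of_norm_le_const measure_ball_lt_top ?_)
            intro z hz
            rw [norm_norm, norm_mul, Real.norm_eq_abs, Real.norm_eq_abs]
            exact mul_le_mul (hker z hz) (hgM z) (abs_nonneg _) (by positivity)
        _ = _ := by ring
    have h2 : M * (2 * (d + 2).factorial * 2 ^ (d + 1) * (δ ^ (d + 1))⁻¹ * ρ) * volume.real (ball x₀ ρ) ≤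
        Cfar * ((1 + δ) ^ (d + 1))⁻¹ := by
      have h := inv_pow_le_inv_one_add_pow hρ hfar (d + 1)
      calc M * (2 * (d + 2).factorial * 2 ^ (d + 1) * (δ ^ (d + 1))⁻¹ * ρ) * volume.real (ball x₀ ρ)
          ≤ M * (2 * (d + 2).factorial * 2 ^ (d + 1) * (((1 + 2 * ρ) / (2 * ρ)) ^ (d + 1) *
              ((1 + δ) ^ (d + 1))⁻¹) * ρ) * volume.real (ball x₀ ρ) := by gcongr
        _ = Cfar * ((1 + δ) ^ (d + 1))⁻¹ := by rw [hCfar]; ring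
    calc |heatExtension g b v| ≤ Cfar * ((1 + δ) ^ (d + 1))⁻¹ := h1.trans h2
      _ ≤ (Cfar + Cnear) * ((1 + δ) ^ (d + 1))⁻¹ := by rw [add_mul]; linarith

end Limits

section PointwiseLimits

variable {E : Type*} [NormedAddCommGroup E] [InnerProductSpace ℝ E] [FiniteDimensional ℝ E]
  [MeasurableSpace E] [BorelSpace E]

omit [FiniteDimensional ℝ E] [MeasurableSpace E] [BorelSpace E] in
/-- Parabolic scaling of the heat kernel: `c^d K_1(c x) = K_{c⁻²}(x)` for `c > 0`. [folklore] -/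
theorem pow_mul_heatKernel_one_smul {c : ℝ} (hc : 0 < c) (x : E) :
    c ^ Module.finrank ℝ E * heatKernel 1 (c • x) = heatKernel ((c ^ 2)⁻¹) x := by
  set d := Module.finrank ℝ E with hd
  unfold heatKernel
  rw [norm_smul, Real.norm_of_nonneg hc.le, mul_pow, mul_one]
  have h1 : (4 * Real.pi * (c ^ 2)⁻¹) ^ (-(d : ℝ) / 2) = c ^ d * (4 * Real.pi) ^ (-(d : ℝ) / 2) := by
    rw [Real.mul_rpow (by positivity) (by positivity), mul_comm]
    congr 1
    rw [show ((c : ℝ) ^ 2)⁻¹ = c ^ (-(2 : ℝ)) by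
        rw [Real.rpow_neg hc.le, Real.rpow_two], ← Real.rpow_mul hc.le,
      show (-(2 : ℝ)) * (-(d : ℝ) / 2) = d by ring, Real.rpow_natCast]
  rw [h1, mul_assoc]
  congr 2
  field_simp

omit [MeasurableSpace E] [BorelSpace E] in
/-- Decay of `‖x‖^d K_1(x)` at infinity (needed for the peak-function lemma). [folklore] -/
theorem tendsto_norm_pow_mul_heatKernel_one :
    Tendsto (fun x : E => ‖x‖ ^ Module.finrank ℝ E * heatKernel 1 x) (Bornology.cobounded E) (𝓝 0) := by
  set d := Module.finrank ℝ E with hd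
  set P : ℝ := (4 * Real.pi) ^ (-(d : ℝ) / 2) * (d + 2).factorial * 4 ^ (d + 2) with hP
  have hP0 : 0 ≤ P := by positivity
  -- `‖x‖^d K_1(x) ≤ P ‖x‖^{-(d+4)}` for `x ≠ 0`
  have hbound : ∀ x : E, 1 ≤ ‖x‖ → ‖x‖ ^ d * heatKernel 1 x ≤ P * ‖x‖⁻¹ := by
    intro x hx
    have hx0 : 0 < ‖x‖ := by linarith
    have h1 := norm_pow_mul_heatKernel_le (E := E) one_pos x
    rw [← hd, Real.sqrt_one, one_pow, mul_one] at h1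
    -- `‖x‖^d K = ‖x‖^{-(d+4)} (‖x‖^{2(d+2)} K) ≤ ‖x‖^{-(d+4)} P ≤ ‖x‖⁻¹ P`
    have h2 : ‖x‖ ^ d * heatKernel 1 x = (‖x‖ ^ (d + 4))⁻¹ * (‖x‖ ^ (2 * (d + 2)) * heatKernel 1 x) := by
      have : ‖x‖ ^ (2 * (d + 2)) = ‖x‖ ^ (d + 4) * ‖x‖ ^ d := by rw [← pow_add]; ring_nf
      rw [this]; field_simp
    rw [h2]
    have h3 : (‖x‖ ^ (d + 4))⁻¹ ≤ ‖x‖⁻¹ := by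
      refine inv_anti₀ hx0 ?_
      calc ‖x‖ = ‖x‖ ^ 1 := (pow_one _).symm
        _ ≤ ‖x‖ ^ (d + 4) := pow_le_pow_right₀ hx (by omega)
    calc (‖x‖ ^ (d + 4))⁻¹ * (‖x‖ ^ (2 * (d + 2)) * heatKernel 1 x) ≤ ‖x‖⁻¹ * P :=
          mul_le_mul h3 h1 (mul_nonneg (by positivity) (Literature.Analysis.UnboundedOperators.heatKernel_pos one_pos x).le) (by positivity)
      _ = P * ‖x‖⁻¹ := mul_comm _ _
  rw [(Metric.hasBasis_cobounded_compl_closedBall (0 : E)).tendsto_iff Metric.nhds_basis_ball]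
  intro ε hε
  refine ⟨max 1 (P / ε + 1), trivial, fun x hx => ?_⟩
  simp only [Set.mem_compl_iff, mem_closedBall, dist_zero_right, not_le] at hx
  have hx1 : 1 ≤ ‖x‖ := le_trans (le_max_left _ _) hx.le
  have hx2 : P / ε < ‖x‖ := by linarith [le_max_right 1 (P / ε + 1)]
  rw [mem_ball, dist_zero_right,
    Real.norm_of_nonneg (show 0 ≤ ‖x‖ ^ d * heatKernel 1 x from mul_nonneg (by positivity) (Literature.Analysis.UnboundedOperators.heatKernel_pos one_pos x).le)]
  refine lt_of_le_of_lt (hbound x hx1) ?_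
  rw [div_lt_iff₀ hε] at hx2
  rw [← div_eq_mul_inv, div_lt_iff₀ (by linarith)]
  linarith

/-- **The caloric extension converges at continuity points**: for `g ∈ L¹` continuous at `v`,
`e^{aΔ}g(v) → g(v)` as `a → 0⁺` (the heat kernels form a family of peak functions). [folklore] -/
theorem tendsto_heatExtension_nhdsWithin_zero {g : E → ℝ} (hgi : Integrable g) {v : E}
    (hgc : ContinuousAt g v) :
    Tendsto (fun a : ℝ => heatExtension g a v) (𝓝[>] 0) (𝓝 (g v)) := by
  have hlim := tendsto_integral_comp_smul_smul_of_integrable' (μ := volume)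
    (fun x => (Literature.Analysis.UnboundedOperators.heatKernel_pos one_pos x).le) (Literature.Analysis.UnboundedOperators.integral_heatKernel_eq_one_holds (E := E) one_pos)
    tendsto_norm_pow_mul_heatKernel_one hgi hgc
  -- `a ↦ (√a)⁻¹ → ∞` as `a → 0⁺`
  have hsqrt : Tendsto (fun a : ℝ => (Real.sqrt a)⁻¹) (𝓝[>] 0) atTop := by
    refine tendsto_inv_nhdsGT_zero.comp ?_
    refine tendsto_nhdsWithin_of_tendsto_nhds_of_eventually_within _ ?_ ?_
    · have h := (Real.continuous_sqrt.tendsto 0).mono_left (nhdsWithin_le_nhds (s := Set.Ioi (0 : ℝ)))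
      rwa [Real.sqrt_zero] at h
    · filter_upwards [self_mem_nhdsWithin] with a (ha : 0 < a)
      exact Real.sqrt_pos.mpr ha
  refine ((hlim.comp hsqrt).congr' ?_)
  filter_upwards [self_mem_nhdsWithin] with a (ha : 0 < a)
  simp only [Function.comp_apply]
  show ∫ x, ((Real.sqrt a)⁻¹ ^ Module.finrank ℝ E * heatKernel 1 ((Real.sqrt a)⁻¹ • (v - x))) • g x =
    heatExtension g a v
  refine integral_congr_ae (Eventually.of_forall fun x => ?_)
  beta_reduce
  rw [pow_mul_heatKernel_one_smul (inv_pos.mpr (Real.sqrt_pos.mpr ha)), inv_pow, inv_inv,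
    Real.sq_sqrt ha.le, smul_eq_mul]

/-- **The caloric extension of a mean-zero atom tends to zero** as `b → ∞`, pointwise. [folklore] -/
theorem tendsto_heatExtension_atTop {g : E → ℝ} {x₀ : E} {ρ M : ℝ} (hgi : Integrable g)
    (hgM : ∀ z, |g z| ≤ M) (hgs : ∀ z, z ∉ ball x₀ ρ → g z = 0) (hg0 : ∫ z, g z = 0) (v : E) :
    Tendsto (fun b : ℝ => heatExtension g b v) atTop (𝓝 0) := by
  set d := Module.finrank ℝ E with hd
  -- `(4πb)^{-d/2} (√b)⁻¹ → 0`
  have h1 : Tendsto (fun b : ℝ => (4 * Real.pi * b) ^ (-(d : ℝ) / 2) * (Real.sqrt b)⁻¹) atTop (𝓝 0) := by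
    have hb : ∀ᶠ b : ℝ in atTop, |(4 * Real.pi * b) ^ (-(d : ℝ) / 2) * (Real.sqrt b)⁻¹| ≤ (Real.sqrt b)⁻¹ := by
      filter_upwards [Ici_mem_atTop (1 : ℝ)] with b hb
      have hb0 : 0 < b := by linarith [Set.mem_Ici.mp hb]
      rw [abs_of_nonneg (by positivity)]
      refine mul_le_of_le_one_left (by positivity) ?_
      refine Real.rpow_le_one_of_one_le_of_nonpos ?_ ?_
      · nlinarith [Real.two_le_pi, Set.mem_Ici.mp hb]
      · rw [neg_div]; exact neg_nonpos.mpr (by positivity)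
    have h0 : Tendsto (fun b : ℝ => (Real.sqrt b)⁻¹) atTop (𝓝 0) :=
      tendsto_inv_atTop_zero.comp (Real.tendsto_sqrt_atTop)
    exact squeeze_zero_norm' hb h0
  have h2 : Tendsto (fun b : ℝ => M * volume.real (ball x₀ ρ) * ρ *
      ((4 * Real.pi * b) ^ (-(d : ℝ) / 2) * (Real.sqrt b)⁻¹)) atTop (𝓝 0) := by
    simpa using h1.const_mul (M * volume.real (ball x₀ ρ) * ρ)
  refine squeeze_zero_norm' ?_ h2
  filter_upwards [Ioi_mem_atTop (0 : ℝ)] with b hb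
  exact abs_heatExtension_le_of_integral_eq_zero hgi hgM hgs hg0 hb v

end PointwiseLimits

section DualityBound

variable {E : Type*} [NormedAddCommGroup E] [InnerProductSpace ℝ E] [FiniteDimensional ℝ E]
  [MeasurableSpace E] [BorelSpace E]

/-- **Dominated convergence as `a → 0⁺`**: `∫ f e^{aΔ}g → ∫ f g` for `f` of Stein growth and `g`
continuous, bounded, supported in a ball. [folklore] -/
theorem tendsto_integral_mul_heatExtension_nhdsWithin_zero {f g : E → ℝ} {x₀ : E} {ρ M : ℝ}
    (hfw : Integrable fun w => ((1 + ‖w‖) ^ (Module.finrank ℝ E + 1))⁻¹ * f w)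
    (hgc : Continuous g) (hgi : Integrable g) (hρ : 0 < ρ) (hgM : ∀ z, |g z| ≤ M)
    (hgs : ∀ z, z ∉ ball x₀ ρ → g z = 0) :
    Tendsto (fun a : ℝ => ∫ v, f v * heatExtension g a v) (𝓝[>] 0) (𝓝 (∫ v, f v * g v)) := by
  set K := Module.finrank ℝ E + 1 with hK
  obtain ⟨C, hC0, hC⟩ := exists_abs_heatExtension_le_of_le_one hρ hgM hgs
  have hfm : AEStronglyMeasurable f volume := aestronglyMeasurable_of_growth hfw
  have hmem : Set.Ioc (0 : ℝ) 1 ∈ 𝓝[>] (0 : ℝ) := Ioc_mem_nhdsGT zero_lt_one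
  refine tendsto_integral_filter_of_dominated_convergence
    (bound := fun v => C * (1 + ‖x₀‖) ^ K * ‖((1 + ‖v‖) ^ K)⁻¹ * f v‖) ?_ ?_ ?_ ?_
  · filter_upwards [hmem] with a ha
    exact hfm.mul (continuous_heatExtension hgi ha.1).aestronglyMeasurable
  · filter_upwards [hmem] with a ha
    refine Eventually.of_forall fun v => ?_
    rw [norm_mul, norm_mul, Real.norm_of_nonneg (by positivity : (0 : ℝ) ≤ ((1 + ‖v‖) ^ K)⁻¹),
      Real.norm_eq_abs, Real.norm_eq_abs]
    have h1 := hC ha.1 ha.2 v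
    have h2 := inv_one_add_norm_sub_pow_le v x₀ K
    calc |f v| * |heatExtension g a v| ≤ |f v| * (C * ((1 + ‖v - x₀‖) ^ K)⁻¹) := by gcongr
      _ ≤ |f v| * (C * ((1 + ‖x₀‖) ^ K * ((1 + ‖v‖) ^ K)⁻¹)) := by gcongr
      _ = C * (1 + ‖x₀‖) ^ K * (((1 + ‖v‖) ^ K)⁻¹ * |f v|) := by ring
  · exact hfw.norm.const_mul _
  · refine Eventually.of_forall fun v => ?_
    exact (tendsto_heatExtension_nhdsWithin_zero hgi hgc.continuousAt).const_mul (f v)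

/-- **Dominated convergence as `b → ∞`**: `∫ f e^{bΔ}g → 0` for `f` of Stein growth and `g`
mean-zero, bounded, supported in a ball. [folklore] -/
theorem tendsto_integral_mul_heatExtension_atTop {f g : E → ℝ} {x₀ : E} {ρ M : ℝ}
    (hfw : Integrable fun w => ((1 + ‖w‖) ^ (Module.finrank ℝ E + 1))⁻¹ * f w)
    (hgi : Integrable g) (hρ : 0 < ρ) (hgM : ∀ z, |g z| ≤ M)
    (hgs : ∀ z, z ∉ ball x₀ ρ → g z = 0) (hg0 : ∫ z, g z = 0) :
    Tendsto (fun b : ℝ => ∫ v, f v * heatExtension g b v) atTop (𝓝 0) := by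
  set K := Module.finrank ℝ E + 1 with hK
  obtain ⟨C, hC0, hC⟩ := exists_abs_heatExtension_le_of_integral_eq_zero hgi hρ hgM hgs hg0
  have hfm : AEStronglyMeasurable f volume := aestronglyMeasurable_of_growth hfw
  have h := tendsto_integral_filter_of_dominated_convergence (l := atTop) (μ := volume)
    (F := fun (b : ℝ) v => f v * heatExtension g b v) (f := fun v => (0 : ℝ))
    (bound := fun v => C * (1 + ‖x₀‖) ^ K * ‖((1 + ‖v‖) ^ K)⁻¹ * f v‖) ?_ ?_ ?_ ?_
  · simpa using h
  · filter_upwards [Ioi_mem_atTop (0 : ℝ)] with b hb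
    exact hfm.mul (continuous_heatExtension hgi hb).aestronglyMeasurable
  · filter_upwards [Ioi_mem_atTop (0 : ℝ)] with b hb
    refine Eventually.of_forall fun v => ?_
    rw [norm_mul, norm_mul, Real.norm_of_nonneg (by positivity : (0 : ℝ) ≤ ((1 + ‖v‖) ^ K)⁻¹),
      Real.norm_eq_abs, Real.norm_eq_abs]
    have h1 := hC hb v
    have h2 := inv_one_add_norm_sub_pow_le v x₀ K
    calc |f v| * |heatExtension g b v| ≤ |f v| * (C * ((1 + ‖v - x₀‖) ^ K)⁻¹) := by gcongr
      _ ≤ |f v| * (C * ((1 + ‖x₀‖) ^ K * ((1 + ‖v‖) ^ K)⁻¹)) := by gcongr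
      _ = C * (1 + ‖x₀‖) ^ K * (((1 + ‖v‖) ^ K)⁻¹ * |f v|) := by ring
  · exact hfw.norm.const_mul _
  · refine Eventually.of_forall fun v => ?_
    simpa using (tendsto_heatExtension_atTop hgi hgM hgs hg0 v).const_mul (f v)

omit [FiniteDimensional ℝ E] [MeasurableSpace E] [BorelSpace E] in
/-- `‖⟪a, b⟫‖ₑ ≤ ‖a‖ₑ ‖b‖ₑ`. [folklore] -/
theorem enorm_inner_le (a b : E) : ‖⟪a, b⟫‖ₑ ≤ ‖a‖ₑ * ‖b‖ₑ := by
  rw [← ofReal_norm, ← ofReal_norm, ← ofReal_norm, ← ENNReal.ofReal_mul (norm_nonneg _)]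
  exact ENNReal.ofReal_le_ofReal (norm_inner_le_norm a b)

/-- **The duality bound** (Fefferman–Stein; Stein, *Harmonic Analysis*, IV §4.3–4.4, in caloric
form): there are constants `A₁, A₂ = A(E)` such that for `f` of Stein growth with finite Carleson
`BMO` quantity `γ` and every continuous mean-zero `g` with `|g| ≤ M` supported in `B(x₀, ρ)`,
`|∫ f g| ≤ (A₁ γ + A₂ M²) ρ^d`. [folklore] -/
theorem exists_abs_integral_mul_le :
    ∃ A₁ A₂ : ℝ, 0 ≤ A₁ ∧ 0 ≤ A₂ ∧ ∀ {f g : E → ℝ} {x₀ : E} {ρ M : ℝ},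
      (Integrable fun w => ((1 + ‖w‖) ^ (Module.finrank ℝ E + 1))⁻¹ * f w) →
      eCarlesonGradNorm f < ∞ → Continuous g → 0 < ρ → (∀ z, |g z| ≤ M) →
      (∀ z, z ∉ ball x₀ ρ → g z = 0) → (∫ z, g z = 0) →
      |∫ v, f v * g v| ≤ (A₁ * (eCarlesonGradNorm f).toReal + A₂ * M ^ 2) * ρ ^ Module.finrank ℝ E := by
  obtain ⟨A₁, A₂, hA₁, hA₂, hA⟩ := exists_lintegral_two_mul_enorm_mul_enorm_le (E := E)
  refine ⟨A₁, A₂, hA₁, hA₂, ?_⟩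
  intro f g x₀ ρ M hfw hγ hgc hρ hgM hgs hg0
  set Kfin : ℝ := (A₁ * (eCarlesonGradNorm f).toReal + A₂ * M ^ 2) * ρ ^ Module.finrank ℝ E with hKfin
  have hKfin0 : 0 ≤ Kfin := by positivity
  -- `g` is integrable: continuous with support in a ball
  have hgi : Integrable g := by
    refine Continuous.integrable_of_hasCompactSupport hgc ?_
    refine HasCompactSupport.of_support_subset_isCompact (isCompact_closedBall x₀ ρ) ?_
    intro z hz
    by_contra h
    exact hz (hgs z fun h' => h (ball_subset_closedBall h'))
  have hQ := hA hγ hgi hρ hgM hgs hg0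
  -- the bound for `0 < a ≤ b`
  have hab : ∀ {a b : ℝ}, 0 < a → a ≤ b →
      |(∫ v, f v * heatExtension g a v) - ∫ v, f v * heatExtension g b v| ≤ Kfin := by
    intro a b ha hab
    rw [integral_mul_heatExtension_sub_eq hfw hgi hρ hgM hgs ha hab, abs_mul, abs_two]
    set μ : Measure (ℝ × E) := (volume.restrict (Set.Ioo (a / 2) (b / 2))).prod volume with hμ
    have hμle : μ ≤ (volume : Measure (ℝ × E)).restrict (Set.Ioi (0 : ℝ) ×ˢ (Set.univ : Set E)) := by
      rw [hμ, Measure.restrict_prod_eq_prod_univ, ← Measure.volume_eq_prod]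
      exact Measure.restrict_mono (Set.prod_mono (Set.Ioo_subset_Ioi_self.trans
        (Set.Ioi_subset_Ioi (by positivity : (0 : ℝ) ≤ a / 2))) subset_rfl) le_rfl
    have h1 : |∫ p, ⟪heatExtensionGrad f p.1 p.2, heatExtensionGrad g p.1 p.2⟫ ∂μ| ≤
        (∫⁻ p, ‖heatExtensionGrad f p.1 p.2‖ₑ * ‖heatExtensionGrad g p.1 p.2‖ₑ ∂μ).toReal := by
      rw [← Real.norm_eq_abs]
      refine (norm_integral_le_lintegral_norm _).trans (ENNReal.toReal_mono ?_ (lintegral_mono fun p => ?_))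
      · refine ne_top_of_le_ne_top (ENNReal.ofReal_ne_top : ENNReal.ofReal Kfin ≠ ⊤) ?_
        calc ∫⁻ p, ‖heatExtensionGrad f p.1 p.2‖ₑ * ‖heatExtensionGrad g p.1 p.2‖ₑ ∂μ
            ≤ ∫⁻ p, 2 * (‖heatExtensionGrad f p.1 p.2‖ₑ * ‖heatExtensionGrad g p.1 p.2‖ₑ) ∂μ :=
              lintegral_mono fun p => by
                calc _ = 1 * (‖heatExtensionGrad f p.1 p.2‖ₑ * ‖heatExtensionGrad g p.1 p.2‖ₑ) := (one_mul _).symm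
                  _ ≤ _ := by gcongr; norm_num
          _ ≤ _ := (lintegral_mono' hμle le_rfl).trans hQ
      · rw [ofReal_norm]
        exact enorm_inner_le _ _
    have h2 : 2 * (∫⁻ p, ‖heatExtensionGrad f p.1 p.2‖ₑ * ‖heatExtensionGrad g p.1 p.2‖ₑ ∂μ).toReal ≤ Kfin := by
      rw [← ENNReal.toReal_ofNat, ← ENNReal.toReal_mul, ← ENNReal.toReal_ofReal hKfin0]
      refine ENNReal.toReal_mono ENNReal.ofReal_ne_top ?_
      rw [← lintegral_const_mul' _ _ (by norm_num)]
      exact (lintegral_mono' hμle le_rfl).trans hQ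
    calc 2 * |∫ p, ⟪heatExtensionGrad f p.1 p.2, heatExtensionGrad g p.1 p.2⟫ ∂μ|
        ≤ 2 * (∫⁻ p, ‖heatExtensionGrad f p.1 p.2‖ₑ * ‖heatExtensionGrad g p.1 p.2‖ₑ ∂μ).toReal := by gcongr
      _ ≤ Kfin := h2
  -- let `b → ∞`, then `a → 0⁺`
  have ha : ∀ {a : ℝ}, 0 < a → |∫ v, f v * heatExtension g a v| ≤ Kfin := by
    intro a ha
    have hlim := tendsto_integral_mul_heatExtension_atTop hfw hgi hρ hgM hgs hg0
    have hlim2 : Tendsto (fun b : ℝ => |(∫ v, f v * heatExtension g a v) - ∫ v, f v * heatExtension g b v|)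
        atTop (𝓝 |(∫ v, f v * heatExtension g a v) - 0|) :=
      (tendsto_const_nhds.sub hlim).abs
    rw [sub_zero] at hlim2
    refine le_of_tendsto hlim2 ?_
    filter_upwards [Ici_mem_atTop a] with b hb
    exact hab ha hb
  have hlim := tendsto_integral_mul_heatExtension_nhdsWithin_zero hfw hgc hgi hρ hgM hgs
  refine le_of_tendsto hlim.abs ?_
  filter_upwards [self_mem_nhdsWithin] with a ha'
  exact ha ha'

end DualityBound

/-! ## From continuous to measurable test functions (mollification) -/

section Mollify

variable {E : Type*} [NormedAddCommGroup E] [InnerProductSpace ℝ E] [FiniteDimensional ℝ E]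
  [MeasurableSpace E] [BorelSpace E]

omit [InnerProductSpace ℝ E] [FiniteDimensional ℝ E] [MeasurableSpace E] [BorelSpace E] in
/-- A sequence of bump functions centred at `0` with outer radii `ρ/(n+1) ≤ ρ → 0` and
`rOut = 2 rIn` (the shape hypothesis of the Lebesgue differentiation theorem for bump
convolutions). [folklore] -/
theorem exists_contDiffBump_seq {ρ : ℝ} (hρ : 0 < ρ) :
    ∃ φ : ℕ → ContDiffBump (0 : E), (∀ n, (φ n).rOut ≤ ρ) ∧
      (∀ n, (φ n).rOut ≤ 2 * (φ n).rIn) ∧ Tendsto (fun n => (φ n).rOut) atTop (𝓝 0) := by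
  have hlt : ∀ n : ℕ, ρ / (2 * ((n : ℝ) + 1)) < ρ / ((n : ℝ) + 1) := by
    intro n
    have h1 : (0 : ℝ) < (n : ℝ) + 1 := by positivity
    rw [div_lt_div_iff_of_pos_left hρ (by positivity) h1]
    linarith
  refine ⟨fun n => ⟨ρ / (2 * ((n : ℝ) + 1)), ρ / ((n : ℝ) + 1), by positivity, hlt n⟩,
    fun n => ?_, fun n => ?_, ?_⟩
  · show ρ / ((n : ℝ) + 1) ≤ ρ
    exact div_le_self hρ.le (by linarith [n.cast_nonneg (α := ℝ)])
  · show ρ / ((n : ℝ) + 1) ≤ 2 * (ρ / (2 * ((n : ℝ) + 1)))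
    have : 2 * (ρ / (2 * ((n : ℝ) + 1))) = ρ / ((n : ℝ) + 1) := by
      field_simp
    rw [this]
  · show Tendsto (fun n : ℕ => ρ / ((n : ℝ) + 1)) atTop (𝓝 0)
    exact tendsto_const_nhds.div_atTop (tendsto_natCast_atTop_atTop.atTop_add tendsto_const_nhds)

/-- **Mollified duality bound.** If the duality estimate `|∫ f g| ≤ (A₁γ + A₂M²)ρ^d` holds for
all continuous mean-zero `g` with `|g| ≤ M` vanishing off `B(x₀, ρ)`, then it holds — with `ρ^d`
replaced by `(2ρ)^d` — for all such *measurable* `g`: the mollifications `φₙ ⋆ g` by normalised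
bump functions are continuous, obey the same bound, have mean zero and vanish off `B(x₀, 2ρ)`;
they converge to `g` a.e. (Lebesgue differentiation), and one passes to the limit in `∫ f (φₙ ⋆ g)`
by dominated convergence since `f` is locally integrable. [folklore] -/
theorem abs_integral_mul_le_of_aestronglyMeasurable {A₁ A₂ : ℝ}
    (hA : ∀ {f g : E → ℝ} {x₀ : E} {ρ M : ℝ},
      (Integrable fun w => ((1 + ‖w‖) ^ (Module.finrank ℝ E + 1))⁻¹ * f w) →
      eCarlesonGradNorm f < ∞ → Continuous g → 0 < ρ → (∀ z, |g z| ≤ M) →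
      (∀ z, z ∉ ball x₀ ρ → g z = 0) → (∫ z, g z = 0) →
      |∫ v, f v * g v| ≤ (A₁ * (eCarlesonGradNorm f).toReal + A₂ * M ^ 2) * ρ ^ Module.finrank ℝ E)
    {f g : E → ℝ} {x₀ : E} {ρ M : ℝ}
    (hfw : Integrable fun w => ((1 + ‖w‖) ^ (Module.finrank ℝ E + 1))⁻¹ * f w)
    (hf : LocallyIntegrable f) (hγ : eCarlesonGradNorm f < ∞)
    (hgm : AEStronglyMeasurable g volume) (hρ : 0 < ρ) (hgM : ∀ z, |g z| ≤ M)
    (hgs : ∀ z, z ∉ ball x₀ ρ → g z = 0) (hg0 : ∫ z, g z = 0) :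
    |∫ v, f v * g v| ≤
      (A₁ * (eCarlesonGradNorm f).toReal + A₂ * M ^ 2) * (2 * ρ) ^ Module.finrank ℝ E := by
  have hM : 0 ≤ M := (abs_nonneg _).trans (hgM x₀)
  -- `g` is integrable
  have hgi : Integrable g := by
    have hg_eq : (ball x₀ ρ).indicator g = g := by
      ext z
      by_cases hz : z ∈ ball x₀ ρ
      · exact Set.indicator_of_mem hz _
      · rw [Set.indicator_of_notMem hz, hgs z hz]
    rw [← hg_eq, integrable_indicator_iff measurableSet_ball]
    exact Measure.integrableOn_of_bounded measure_ball_lt_top.ne hgm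
      (Eventually.of_forall fun z => (Real.norm_eq_abs _).trans_le (hgM z))
  have hgli : LocallyIntegrable g := hgi.locallyIntegrable
  obtain ⟨φ, hφρ, hφ2, hφ0⟩ := exists_contDiffBump_seq (E := E) hρ
  set G : ℕ → E → ℝ := fun n =>
    (φ n).normed volume ⋆[ContinuousLinearMap.lsmul ℝ ℝ, volume] g with hG
  have hGc : ∀ n, Continuous (G n) := fun n =>
    (φ n).hasCompactSupport_normed.continuous_convolution_left _ (φ n).continuous_normed hgli
  have hGM : ∀ n z, |G n z| ≤ M := by
    intro n z
    have hGz : G n z = ∫ t, (φ n).normed volume t * g (z - t) := by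
      simp only [hG, convolution_def, ContinuousLinearMap.lsmul_apply, smul_eq_mul]
    rw [hGz]
    calc |∫ t, (φ n).normed volume t * g (z - t)|
        ≤ ∫ t, |(φ n).normed volume t * g (z - t)| := abs_integral_le_integral_abs
      _ ≤ ∫ t, (φ n).normed volume t * M := by
          refine integral_mono_of_nonneg (Eventually.of_forall fun t => abs_nonneg _)
            ((φ n).integrable_normed.mul_const M) (Eventually.of_forall fun t => ?_)
          beta_reduce
          rw [abs_mul, abs_of_nonneg ((φ n).nonneg_normed t)]
          exact mul_le_mul_of_nonneg_left (hgM _) ((φ n).nonneg_normed t)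
      _ = M := by rw [integral_mul_const, (φ n).integral_normed, one_mul]
  have hGs : ∀ n z, z ∉ ball x₀ (2 * ρ) → G n z = 0 := by
    intro n z hz
    by_contra h
    have hmem : z ∈ Function.support (G n) := h
    have h2 := support_convolution_subset (ContinuousLinearMap.lsmul ℝ ℝ) hmem
    rw [(φ n).support_normed_eq] at h2
    obtain ⟨a, ha, b, hb, hab⟩ := h2
    have hb' : b ∈ ball x₀ ρ := by
      by_contra hb'
      exact hb (hgs b hb')
    apply hz
    rw [← hab]
    rw [mem_ball, dist_zero_right] at ha
    rw [mem_ball] at hb' ⊢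
    calc dist (a + b) x₀ ≤ dist (a + b) b + dist b x₀ := dist_triangle _ _ _
      _ = ‖a‖ + dist b x₀ := by rw [dist_eq_norm, add_sub_cancel_right]
      _ < ρ + ρ := add_lt_add (ha.trans_le (hφρ n)) hb'
      _ = 2 * ρ := by ring
  have hG0 : ∀ n, ∫ z, G n z = 0 := by
    intro n
    have h1 := integral_convolution (ContinuousLinearMap.lsmul ℝ ℝ) (μ := volume) (ν := volume)
      (φ n).integrable_normed hgi
    rw [hg0] at h1
    simpa using h1
  have hlim : ∀ᵐ v ∂volume, Tendsto (fun n => G n v) atTop (𝓝 (g v)) :=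
    ContDiffBump.ae_convolution_tendsto_right_of_locallyIntegrable hφ0
      (Eventually.of_forall hφ2) hgli
  have hbound : ∀ n, |∫ v, f v * G n v| ≤
      (A₁ * (eCarlesonGradNorm f).toReal + A₂ * M ^ 2) * (2 * ρ) ^ Module.finrank ℝ E :=
    fun n => hA hfw hγ (hGc n) (by positivity) (hGM n) (hGs n) (hG0 n)
  -- dominated convergence
  have hfB : Integrable ((ball x₀ (2 * ρ)).indicator f) :=
    ((hf.integrableOn_isCompact (isCompact_closedBall x₀ (2 * ρ))).mono_set
      ball_subset_closedBall).integrable_indicator measurableSet_ball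
  have hT : Tendsto (fun n => ∫ v, f v * G n v) atTop (𝓝 (∫ v, f v * g v)) := by
    refine tendsto_integral_of_dominated_convergence
      (fun v => M * ‖(ball x₀ (2 * ρ)).indicator f v‖)
      (fun n => hf.aestronglyMeasurable.mul (hGc n).aestronglyMeasurable)
      (hfB.norm.const_mul M) (fun n => Eventually.of_forall fun v => ?_)
      (hlim.mono fun v hv => tendsto_const_nhds.mul hv)
    by_cases hv : v ∈ ball x₀ (2 * ρ)
    · rw [Set.indicator_of_mem hv, norm_mul, mul_comm]
      exact mul_le_mul_of_nonneg_right ((Real.norm_eq_abs _).trans_le (hGM n v)) (norm_nonneg _)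
    · rw [hGs n v hv, mul_zero, norm_zero]
      positivity
  exact le_of_tendsto' hT.abs hbound

end Mollify

/-! ## Carleson `⇒` BMO -/

section BMO

variable {E : Type*} [NormedAddCommGroup E] [InnerProductSpace ℝ E] [FiniteDimensional ℝ E]
  [MeasurableSpace E] [BorelSpace E]

/-- `Real.sign` is measurable (piecewise constant on `(-∞,0)`, `{0}`, `(0,∞)`). [folklore] -/
theorem measurable_real_sign : Measurable Real.sign := by
  have h : Real.sign = fun r : ℝ => if r < 0 then (-1 : ℝ) else if 0 < r then 1 else 0 := by
    funext r
    rfl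
  rw [h]
  exact Measurable.ite measurableSet_Iio measurable_const
    (Measurable.ite measurableSet_Ioi measurable_const measurable_const)

/-- `|sign r| ≤ 1`. [folklore] -/
theorem abs_real_sign_le_one (r : ℝ) : |Real.sign r| ≤ 1 := by
  rcases Real.sign_apply_eq r with h | h | h <;> rw [h] <;> norm_num

/-- `sign r · r = |r|`. [folklore] -/
theorem real_sign_mul_self_eq_abs (r : ℝ) : Real.sign r * r = |r| := by
  rcases lt_trichotomy r 0 with h | rfl | h
  · rw [Real.sign_of_neg h, abs_of_neg h]
    ring
  · simp
  · rw [Real.sign_of_pos h, abs_of_pos h, one_mul]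

/-- **Mean oscillation by duality**: if `|∫ f g| ≤ K` for every measurable mean-zero `g` with
`|g| ≤ 2` vanishing off the ball `B`, then `∫_B |f - f_B| ≤ K`; test with
`g = 1_B (σ - σ_B)`, `σ = sign (f - f_B)`, using `∫_B (f - f_B) = 0`. [folklore] -/
theorem setIntegral_abs_sub_average_le {f : E → ℝ} {x₀ : E} {ρ K : ℝ} (hρ : 0 < ρ)
    (hf : IntegrableOn f (ball x₀ ρ))
    (hK : ∀ g : E → ℝ, AEStronglyMeasurable g volume → (∀ z, |g z| ≤ 2) →
      (∀ z, z ∉ ball x₀ ρ → g z = 0) → (∫ z, g z = 0) → |∫ v, f v * g v| ≤ K) :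
    ∫ v in ball x₀ ρ, |f v - ⨍ z in ball x₀ ρ, f z| ≤ K := by
  obtain ⟨c, hc⟩ : ∃ c : ℝ, c = ⨍ z in ball x₀ ρ, f z := ⟨_, rfl⟩
  rw [← hc]
  have hBfin : volume (ball x₀ ρ) ≠ ∞ := measure_ball_lt_top.ne
  have hBpos : 0 < volume.real (ball x₀ ρ) := by
    rw [measureReal_def]
    exact ENNReal.toReal_pos (measure_ball_pos volume x₀ hρ).ne' hBfin
  obtain ⟨σ, hσ⟩ : ∃ σ : E → ℝ, σ = fun v => Real.sign (f v - c) := ⟨_, rfl⟩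
  have hfi : Integrable f (volume.restrict (ball x₀ ρ)) := hf
  have hσm : AEStronglyMeasurable σ (volume.restrict (ball x₀ ρ)) := by
    rw [hσ]
    exact (measurable_real_sign.comp_aemeasurable
      (hfi.aestronglyMeasurable.aemeasurable.sub_const c)).aestronglyMeasurable
  have hσ1 : ∀ v, |σ v| ≤ 1 := fun v => by rw [hσ]; exact abs_real_sign_le_one _
  have hσabs : ∀ v, σ v * (f v - c) = |f v - c| := fun v => by
    rw [hσ]; exact real_sign_mul_self_eq_abs _
  have hci : Integrable (fun _ : E => c) (volume.restrict (ball x₀ ρ)) := integrableOn_const hBfin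
  have h1i : Integrable (fun _ : E => (1 : ℝ)) (volume.restrict (ball x₀ ρ)) :=
    integrableOn_const hBfin
  have hσi : Integrable σ (volume.restrict (ball x₀ ρ)) :=
    h1i.mono' hσm (Eventually.of_forall fun v => (Real.norm_eq_abs _).trans_le (hσ1 v))
  obtain ⟨σB, hσB⟩ : ∃ σB : ℝ, σB = ⨍ z in ball x₀ ρ, σ z := ⟨_, rfl⟩
  have hσB1 : |σB| ≤ 1 := by
    rw [hσB, setAverage_eq, smul_eq_mul, abs_mul, abs_inv, abs_of_pos hBpos]
    have h := norm_setIntegral_le_of_norm_le_const (μ := volume) (f := σ)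
      (measure_ball_lt_top (x := x₀) (r := ρ)) (fun v _ => (Real.norm_eq_abs _).trans_le (hσ1 v))
    rw [Real.norm_eq_abs, one_mul] at h
    calc (volume.real (ball x₀ ρ))⁻¹ * |∫ v in ball x₀ ρ, σ v|
        ≤ (volume.real (ball x₀ ρ))⁻¹ * volume.real (ball x₀ ρ) := by gcongr
      _ = 1 := inv_mul_cancel₀ hBpos.ne'
  have hσBint : ∫ v in ball x₀ ρ, σ v = volume.real (ball x₀ ρ) * σB := by
    rw [hσB, ← smul_eq_mul, measure_smul_setAverage _ hBfin]
  have hcint : ∫ v in ball x₀ ρ, f v = volume.real (ball x₀ ρ) * c := by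
    rw [hc, ← smul_eq_mul, measure_smul_setAverage _ hBfin]
  obtain ⟨g, hg⟩ : ∃ g : E → ℝ, g = (ball x₀ ρ).indicator fun v => σ v - σB := ⟨_, rfl⟩
  have hgm : AEStronglyMeasurable g volume := by
    rw [hg, aestronglyMeasurable_indicator_iff measurableSet_ball]
    exact hσm.sub aestronglyMeasurable_const
  have hg2 : ∀ z, |g z| ≤ 2 := by
    intro z
    by_cases hz : z ∈ ball x₀ ρ
    · rw [hg, Set.indicator_of_mem hz]
      calc |σ z - σB| ≤ |σ z| + |σB| := abs_sub _ _
        _ ≤ 1 + 1 := add_le_add (hσ1 z) hσB1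
        _ = 2 := by norm_num
    · rw [hg, Set.indicator_of_notMem hz, abs_zero]
      norm_num
  have hgs : ∀ z, z ∉ ball x₀ ρ → g z = 0 := fun z hz => by
    rw [hg]; exact Set.indicator_of_notMem hz _
  have hg0 : ∫ z, g z = 0 := by
    have hI : Integrable (fun v => σ v - σB) (volume.restrict (ball x₀ ρ)) :=
      hσi.sub (integrableOn_const hBfin)
    rw [hg, integral_indicator measurableSet_ball, integral_sub hσi (integrableOn_const hBfin),
      setIntegral_const, smul_eq_mul, hσBint]
    ring
  -- the key identity `∫ f g = ∫_B |f - f_B|`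
  have hfg : ∫ v, f v * g v = ∫ v in ball x₀ ρ, |f v - c| := by
    have h1 : (fun v => f v * g v) =
        (ball x₀ ρ).indicator (fun v => |f v - c| + (c * σ v - σB * f v)) := by
      funext v
      by_cases hv : v ∈ ball x₀ ρ
      · rw [hg, Set.indicator_of_mem hv, Set.indicator_of_mem hv, ← hσabs v]
        ring
      · rw [hg, Set.indicator_of_notMem hv, Set.indicator_of_notMem hv, mul_zero]
    rw [h1, integral_indicator measurableSet_ball]
    have hI1 : Integrable (fun v => |f v - c|) (volume.restrict (ball x₀ ρ)) := (hfi.sub hci).abs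
    have hI2 : Integrable (fun v => c * σ v) (volume.restrict (ball x₀ ρ)) := hσi.const_mul c
    have hI3 : Integrable (fun v => σB * f v) (volume.restrict (ball x₀ ρ)) := hfi.const_mul σB
    have hI23 : Integrable (fun v => c * σ v - σB * f v) (volume.restrict (ball x₀ ρ)) :=
      hI2.sub hI3
    rw [integral_add hI1 hI23, integral_sub hI2 hI3, integral_const_mul,
      integral_const_mul, hσBint, hcint]
    ring
  have h := hK g hgm hg2 hgs hg0
  rw [hfg] at h
  exact (le_abs_self _).trans h

/-- **(E) discharged: Carleson `⇒` BMO** (Fefferman–Stein 1972; Stein, *Harmonic Analysis*,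
IV §4.3–4.4; Grafakos, *Modern Fourier Analysis*, remark after Thm 3.3.8, here for the caloric
extension): a locally integrable `f` of Stein growth with
`sup_{x,R} R^{-d} ∫₀^{R²}∫_{B(x,R)} |∇e^{tΔ}f|² < ∞` has bounded mean oscillation. Proof: the
duality bound `|∫ f g| ≤ (A₁γ + A₂M²)ρ^d` for continuous mean-zero test functions
(`exists_abs_integral_mul_le`), extended to measurable ones by mollification, tested against
`g = 1_B (sign(f - f_B) - c_B)`. [cite: FeffermanStein1972, Theorem 3] -/
theorem memBMO_of_eCarlesonGradNorm_lt_top_holds :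
    memBMO_of_eCarlesonGradNorm_lt_top (E := E) := by
  intro f hf hfw hγ
  refine ⟨hf, ?_⟩
  obtain ⟨A₁, A₂, hA₁, hA₂, hA⟩ := exists_abs_integral_mul_le (E := E)
  obtain ⟨d, hd⟩ : ∃ d : ℕ, d = Module.finrank ℝ E := ⟨_, rfl⟩
  obtain ⟨K, hK⟩ : ∃ K : ℝ, K = (A₁ * (eCarlesonGradNorm f).toReal + A₂ * 2 ^ 2) * 2 ^ d :=
    ⟨_, rfl⟩
  have hK0 : 0 ≤ K := hK ▸ by positivity
  have key : ∀ (x₀ : E) {ρ : ℝ}, 0 < ρ →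
      ∫ v in ball x₀ ρ, |f v - ⨍ z in ball x₀ ρ, f z| ≤ K * ρ ^ d := by
    intro x₀ ρ hρ
    refine setIntegral_abs_sub_average_le hρ
      ((hf.integrableOn_isCompact (isCompact_closedBall x₀ ρ)).mono_set ball_subset_closedBall) ?_
    intro g hgm hg2 hgs hg0
    have h := abs_integral_mul_le_of_aestronglyMeasurable hA hfw hf hγ hgm hρ hg2 hgs hg0
    rw [← hd] at h
    calc |∫ v, f v * g v| ≤ (A₁ * (eCarlesonGradNorm f).toReal + A₂ * 2 ^ 2) * (2 * ρ) ^ d := h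
      _ = K * ρ ^ d := by rw [hK, mul_pow]; ring
  have hV : volume (ball (0 : E) 1) ≠ 0 := (measure_ball_pos volume (0 : E) one_pos).ne'
  have hbound : eBMOSeminorm f ≤ ENNReal.ofReal K / volume (ball (0 : E) 1) := by
    refine iSup_le fun x₀ => iSup₂_le fun ρ hρ => ?_
    have hfB : IntegrableOn f (ball x₀ ρ) :=
      (hf.integrableOn_isCompact (isCompact_closedBall x₀ ρ)).mono_set ball_subset_closedBall
    have hint : Integrable (fun v => f v - ⨍ z in ball x₀ ρ, f z) (volume.restrict (ball x₀ ρ)) :=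
      Integrable.sub hfB (integrableOn_const measure_ball_lt_top.ne)
    have hρd : ENNReal.ofReal (ρ ^ d) ≠ 0 := (ENNReal.ofReal_pos.mpr (pow_pos hρ d)).ne'
    have h1 : ∫⁻ y in ball x₀ ρ, ‖f y - ⨍ z in ball x₀ ρ, f z‖ₑ =
        ENNReal.ofReal (∫ y in ball x₀ ρ, |f y - ⨍ z in ball x₀ ρ, f z|) := by
      rw [← ofReal_integral_norm_eq_lintegral_enorm hint]
      simp_rw [Real.norm_eq_abs]
    have h2 : volume (ball x₀ ρ) = ENNReal.ofReal (ρ ^ d) * volume (ball (0 : E) 1) := by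
      rw [Measure.addHaar_ball_of_pos volume x₀ hρ, ← hd]
    rw [setLAverage_eq, h1, h2]
    calc ENNReal.ofReal (∫ y in ball x₀ ρ, |f y - ⨍ z in ball x₀ ρ, f z|) /
          (ENNReal.ofReal (ρ ^ d) * volume (ball (0 : E) 1))
        ≤ ENNReal.ofReal (K * ρ ^ d) / (ENNReal.ofReal (ρ ^ d) * volume (ball (0 : E) 1)) := by
          gcongr
          exact key x₀ hρ
      _ = ENNReal.ofReal K * ENNReal.ofReal (ρ ^ d) /
            (volume (ball (0 : E) 1) * ENNReal.ofReal (ρ ^ d)) := by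
          rw [ENNReal.ofReal_mul hK0, mul_comm (ENNReal.ofReal (ρ ^ d)) (volume _)]
      _ = ENNReal.ofReal K / volume (ball (0 : E) 1) :=
          ENNReal.mul_div_mul_right _ _ hρd ENNReal.ofReal_ne_top
  exact hbound.trans_lt (ENNReal.div_lt_top ENNReal.ofReal_ne_top hV)

end BMO

end BMOInv

/-! ## Koch–Tataru's Theorem 1 from John–Nirenberg and (D) -/

section KochTataru

universe u

variable {E : Type u} [NormedAddCommGroup E] [InnerProductSpace ℝ E] [FiniteDimensional ℝ E]
  [MeasurableSpace E] [BorelSpace E]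

open BMOInv in
/-- **Koch–Tataru's Theorem 1 with (A), (B), (C), (E) discharged**: the named fact
`Literature.Analysis.FunctionSpaces.memBMOInv_iff_carleson_heat` (Koch–Tataru 2001, Theorem 1) follows from the John–Nirenberg
inequality (`Literature.Analysis.FunctionSpaces.john_nirenberg`, John–Nirenberg 1961, Lemma 1') and Koch–Tataru's converse in
Carleson form (D) (`exists_hasWeakDivergenceRepresentation_of_eCarlesonNorm_lt_top`, Koch–Tataru
2001, Theorem 1 `⇐` with Lemma 4.1). [cite: KochTataruAdvMath2001, Theorem 1] -/
theorem memBMOInv_iff_carleson_heat_of_JN_D (hJN : john_nirenberg.{u, 0})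
    (hD : exists_hasWeakDivergenceRepresentation_of_eCarlesonNorm_lt_top (E := E)) :
    memBMOInv_iff_carleson_heat (E := E) :=
  memBMOInv_iff_carleson_heat_of_JN_D_E hJN hD memBMO_of_eCarlesonGradNorm_lt_top_holds

end KochTataru

end Literature.Analysis.FunctionSpaces
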